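import Literature.InformationTheory.Entanglement.GHZStabilizerWitness
import Literature.InformationTheory.Entanglement.UnentangledSpinsBound
import Literature.Computability.QuantumComplexity.GraphStateCutRank
import Mathlib.Combinatorics.SimpleGraph.Finite
import Mathlib.Combinatorics.SimpleGraph.Hasse
import HarnessLib

/-!
# Stabilizer and projector witnesses for graph states and the linear cluster state (Tóth–Gühne 2005, Theorems 6–7; Gühne–Tóth 2009 §6.6)

Topic `Literature/InformationTheory/Entanglement`, companion of `GHZStabilizerWitness.lean` (the GHZ
versions `𝟙 − g₁ − g_m`, `𝟙 − g₁ − g_m − g₁g_m` = Gühne–Tóth 2009 (150)–(152), section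
`FullSeparability`) in the same vocabulary (`pauliWord`, `productVec`, `bloch`, the fully separable
states `SpinSqueezing.IsSeparable`, `vecState`, `trState`).  Sources (held texts, read at the cited
places):

* G. Tóth, O. Gühne, *Entanglement detection in the stabilizer formalism*, Phys. Rev. A 72, 022340
  (2005) = arXiv:quant-ph/0501020 [TothGuhne2005Stabilizer].  §II: **Definition 1** (“Two correlation
  operators `K = ⊗_n K^{(n)}`, `L = ⊗_n L^{(n)}` commute locally if for every `n`:
  `K^{(n)}L^{(n)} = L^{(n)}K^{(n)}`”), **Theorem 1** (`𝒲_m^{(GHZ_N)} := 𝟙 − S₁ − S_m`; “The proof is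
  based on the Cauchy-Schwarz inequality. Using this and `⟨X^{(i)}⟩² + ⟨Z^{(i)}⟩² ≤ 1` …”) and its
  three-term companion (“`𝟙 − S₁ − S_m − S₁S_m` … rule out full separability … using the fact that
  `⟨X⟩² + ⟨Y⟩² + ⟨Z⟩² ≤ 1`”); **Definition 2** (“`ϱ(p_noise) := p_noise 𝟙/2^N + (1 − p_noise)|Ψ⟩⟨Ψ|`
  … the robustness to noise for a witness `𝒲` is determined by the maximal noise ratio for which it
  still detects `ϱ(p_noise)` as entangled”) with “witness `𝒲` detects `ϱ(p_noise)` as entangled if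
  `p_noise < p_limit` where `p_limit := −⟨GHZ_N|𝒲|GHZ_N⟩ / (2^{−N}Tr(𝒲) − ⟨GHZ_N|𝒲|GHZ_N⟩)`”;
  §III.A (PDF p. 8): “A cluster state `|C_N⟩` is defined to be the state fulfilling the equations
  `|C_N⟩ = S_k^{(C_N)}|C_N⟩` with the following stabilizing operators `S₁^{(C_N)} := X^{(1)}Z^{(2)}`,
  `S_k^{(C_N)} := Z^{(k−1)}X^{(k)}Z^{(k+1)}; k = 2, 3, …, N−1`, `S_N^{(C_N)} := Z^{(N−1)}X^{(N)}`.
  Witnesses … which rule out full separability can be constructed with two locally non-commuting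
  operators as `𝒲_k^{(C_N)} := 𝟙 − S_k^{(C_N)} − S_{k+1}^{(C_N)}` for `k = 1, 2, …, N−1`. … The proof
  is essentially the same as the one for [Theorem 1]. … The witness `𝒲_k^{(C_N)}` tolerates noise if
  `p_noise < 1/2`.  The following witnesses have a better noise tolerance
  `𝒲'_k^{(C_N)} := 𝟙 − S_k^{(C_N)} − S_{k+1}^{(C_N)} − S_k^{(C_N)}S_{k+1}^{(C_N)}` for `k = 1, …, N−1`.
  This witness still involves only the qubits of a quadruplet and tolerates noise if
  `p_noise < 2/3`”; §III.B: “Edges of this graph are described by the adjacency matrix `Γ` … one can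
  define the stabilizing operators `S_k^{(G_N)} := X^{(k)} Π_{neighbors l of k} Z^{(l)}`. Then, the
  graph state `|G_N⟩` is defined as the `N`-qubit state fulfilling `|G_N⟩ = S_k^{(G_N)}|G_N⟩`”;
  **Theorem 7.** “A witness detecting biseparable entanglement close to graph states can be given as
  `𝒲_{kl}^{(G_N)} := 𝟙 − S_k^{(G_N)} − S_l^{(G_N)}`, where the spins `(k)` and `(l)` are neighbors”
  … “and a witness detecting genuine `N`-party entanglement can be defined as
  `𝒲^{(G_N)} := (N−1)𝟙 − Σ_k S_k^{(G_N)}`” (Proof: “essentially the same as before. First one has to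
  show that `𝟙/2 − |G_N⟩⟨G_N|` is a witness for true multipartite entanglement. Then one can prove
  that [the] witnesses … detect also only genuine multipartite entanglement”; for the GHZ graph this is
  **Theorem 2**, “One can check that with this choice `𝒲 − 2𝒲̃_{GHZ_N} ≥ 0` … detects states mixed
  with noise … if `p_noise < 1/N`”); **Theorem 6.** “The witnesses
  `𝒲̃_{C_N} := 𝟙/2 − |C_N⟩⟨C_N|`, `𝒲_{C_N} := 3𝟙 − 2[Π_{odd k}(S_k+𝟙)/2 + Π_{even k}(S_k+𝟙)/2]`
  detect genuine `N`-party entanglement close to a cluster state” (Proof: “from a cluster state one can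
  generate a singlet between arbitrary qubits by local operations … the maximal Schmidt coefficient of
  a cluster state … does not exceed the maximal Schmidt coefficient of the singlet, which equals
  `1/√2`. Then … `𝒲̃_{C_N}` is a witness for multi-qubit entanglement. After that we have to prove
  that [`𝒲_{C_N}`] is a multi-qubit witness. This can be proved similarly as it has been done for
  Theorem 3 using that `𝒲_{C_N} − 2𝒲̃_{C_N} ≥ 0`”; after the proof: “tolerates mixing with noise if
  `p_noise < (4 − 4/2^{N/2})^{−1}` for even `N`, `[4 − 2(1/2^{(N+1)/2} + 1/2^{(N−1)/2})]^{−1}` for odd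
  `N`. Thus, for any number of qubits at least 25 % noise is tolerated”).
* O. Gühne, G. Tóth, Phys. Rep. 474 (2009) [GuhneToth2009], §3.4.3 eqs. (56)–(57) (graph-state
  stabilizers `g_i = X_i ⊗_{j∈N(i)} Z_j`, “`g_i|G⟩ = |G⟩` … the graph state `|G⟩` is uniquely
  determined by these eigenvalue equations”, “the state `|G⟩` can be produced from the product state
  `[(|0⟩ + |1⟩)/√2]^{⊗N}` by an Ising type interaction … between the connected qubits”), §6.6.2 eq.
  (142) (the cluster stabilizers), §6.6.5 (PDF p. 54): “This proof can straightforwardly be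
  generalized for arbitrary two locally non-commuting elements of the stabilizer of any graph state.
  … For the cluster state similar witnesses are `𝒲_k^{(C_N)} := 𝟙 − g_k^{(C_N)} − g_{k+1}^{(C_N)}`
  for `k = 1, 2, …, N−1`, and, with a better noise tolerance
  `𝒲̂_k^{(C_N)} := 𝟙 − g_k − g_{k+1} − g_k g_{k+1}` … Both witnesses involve only the qubits of a
  quadruplet and tolerate noise if `p_noise < 1/2` and `2/3`, respectively.”; §6.6.1 eq. (135)
  (`𝒲_stab − α𝒲 ≥ 0`) and eq. (137) (“the projector to `|Ψ⟩` can be written as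
  `|Ψ⟩⟨Ψ| = 2^{−N} Σ_k S_k = Π_{k=1}^N (𝟙 + g_k)/2`”), §6.6.2 eqs. (143)–(145) (the two-setting
  cluster witness, its tolerance “For large `N` the limit is `p_noise = 1/4`”, and “for a `k`-colorable
  graph state … `𝒲̃_{G_N} := 3𝟙 − 2[Σ_{j=1}^k (Π_{i∈M_j} (g_i + 𝟙)/2)]` … requires the measurement of
  `k` settings”).
* M. Hein, J. Eisert, H. J. Briegel, PRA 69, 062311 (2004) [HeinEisertBriegel2004], §2: the
  graph-state amplitudes `⟨x|G⟩ = 2^{−|V|/2} Π_{{a,b}∈E} (−1)^{x_a x_b}` (the `CZ`/Ising construction;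
  cf. `GraphStateCutRank.graphSign`).

HONEST FRAMING (pub-qadeq lane — cluster-state and graph-state ‘entanglement certified from two stabilizer
measurements’ statements in experimental papers): instance-level adjudication of specific advantage
claims; no claim about BQP vs BPP or the summit.  Nothing here concerns devices or statistics.

## Contents (all proved, 0 named facts)

Register `Fin N → Bool`; a graph is a Mathlib `SimpleGraph (Fin N)` with decidable adjacency.

* Pauli-word bookkeeping: `pauliWord_mul_apply` (entries of `(⊗σ_u)(⊗σ_w)` are products of the
  one-qubit products), `trace_pauliMat`, **`trace_pauliWord`** (`Tr ⊗_l σ_{w_l} = Π_l Tr σ_{w_l}`),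
  **`trace_pauliWord_mul`** (`Tr[(⊗σ_u)(⊗σ_w)] = Π_l 2[u_l = w_l]`).
* **`graphStab G k`** `= S_k^{(G_N)} = X^{(k)} ⊗_{l ∈ N(k)} Z^{(l)}` (the `pauliWord` with letters
  `stabLetter G k`); **`edgeParity G x`** `= Σ_{i<j, i∼j} x_i x_j ∈ 𝔽₂` and the graph state vector
  **`graphStateVec G`** `(x) = 2^{−N/2} (−1)^{edgeParity G x}`; the bit flip `flipAt`,
  **`edgeParity_flipAt`** (`q(x ⊕ e_k) = q(x) + Σ_{l∈N(k)} x_l`), **`graphStab_mulVec_apply`**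
  (`(S_kψ)(x) = Π_{l∈N(k)}(−1)^{x_l} ψ(x ⊕ e_k)`), hence the defining eigenvalue equations
  **`graphStab_mulVec_graphStateVec`** (`S_k|G⟩ = |G⟩` for every `k`) and `graphStateVec_norm`
  (`⟨G|G⟩ = 1`): the printed definition “the `N`-qubit state fulfilling `|G_N⟩ = S_k|G_N⟩`” is
  inhabited by the explicit vector.  `vecState_graphStab_graphStateVec` (`⟨S_k⟩_G = 1`),
  `vecState_graphStab_mul_graphStateVec` (`⟨S_kS_l⟩_G = 1`), `trace_graphStab` (`= 0`),
  `trace_graphStab_mul` (`= 0` for neighbours).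
* Product states: **`vecState_graphStab_productVec`** (`⟨S_k⟩ = ⟨X_k⟩ Π_{l∈N(k)} ⟨Z_l⟩`),
  **`vecState_graphStab_mul_productVec`** (for neighbours `k ∼ l`:
  `⟨S_kS_l⟩ = ⟨Y_k⟩⟨Y_l⟩ Π_{m ∈ (N(k) ∆ N(l))∖{k,l}} ⟨Z_m⟩`, via `X Z = −iY` on site `k` and
  `Z X = iY` on site `l`); the Cauchy–Schwarz bounds **`graphStab_add_productVec_le`**
  (`⟨S_k⟩ + ⟨S_l⟩ ≤ |⟨X_k⟩||⟨Z_l⟩| + |⟨Z_k⟩||⟨X_l⟩| ≤ 1`, the printed proof) and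
  **`graphStab_add_add_mul_productVec_le`** (`⟨S_k⟩ + ⟨S_l⟩ + ⟨S_kS_l⟩ ≤ 1`, from
  `⟨X⟩² + ⟨Y⟩² + ⟨Z⟩² = 1` on both sites — “The proof is similar”).
* **Theorem 7** (first witness): **`gsWitness G k l`** `= 𝒲_{kl}^{(G_N)} = 𝟙 − S_k − S_l` and the
  three-term **`gsWitness' G k l`** `= 𝟙 − S_k − S_l − S_kS_l`; on fully separable `ϱ` and
  neighbours `k ∼ l`: **`tothGuhne_theorem7`** (`Tr(ϱ𝒲_{kl}) ≥ 0`), **`graphStab_add_le_one`**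
  (`⟨S_k⟩_ϱ + ⟨S_l⟩_ϱ ≤ 1`), **`not_isSeparable_of_one_lt`**, **`graphStab_add_add_mul_le_one`**,
  `trState_gsWitness'_nonneg`.
* White noise, Definition 2: **`noisyState ψ p`** `= p𝟙/2^N + (1−p)|ψ⟩⟨ψ|` (`noisyState_ghzN`:
  the tree's `noisyGHZ` is the case `ψ = GHZ_N`), **`trState_noisyState`**
  (`Tr(𝒲ϱ(p)) = p·2^{−N}Tr 𝒲 + (1−p)⟨ψ|𝒲|ψ⟩`) and the printed **`noisyState_detected_iff`**
  (`Tr(𝒲ϱ(p)) < 0 ↔ p < p_limit = −⟨ψ|𝒲|ψ⟩/(2^{−N}Tr 𝒲 − ⟨ψ|𝒲|ψ⟩)`); for graph states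
  **`trState_gsWitness_noisy`** (`= 2p − 1`), **`gsWitness_detects_iff`** (iff `p < 1/2`),
  **`trState_gsWitness'_noisy`** (`= 3p − 2`), **`gsWitness'_detects_iff`** (iff `p < 2/3`),
  **`not_isSeparable_noisy_graphState`** (`p < 2/3`, any edge).
* The linear cluster state (§III.A; GT09 (142)): **`chainGraph N`** (nearest neighbours on `Fin N`;
  `chainGraph_eq_pathGraph` identifies it with Mathlib's `SimpleGraph.pathGraph N`),
  **`clusterStab N k`** with the printed letters **`clusterStab_eq`**
  (`Z^{(k−1)}X^{(k)}Z^{(k+1)}`, end cases included), **`clusterVec N`** `= |C_N⟩` with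
  **`clusterStab_mulVec_clusterVec`** (`S_k|C_N⟩ = |C_N⟩`), `clusterVec_norm`; the printed witnesses
  **`clusterWitness i`** `= 𝒲_k^{(C_N)}` and **`clusterWitness' i`** `= 𝒲'_k^{(C_N)}` (`N = n+1`,
  `k = i.castSucc`, `k+1 = i.succ`, so `k = 1, …, N−1`), **`trState_clusterWitness_nonneg`**,
  **`trState_clusterWitness'_nonneg`**, **`clusterStab_add_le_one`**, and the printed tolerances
  **`clusterWitness_detects_iff`** (iff `p < 1/2`), **`clusterWitness'_detects_iff`** (iff `p < 2/3`),
  **`not_isSeparable_noisyCluster`**.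

* (v2, sections `PauliWordOn` … and the GME part) **the projector witness `𝒲̃_{G_N} = 𝟙/2 − |G_N⟩⟨G_N|`
  for the graph state of any CONNECTED graph, i.e. Theorem 6's
  `𝒲̃_{C_N}` and the first step of Theorem 7's proof**: for Pauli strings on an arbitrary finite
  register (`UnentangledSpins.pauliWordOn` of `UnentangledSpinsBound.lean`, reused with its cut calculus
  `pauliWord_mulVec_tensorAcross`, `star_tensorAcross_dotProduct`) the product rules
  `pauliWordOn_mul_apply`, `pauliWordOn_mul_self`, **`pauliWordOn_anticomm`** (one locally
  anticommuting site ⟹ anticommute), `pauliWordOn_comm_of_local`, `pauliWordOn_comm_of_two`;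
  **`graphStab_comm`** (the generators commute), `stabPairOp G i j = (𝟙+S_i)(𝟙+S_j)` with
  `stabPairOp_mulVec_graphStateVec` (`= 4|G_N⟩`), `conjTranspose_stabPairOp`, `stabPairOp_mul_self`
  (`Q² = 4Q`), the Cauchy–Schwarz inequality `normSq_star_dotProduct_le`, **`normSq_overlap_le_stabPair`**
  (`|⟨G_N|φ⟩|² ≤ ¼⟨φ|(𝟙+S_i)(𝟙+S_j)|φ⟩` for every `φ`, i.e. `|G_N⟩⟨G_N| ≤ (𝟙+S_i)(𝟙+S_j)/4`),
  **`sq_expect_triple_le`** (Bloch ball for an anticommuting triple `K, L, −iKL`: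
  `⟨K⟩² + ⟨L⟩² + ⟨−iKL⟩² ≤ ⟨a|a⟩²`), the factorised expectations
  `star_dotProduct_pauliWord_mulVec_tensorAcross` / `star_dotProduct_pauliWord_mul_mulVec_tensorAcross`,
  **`stab_three_le_of_cut`** (edge `i ∼ j` across `A | Ā`: `⟨S_i⟩ + ⟨S_j⟩ + ⟨S_iS_j⟩ ≤ ⟨φ|φ⟩` on
  `|a⟩_A ⊗ |b⟩_Ā`), **`normSq_graphState_overlap_le`** (`|⟨G_N|a⊗b⟩|² ≤ ½‖a⊗b‖²` across a crossed
  cut), **`exists_adj_across_of_connected`** (every proper cut of a connected graph is crossed by an edge; Mathlib's `Walk.exists_boundary_dart`),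
  `graphFidelity`, **`graphProjWitness`**, **`graphFidelity_le_half`** (`⟨G_N|ϱ|G_N⟩ ≤ 1/2` on
  biseparable `ϱ`), **`not_isBiseparable_of_half_lt_graphFidelity`** (`F > 1/2 ⟹` GME),
  `trState_graphProjWitness` / **`trState_graphProjWitness_nonneg`**, `graphFidelity_graphState` (`= 1`),
  **`not_isBiseparable_graphState`**; for the chain: `chainGraph_connected`,
  `clusterFidelity`, **`clusterFidelity_le_half`**, **`not_isBiseparable_of_half_lt_clusterFidelity`**,
  **`not_isBiseparable_clusterVec`** (`|C_N⟩` is genuinely `N`-partite entangled).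
* (v2, part 2: sections `StabProj`, `Comparison` and after) **GT09 (137) `|G_N⟩⟨G_N| = Π_k(𝟙+S_k)/2`,
  Theorem 6's two-setting witness and Theorem 7's `(N−1)𝟙 − Σ_k S_k`**: the partial products
  **`stabProj G T`** `= Π_G(T) = Π_{k∈T}(𝟙+S_k)/2` in closed form (`stabProj_apply`:
  `2^{−|T|}χ_G(x)χ_G(y)[x = y off T]`), `stabProj_empty` (`= 𝟙`), **`stabProj_univ`** (`= |G_N⟩⟨G_N|`,
  eq. (137)), `conjTranspose_stabProj`, `trace_stabProj` (`= 2^N 2^{−|T|}`), `graphStab_mul_apply`,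
  `sign_mul_chi_flipAt`, **`half_one_add_graphStab_mul_stabProj`** (`(𝟙+S_k)/2·Π_G(T) = Π_G(T∪{k})`),
  **`stabProj_singleton`** (`Π_G({k}) = (𝟙+S_k)/2`), `graphStab_eq_stabProj`, `stabProj_singleton_mul`,
  **`stabProj_mul_stabProj`** (`Π_G(T)Π_G(U) = Π_G(T∪U)`), `stabProj_mul_self`, `stabProj_comm`,
  `stabProj_mulVec_graphStateVec`; **`vecState_add_le_of_commuting_proj`** (`⟨A⟩ + ⟨B⟩ ≤ ⟨𝟙⟩ + ⟨AB⟩`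
  for commuting projectors), **`sum_vecState_stabProj_singleton_le`**
  (`Σ_{k∈T}⟨Π_G({k})⟩ ≤ (|T|−1)⟨𝟙⟩ + ⟨Π_G(T)⟩`), **`sum_vecState_graphStab_le`**
  (`Σ_k⟨S_k⟩ ≤ (N−2)⟨φ|φ⟩ + 2|⟨G_N|φ⟩|²`); Theorem 7: **`gsSumWitness G`** `= (N−1)𝟙 − Σ_k S_k`,
  `vecState_`/`trState_gsSumWitness`, `vecState_graphProjWitness`,
  **`two_mul_vecState_graphProjWitness_le_gsSumWitness`** (`𝒲^{(G_N)} − 2𝒲̃ ≥ 0`),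
  **`tothGuhne_theorem7_gme`** (`Tr(ϱ𝒲^{(G_N)}) ≥ 0` on biseparable `ϱ`, connected `G`),
  **`not_isBiseparable_of_sum_graphStab_gt`** (`Σ_k⟨S_k⟩_ϱ > N−1 ⟹` GME),
  `vecState_gsSumWitness_graphStateVec` (`= −1`), `trace_gsSumWitness`, **`trState_gsSumWitness_noisy`**
  (`= Np − 1`), **`gsSumWitness_detects_iff`** (iff `p < 1/N`); Theorem 6 / GT09 (145) with two
  colours: **`twoSettingWitness G T`** `= 3·𝟙 − 2[Π_G(T) + Π_G(Tᶜ)]`, `vecState_`/`trState_twoSettingWitness`,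
  **`two_mul_vecState_graphProjWitness_le_twoSettingWitness`** (`𝒲₂ − 2𝒲̃ ≥ 0`),
  **`twoSettingWitness_nonneg_of_isBiseparable`** (any bipartition `T | Tᶜ`, connected `G`),
  **`not_isBiseparable_of_stabProj_add_gt`** (`⟨Π_G(T)⟩ + ⟨Π_G(Tᶜ)⟩ > 3/2 ⟹` GME),
  `vecState_stabProj_graphStateVec`, `vecState_twoSettingWitness_graphStateVec` (`= −1`),
  `trace_twoSettingWitness`, **`trState_twoSettingWitness_noisy`**
  (`= p[4 − 2(2^{−|T|} + 2^{−|Tᶜ|})] − 1`), **`twoSettingWitness_detects_iff`**,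
  **`not_isBiseparable_noisy_graphState_of_lt_quarter`** (“at least 25 % noise is tolerated”); the
  cluster state: **`oddSites N`**, **`clusterTwoSettingWitness N`** `= 𝒲_{C_N}`,
  `chainGraph_connected_of_pos`, **`tothGuhne_theorem6`**, **`not_isBiseparable_of_cluster_stabProj_add_gt`**,
  `card_oddSites` (`= ⌈N/2⌉`), `card_oddSites_compl` (`= ⌊N/2⌋`),
  **`trState_clusterTwoSettingWitness_noisy`**, **`clusterTwoSettingWitness_detects_iff`** with the
  printed even/odd forms **`clusterTwoSettingWitness_detects_iff_even`** (`(4 − 4/2^{N/2})^{−1}`) and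
  **`clusterTwoSettingWitness_detects_iff_odd`** (`[4 − 2(2^{−(N+1)/2} + 2^{−(N−1)/2})]^{−1}`),
  **`not_isBiseparable_noisyCluster_of_lt_quarter`**, `cluster_gsSumWitness_nonneg_of_isBiseparable`,
  `cluster_gsSumWitness_detects_iff` (iff `p < 1/N`).
* (v2, part 3) **fidelity estimation from the stabilizer data** (TG05 §III.C last sentence
  “Bounds can be obtained similarly for the fidelity with respect to the cluster state based on
  `|C_N⟩⟨C_N| ≥ ½ − ½𝒲_{C_N}`”; GT09 §6.6.4 “the stabilizer witness allows to give a lower bound on the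
  fidelity via `F ≥ (1 − ⟨𝒲̃⟩)/2`”): `stabProj_add_sub_norm_le_overlap`, **`graphFidelity_ge_stabProj_add`**
  (`F_G(ϱ) ≥ Tr(ϱΠ_G(T)) + Tr(ϱΠ_G(Tᶜ)) − Tr ϱ`, every mixture of pure states, every graph, every `T`),
  `graphFidelity_ge_half_sub_twoSettingWitness`, **`graphFidelity_ge_sum_graphStab`**
  (`F_G(ϱ) ≥ (Σ_k Tr(ϱS_k) − (N−2)Tr ϱ)/2`), `graphFidelity_ge_half_sub_gsSumWitness`,
  **`clusterFidelity_ge_stabProj_add`**; **the bridge to `GraphStateCutRank.lean`**: `bitZ_eq_one_iff`,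
  **`edgeParity_eq_litEdgeCount`** (`q_G(x) = #E(G[supp x]) mod 2`), **`graphStateVec_eq_graphSign`**
  (`⟨x|G_N⟩ = 2^{−N/2}·graphSign G x` — the same vector as in Hein–Eisert–Briegel's Schmidt-rank file);
  **uniqueness** (GT09 §3.4.3 “the graph state `|G⟩` is uniquely determined by these eigenvalue
  equations”): `stabProj_mulVec_of_forall_stab`, **`graphState_unique`** (`S_kψ = ψ ∀k ⟹ ψ = ⟨G_N|ψ⟩|G_N⟩`),
  `normSq_overlap_eq_one_of_forall_stab`.

Deviations, flagged: the three-term bound is printed for the GHZ and cluster states; we prove it (same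
Cauchy–Schwarz step) for any pair of neighbouring vertices of any graph (`gsWitness'`) and specialise.
The overlap bound `1/2` behind the projector witness is printed via the maximal Schmidt coefficient
(“from a cluster state one can generate a singlet between arbitrary qubits by local operations”); OUR
ROUTE is the operator inequality `|G_N⟩⟨G_N| ≤ (𝟙+S_i)(𝟙+S_j)/4` plus local anticommutation across the
cut (section docstring below).  The partial stabilizer products `Π_{k∈T}(𝟙+S_k)/2` are defined by
their closed form and the comparisons `𝒲 − 2𝒲̃ ≥ 0` are proved as quadratic-form inequalities via
`A + B ≤ 𝟙 + AB` for commuting projectors (section docstring of part 2); the two-setting witness is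
proved for every vertex bipartition (the measurability of each product with one local setting, i.e.
the colouring, is not formalised).  NOT formalised: Theorem 5 (composite witness), the optimality
clause of Theorem 6 (Appendix B), GT09 (145) for `k ≥ 3` colours, Definition 1 / Observation 1 as
such, the local-unitary form (60) of `|CL₄⟩`, and graphs with an uncrossed cut (disconnected: `|G_N⟩`
is then a product across it).

## Mathlib / tree search

`lean search 'graphState|clusterState|cluster state'`: only `GraphStateCutRank.lean` (Schmidt rank of a
graph state across a cut; its `chi = (−1)^a` on `𝔽₂` is reused here) — no stabilizers, no witnesses.
`UnentangledSpinsBound.lean` supplies Pauli strings on any finite register (`pauliWordOn`) and the cut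
calculus (`tensorAcross` factorisation of words and inner products), reused from v2 on.
Mathlib: `SimpleGraph.pathGraph` / `pathGraph_adj` (no `DecidableRel` instance for its adjacency, whence
`chainGraph`), `SimpleGraph.neighborFinset`, `Finset.symmDiff`.
-/

namespace Literature.InformationTheory.Entanglement

namespace GraphStateWitness

open Matrix Complex Finset
open Literature.Computability.QuantumComplexity
open Literature.Computability.QuantumComplexity.GraphStateCutRank
open Literature.InformationTheory.Entanglement.Tsirelson
open GHZWitness MerminKlyshkoGHZ SpinSqueezing GHZStabilizerWitness UnentangledSpins

variable {N : ℕ}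

/-! ## Pauli-word bookkeeping: entries of products, traces -/

/-- `σ_𝟙 = 𝟙` as a matrix. [cite: TothGuhne2005Stabilizer, §III.B (the letters of `S_k^{(G_N)}`)] -/
private theorem pauliI_mat : (Pauli.I).mat = (1 : Matrix Bool Bool ℂ) := rfl

/-- Entries of a product of two Pauli strings: `[(⊗σ_u)(⊗σ_w)]_{xz} = Π_l (σ_{u_l}σ_{w_l})_{x_l z_l}`.
[cite: TothGuhne2005Stabilizer, Definition 1 (correlation operators `K = ⊗_n K^{(n)}`)] -/
theorem pauliWord_mul_apply (u w : Fin N → Pauli) (x z : Fin N → Bool) :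
    (pauliWord u * pauliWord w) x z = ∏ l, ((u l).mat * (w l).mat) (x l) (z l) := by
  rw [Matrix.mul_apply]
  simp only [pauliWord_apply]
  have h : ∀ y : Fin N → Bool, (∏ j, (u j).mat (x j) (y j)) * (∏ j, (w j).mat (y j) (z j)) =
      ∏ j, (u j).mat (x j) (y j) * (w j).mat (y j) (z j) :=
    fun y => (Finset.prod_mul_distrib).symm
  simp_rw [h]
  rw [← Fintype.piFinset_univ, ← Finset.prod_univ_sum (fun _ => (Finset.univ : Finset Bool))
    (fun j b => (u j).mat (x j) b * (w j).mat b (z j))]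
  refine Finset.prod_congr rfl fun j _ => ?_
  rw [Matrix.mul_apply]

/-- `Tr σ_𝟙 = 2`, `Tr σ_x = Tr σ_y = Tr σ_z = 0`. [cite: TothGuhne2005Stabilizer, Definition 2
(the white-noise term `𝟙/2^N`)] -/
theorem trace_pauliMat (Q : Pauli) : (Q.mat).trace = if Q = Pauli.I then 2 else 0 := by
  rw [Matrix.trace, Fintype.sum_bool, Matrix.diag_apply, Matrix.diag_apply]
  cases Q <;> norm_num <;> decide

/-- **`Tr ⊗_l σ_{w_l} = Π_l Tr σ_{w_l}`.** [cite: TothGuhne2005Stabilizer, Definition 2 (`2^{−N}Tr(𝒲)`)] -/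
theorem trace_pauliWord (w : Fin N → Pauli) : (pauliWord w).trace = ∏ l, ((w l).mat).trace := by
  simp only [Matrix.trace, Matrix.diag_apply, pauliWord_apply]
  rw [← Fintype.piFinset_univ, ← Finset.prod_univ_sum (fun _ => (Finset.univ : Finset Bool))
    (fun j b => (w j).mat b b)]

/-- **`Tr[(⊗σ_u)(⊗σ_w)] = Π_l 2[u_l = w_l]`** (trace orthogonality of Pauli strings).
[cite: TothGuhne2005Stabilizer, Definition 2 (`2^{−N}Tr(𝒲)`)] -/
theorem trace_pauliWord_mul (u w : Fin N → Pauli) :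
    (pauliWord u * pauliWord w).trace = ∏ l, (if u l = w l then (2 : ℂ) else 0) := by
  simp only [Matrix.trace, Matrix.diag_apply, pauliWord_mul_apply]
  rw [← Fintype.piFinset_univ, ← Finset.prod_univ_sum (fun _ => (Finset.univ : Finset Bool))
    (fun j b => ((u j).mat * (w j).mat) b b)]
  refine Finset.prod_congr rfl fun j _ => ?_
  rw [← Pauli.trace_mat_mul_mat, Matrix.trace]
  rfl

/-! ## Bits in `𝔽₂`, the flip of one bit -/

/-- A bit read in `𝔽₂`. [cite: TothGuhne2005Stabilizer, §III.B (adjacency matrix `Γ_{kl} ∈ {0,1}`)] -/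
def bitZ (b : Bool) : ZMod 2 := if b then 1 else 0

/-- Flip bit `k` of the label `x`: `x ⊕ e_k`. [cite: GuhneToth2009, §3.4.3 eq. (56) (the `X_i` of `g_i`)] -/
def flipAt (k : Fin N) (x : Fin N → Bool) : Fin N → Bool := Function.update x k (!x k)

/-- `(x ⊕ e_k)_k = x̄_k`. [cite: GuhneToth2009, §3.4.3 eq. (56)] -/
@[simp] theorem flipAt_apply_self (k : Fin N) (x : Fin N → Bool) : flipAt k x k = !x k := by
  simp [flipAt]

/-- `(x ⊕ e_k)_l = x_l` for `l ≠ k`. [cite: GuhneToth2009, §3.4.3 eq. (56)] -/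
@[simp] theorem flipAt_apply_of_ne {k l : Fin N} (h : l ≠ k) (x : Fin N → Bool) :
    flipAt k x l = x l := by
  simp [flipAt, h]

/-- `x̄ = x + 1` in `𝔽₂`. [cite: TothGuhne2005Stabilizer, §III.B] -/
theorem bitZ_not (b : Bool) : bitZ (!b) = bitZ b + 1 := by
  cases b <;> decide

/-- `(x ⊕ e_k)_l = x_l + [l = k]` in `𝔽₂`. [cite: GuhneToth2009, §3.4.3 eq. (56)] -/
theorem bitZ_flipAt (k l : Fin N) (x : Fin N → Bool) :
    bitZ (flipAt k x l) = bitZ (x l) + if l = k then 1 else 0 := by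
  by_cases h : l = k
  · subst h; rw [flipAt_apply_self, bitZ_not, if_pos rfl]
  · rw [flipAt_apply_of_ne h, if_neg h, add_zero]

/-- `(−1)^{x} = ∓1` for a bit. [cite: HeinEisertBriegel2004, §2 (`(−1)^{x_a x_b}`)] -/
theorem chi_bitZ (b : Bool) : (chi (bitZ b) : ℂ) = if b then -1 else 1 := by
  cases b <;> simp [chi, bitZ, ZMod.val_one]

/-- `(−1)^{Σ_l a_l} = Π_l (−1)^{a_l}`. [cite: HeinEisertBriegel2004, §2 (`Π_{{a,b}∈E} (−1)^{x_a x_b}`)] -/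
theorem chi_sum {ι : Type*} [DecidableEq ι] (s : Finset ι) (f : ι → ZMod 2) :
    (chi (∑ l ∈ s, f l) : ℂ) = ∏ l ∈ s, chi (f l) := by
  refine Finset.induction_on s (by simp) ?_
  intro a s ha ih
  rw [Finset.sum_insert ha, Finset.prod_insert ha, chi_add, ih]

/-- `(−1)^a` is real: `star χ(a) = χ(a)`. [cite: HeinEisertBriegel2004, §2] -/
theorem star_chi (a : ZMod 2) : star (chi a : ℂ) = chi a := by
  rw [chi, star_pow, star_neg, star_one]

/-! ## Graph-state stabilizers `S_k^{(G_N)} = X^{(k)} ⊗_{l ∈ N(k)} Z^{(l)}` and the graph state -/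

variable (G : SimpleGraph (Fin N)) [DecidableRel G.Adj]

/-- The letters of `S_k^{(G_N)}`: `X` at `k`, `Z` at the neighbours of `k`, `𝟙` elsewhere.
[cite: TothGuhne2005Stabilizer, §III.B (`S_k^{(G_N)} := X^{(k)} Π_{neighbors l of k} Z^{(l)}`);
GuhneToth2009, §3.4.3 eq. (56)] -/
def stabLetter (k l : Fin N) : Pauli :=
  if l = k then Pauli.X else if G.Adj k l then Pauli.Z else Pauli.I

/-- **The graph-state stabilizer `S_k^{(G_N)} = X^{(k)} Π_{l ∈ N(k)} Z^{(l)}`** (= `g_k` of GT09 (56)).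
[cite: TothGuhne2005Stabilizer, §III.B; GuhneToth2009, §3.4.3 eq. (56)] -/
noncomputable def graphStab (k : Fin N) : Matrix (Fin N → Bool) (Fin N → Bool) ℂ :=
  pauliWord (stabLetter G k)

/-- `S_k` is Hermitian. [cite: TothGuhne2005Stabilizer, §III.B] -/
theorem graphStab_isHermitian (k : Fin N) : (graphStab G k).IsHermitian :=
  pauliWord_isHermitian _

/-- `S_k² = 𝟙`. [cite: TothGuhne2005Stabilizer, §III.B] -/
theorem graphStab_mul_self (k : Fin N) : graphStab G k * graphStab G k = 1 :=
  pauliWord_mul_self _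

/-- The edge parity `q_G(x) = Σ_{i<j, i∼j} x_i x_j ∈ 𝔽₂` — the number, mod 2, of edges of `G` both
of whose endpoints carry bit `1` (the exponent of `⟨x|G⟩ ∝ Π_{{a,b}∈E}(−1)^{x_a x_b}`).
[cite: HeinEisertBriegel2004, §2; GuhneToth2009, §3.4.3 (Ising interaction “between the connected
qubits”)] -/
def edgeParity (x : Fin N → Bool) : ZMod 2 :=
  ∑ i, ∑ j, (if i < j ∧ G.Adj i j then (1 : ZMod 2) else 0) * (bitZ (x i) * bitZ (x j))

/-- **The graph state vector** `|G_N⟩ = 2^{−N/2} Σ_x (−1)^{q_G(x)} |x⟩` (the state “produced from the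
product state `[(|0⟩+|1⟩)/√2]^{⊗N}` by an Ising type interaction … between the connected qubits”; that
it fulfils the printed defining equations `S_k|G_N⟩ = |G_N⟩` is `graphStab_mulVec_graphStateVec`).
[cite: TothGuhne2005Stabilizer, §III.B (“the graph state `|G_N⟩` is defined as the `N`-qubit state
fulfilling `|G_N⟩ = S_k^{(G_N)}|G_N⟩`”); GuhneToth2009, §3.4.3 eqs. (57)–(58); HeinEisertBriegel2004, §2] -/
noncomputable def graphStateVec : (Fin N → Bool) → ℂ := fun x =>
  (CHSHOpt.invSqrtTwo : ℂ) ^ N * chi (edgeParity G x)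

/-- The algebra of one bit flip in the quadratic form: for any coefficients `c` and vector `v` over
`𝔽₂`, `Σ_{ij} c_{ij}(v_i + δ_{ik})(v_j + δ_{jk}) = Σ_{ij} c_{ij}v_iv_j + Σ_l (c_{lk} + c_{kl})v_l + c_{kk}`.
[cite: HeinEisertBriegel2004, §2 (“arithmetic … modulo 2”)] -/
private theorem sum_sum_flip (c : Fin N → Fin N → ZMod 2) (v : Fin N → ZMod 2) (k : Fin N) :
    ∑ i, ∑ j, c i j * ((v i + if i = k then 1 else 0) * (v j + if j = k then 1 else 0)) =
      ∑ i, ∑ j, c i j * (v i * v j) + (∑ l, (c l k + c k l) * v l + c k k) := by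
  have hsplit : ∑ i, ∑ j, c i j * ((v i + if i = k then 1 else 0) * (v j + if j = k then 1 else 0)) =
      ∑ i, ∑ j, c i j * (v i * v j) + ∑ i, ∑ j, c i j * (v i * if j = k then 1 else 0) +
        ∑ i, ∑ j, c i j * ((if i = k then 1 else 0) * v j) +
        ∑ i, ∑ j, c i j * ((if i = k then 1 else 0) * if j = k then 1 else 0) := by
    simp only [← Finset.sum_add_distrib]
    refine Finset.sum_congr rfl fun i _ => Finset.sum_congr rfl fun j _ => by ring
  have h2 : ∑ i, ∑ j, c i j * (v i * if j = k then 1 else 0) = ∑ i, c i k * v i := by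
    refine Finset.sum_congr rfl fun i _ => ?_
    rw [Finset.sum_eq_single k]
    · rw [if_pos rfl, mul_one]
    · intro j _ hj; rw [if_neg hj, mul_zero, mul_zero]
    · intro h; exact absurd (Finset.mem_univ k) h
  have h3 : ∑ i, ∑ j, c i j * ((if i = k then 1 else 0) * v j) = ∑ j, c k j * v j := by
    rw [Finset.sum_eq_single k]
    · exact Finset.sum_congr rfl fun j _ => by rw [if_pos rfl, one_mul]
    · intro i _ hi; exact Finset.sum_eq_zero fun j _ => by rw [if_neg hi, zero_mul, mul_zero]
    · intro h; exact absurd (Finset.mem_univ k) h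
  have h4 : ∑ i, ∑ j, c i j * ((if i = k then 1 else 0) * if j = k then 1 else 0) = c k k := by
    rw [Finset.sum_eq_single k]
    · rw [Finset.sum_eq_single k]
      · rw [if_pos rfl, mul_one, mul_one]
      · intro j _ hj; rw [if_neg hj, mul_zero, mul_zero]
      · intro h; exact absurd (Finset.mem_univ k) h
    · intro i _ hi; exact Finset.sum_eq_zero fun j _ => by rw [if_neg hi, zero_mul, mul_zero]
    · intro h; exact absurd (Finset.mem_univ k) h
  have h5 : ∑ i, c i k * v i + ∑ j, c k j * v j = ∑ l, (c l k + c k l) * v l := by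
    rw [← Finset.sum_add_distrib]
    refine Finset.sum_congr rfl fun l _ => by ring
  rw [hsplit, h2, h3, h4, add_assoc (∑ i, ∑ j, c i j * (v i * v j)), h5, add_assoc]

/-- **One bit flip changes the edge parity by the lit neighbours**:
`q_G(x ⊕ e_k) = q_G(x) + Σ_{l ∈ N(k)} x_l` in `𝔽₂`. [cite: HeinEisertBriegel2004, §2 (the `CZ`
phases); GuhneToth2009, §3.4.3 eqs. (56)–(57)] -/
theorem edgeParity_flipAt (k : Fin N) (x : Fin N → Bool) :
    edgeParity G (flipAt k x) = edgeParity G x + ∑ l ∈ G.neighborFinset k, bitZ (x l) := by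
  unfold edgeParity
  simp_rw [bitZ_flipAt k]
  rw [sum_sum_flip]
  congr 1
  have hkk : (if k < k ∧ G.Adj k k then (1 : ZMod 2) else 0) = 0 := by
    rw [if_neg]; exact fun h => lt_irrefl _ h.1
  rw [hkk, add_zero]
  have hset : G.neighborFinset k = Finset.univ.filter (fun l => G.Adj k l) := by
    ext l; simp [SimpleGraph.mem_neighborFinset]
  rw [hset, Finset.sum_filter]
  refine Finset.sum_congr rfl fun l _ => ?_
  rcases lt_trichotomy l k with h | h | h
  · have hkl : ¬ k < l := not_lt.mpr h.le
    by_cases ha : G.Adj k l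
    · have ha' : G.Adj l k := ha.symm
      simp [h, hkl, ha, ha']
    · have ha' : ¬ G.Adj l k := fun h' => ha h'.symm
      simp [h, hkl, ha, ha']
  · subst h
    simp
  · have hlk : ¬ l < k := not_lt.mpr h.le
    by_cases ha : G.Adj k l
    · simp [h, hlk, ha]
    · simp [h, hlk, ha]

/-- **The action of `S_k` in the computational basis**:
`(S_k ψ)(x) = [Π_{l ∈ N(k)} (−1)^{x_l}] · ψ(x ⊕ e_k)` (`X^{(k)}` flips bit `k`, each `Z^{(l)}` reads
the sign of bit `l`). [cite: TothGuhne2005Stabilizer, §III.B; GuhneToth2009, §3.4.3 eq. (56)] -/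
theorem graphStab_mulVec_apply (k : Fin N) (ψ : (Fin N → Bool) → ℂ) (x : Fin N → Bool) :
    (graphStab G k *ᵥ ψ) x =
      (∏ l ∈ G.neighborFinset k, (if x l then (-1 : ℂ) else 1)) * ψ (flipAt k x) := by
  rw [graphStab, mulVec, dotProduct]
  simp_rw [pauliWord_apply]
  rw [Finset.sum_eq_single (flipAt k x)]
  · congr 1
    rw [← Finset.mul_prod_erase Finset.univ _ (Finset.mem_univ k)]
    have hk : (stabLetter G k k).mat (x k) (flipAt k x k) = 1 := by
      rw [flipAt_apply_self, stabLetter, if_pos rfl, Pauli.mat_X_apply]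
      cases x k <;> simp
    rw [hk, one_mul]
    have hl : ∀ l ∈ Finset.univ.erase k, (stabLetter G k l).mat (x l) (flipAt k x l) =
        if G.Adj k l then (if x l then (-1 : ℂ) else 1) else 1 := by
      intro l hl
      have hne : l ≠ k := Finset.ne_of_mem_erase hl
      rw [flipAt_apply_of_ne hne, stabLetter, if_neg hne]
      by_cases ha : G.Adj k l
      · rw [if_pos ha, if_pos ha, Pauli.mat_Z_apply, if_pos rfl]
      · rw [if_neg ha, if_neg ha, Pauli.mat_I_apply, if_pos rfl]
    rw [Finset.prod_congr rfl hl, Finset.prod_ite, Finset.prod_const_one, mul_one]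
    congr 1
    ext l
    simp only [Finset.mem_filter, Finset.mem_erase, Finset.mem_univ, and_true,
      SimpleGraph.mem_neighborFinset]
    exact ⟨fun h => h.2, fun h => ⟨(G.ne_of_adj h).symm, h⟩⟩
  · intro y _ hy
    by_cases hyk : y k = x k
    · exact mul_eq_zero_of_left (Finset.prod_eq_zero (Finset.mem_univ k)
        (by rw [stabLetter, if_pos rfl, Pauli.mat_X_apply, if_pos hyk.symm])) _
    · have hex : ∃ l, l ≠ k ∧ y l ≠ x l := by
        by_contra hall
        push Not at hall
        apply hy
        funext l
        by_cases hl : l = k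
        · subst hl
          rw [flipAt_apply_self]
          cases hx : x l <;> cases hy' : y l <;> simp_all
        · rw [flipAt_apply_of_ne hl]; exact hall l hl
      obtain ⟨l, hlk, hl⟩ := hex
      refine mul_eq_zero_of_left (Finset.prod_eq_zero (Finset.mem_univ l) ?_) _
      rw [stabLetter, if_neg hlk]
      split_ifs <;> simp [Ne.symm hl]
  · intro h; exact absurd (Finset.mem_univ _) h

/-- **The defining eigenvalue equations hold: `S_k^{(G_N)}|G_N⟩ = |G_N⟩` for every vertex `k`.**
[cite: TothGuhne2005Stabilizer, §III.B (“`|G_N⟩ = S_k^{(G_N)}|G_N⟩`”); GuhneToth2009, §3.4.3 eq. (57)] -/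
theorem graphStab_mulVec_graphStateVec (k : Fin N) :
    graphStab G k *ᵥ graphStateVec G = graphStateVec G := by
  funext x
  rw [graphStab_mulVec_apply]
  simp only [graphStateVec]
  rw [edgeParity_flipAt, chi_add, chi_sum]
  simp_rw [chi_bitZ]
  have hP : (∏ l ∈ G.neighborFinset k, (if x l then (-1 : ℂ) else 1)) *
      (∏ l ∈ G.neighborFinset k, (if x l then (-1 : ℂ) else 1)) = 1 := by
    rw [← Finset.prod_mul_distrib]
    exact Finset.prod_eq_one fun l _ => by split_ifs <;> norm_num
  linear_combination ((CHSHOpt.invSqrtTwo : ℂ) ^ N * chi (edgeParity G x)) * hP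

/-- `(1/√2)·(1/√2) = 1/2` in `ℂ`. [folklore] -/
private theorem invSqrtTwo_mul_self_C :
    (CHSHOpt.invSqrtTwo : ℂ) * (CHSHOpt.invSqrtTwo : ℂ) = 1 / 2 := by
  rw [← Complex.ofReal_mul, CHSHOpt.invSqrtTwo_mul_self]; push_cast; ring

/-- `⟨G_N|G_N⟩ = 1`. [cite: TothGuhne2005Stabilizer, §III.B; GuhneToth2009, §3.4.3 eq. (58)] -/
theorem graphStateVec_norm : star (graphStateVec G) ⬝ᵥ graphStateVec G = 1 := by
  simp only [dotProduct, Pi.star_apply, graphStateVec]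
  have hc : star ((CHSHOpt.invSqrtTwo : ℂ) ^ N) = (CHSHOpt.invSqrtTwo : ℂ) ^ N := by
    rw [star_pow, Complex.star_def, Complex.conj_ofReal]
  have h : ∀ x : Fin N → Bool, star ((CHSHOpt.invSqrtTwo : ℂ) ^ N * chi (edgeParity G x)) *
      ((CHSHOpt.invSqrtTwo : ℂ) ^ N * chi (edgeParity G x)) = (1 / 2 : ℂ) ^ N := by
    intro x
    rw [star_mul', hc, star_chi]
    have h1 := chi_mul_self (K := ℂ) (edgeParity G x)
    have h2 : (CHSHOpt.invSqrtTwo : ℂ) ^ N * (CHSHOpt.invSqrtTwo : ℂ) ^ N = (1 / 2 : ℂ) ^ N := by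
      rw [← mul_pow, invSqrtTwo_mul_self_C]
    linear_combination (chi (K := ℂ) (edgeParity G x) * chi (K := ℂ) (edgeParity G x)) * h2 +
      (1 / 2 : ℂ) ^ N * h1
  simp_rw [h]
  rw [Finset.sum_const, Finset.card_univ, Fintype.card_fun, Fintype.card_bool, Fintype.card_fin,
    nsmul_eq_mul]
  push_cast
  rw [← mul_pow]; norm_num

/-- `⟨S_k⟩ = 1` in the graph state. [cite: TothGuhne2005Stabilizer, §III.B; GuhneToth2009, §3.4.3
(“`⟨g_i⟩ = 1`”)] -/
theorem vecState_graphStab_graphStateVec (k : Fin N) :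
    vecState (graphStateVec G) (graphStab G k) = 1 := by
  rw [vecState_apply, graphStab_mulVec_graphStateVec, graphStateVec_norm, Complex.one_re]

/-- `⟨S_kS_l⟩ = 1` in the graph state. [cite: TothGuhne2005Stabilizer, §III.A (the term `S_kS_{k+1}`)] -/
theorem vecState_graphStab_mul_graphStateVec (k l : Fin N) :
    vecState (graphStateVec G) (graphStab G k * graphStab G l) = 1 := by
  rw [vecState_apply, ← mulVec_mulVec, graphStab_mulVec_graphStateVec,
    graphStab_mulVec_graphStateVec, graphStateVec_norm, Complex.one_re]

/-- `Tr S_k = 0` (the letter `X^{(k)}` is traceless). [cite: TothGuhne2005Stabilizer, Definition 2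
(`2^{−N}Tr(𝒲)`)] -/
theorem trace_graphStab (k : Fin N) : (graphStab G k).trace = 0 := by
  rw [graphStab, trace_pauliWord]
  refine Finset.prod_eq_zero (Finset.mem_univ k) ?_
  rw [trace_pauliMat, stabLetter, if_pos rfl]
  exact if_neg (by decide)

/-- `Tr(S_kS_l) = 0` for neighbours `k ∼ l` (the letters at `k` are `X` and `Z`).
[cite: TothGuhne2005Stabilizer, Definition 2 (`2^{−N}Tr(𝒲)`)] -/
theorem trace_graphStab_mul {k l : Fin N} (hkl : G.Adj k l) :
    (graphStab G k * graphStab G l).trace = 0 := by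
  rw [graphStab, graphStab, trace_pauliWord_mul]
  refine Finset.prod_eq_zero (Finset.mem_univ k) ?_
  have hne : stabLetter G k k ≠ stabLetter G l k := by
    rw [stabLetter, stabLetter, if_pos rfl, if_neg (G.ne_of_adj hkl), if_pos hkl.symm]; decide
  exact if_neg hne

/-! ## Expectation values in product states -/

/-- `|⟨σ_l⟩| ≤ 1` on a unit qubit vector (and `⟨𝟙⟩ = 1`). [cite: TothGuhne2005Stabilizer, §II
(“`⟨X⟩² + ⟨Y⟩² + ⟨Z⟩² ≤ 1`”)] -/
private theorem abs_bloch_le (l : Pauli) (φ : Bool → ℂ) (hφ : star φ ⬝ᵥ φ = 1) :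
    |bloch l φ| ≤ 1 := by
  cases l with
  | I => rw [bloch, pauliI_mat, one_mulVec, hφ, Complex.one_re, abs_one]
  | X =>
    have h := bloch_sq_sum φ hφ
    exact abs_le_one_iff_mul_self_le_one.mpr
      (by nlinarith [sq_nonneg (bloch Pauli.Y φ), sq_nonneg (bloch Pauli.Z φ)])
  | Y =>
    have h := bloch_sq_sum φ hφ
    exact abs_le_one_iff_mul_self_le_one.mpr
      (by nlinarith [sq_nonneg (bloch Pauli.X φ), sq_nonneg (bloch Pauli.Z φ)])
  | Z =>
    have h := bloch_sq_sum φ hφ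
    exact abs_le_one_iff_mul_self_le_one.mpr
      (by nlinarith [sq_nonneg (bloch Pauli.X φ), sq_nonneg (bloch Pauli.Y φ)])

/-- `|Π_{m∈s} ⟨σ_l⟩_m| ≤ 1` for unit factors. [cite: TothGuhne2005Stabilizer, §II] -/
private theorem abs_prod_bloch_le (l : Pauli) (φ : Fin N → Bool → ℂ)
    (hφ : ∀ m, star (φ m) ⬝ᵥ φ m = 1) (s : Finset (Fin N)) :
    |∏ m ∈ s, bloch l (φ m)| ≤ 1 := by
  rw [Finset.abs_prod]
  exact Finset.prod_le_one (fun m _ => abs_nonneg _) fun m _ => abs_bloch_le l (φ m) (hφ m)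

/-- The neighbours of `k` as a filter of `univ ∖ {k}`. [cite: TothGuhne2005Stabilizer, §III.B] -/
private theorem filter_erase_adj (k : Fin N) :
    (Finset.univ.erase k).filter (fun l => G.Adj k l) = G.neighborFinset k := by
  ext l
  simp only [Finset.mem_filter, Finset.mem_erase, Finset.mem_univ, and_true,
    SimpleGraph.mem_neighborFinset]
  exact ⟨fun h => h.2, fun h => ⟨(G.ne_of_adj h).symm, h⟩⟩

/-- **`⟨S_k⟩ = ⟨X_k⟩ Π_{l ∈ N(k)} ⟨Z_l⟩` on a product state** (the first line of the printed proof,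
`⟨Z^{(k−1)}X^{(k)}Z^{(k+1)}⟩ = ⟨Z^{(k−1)}⟩⟨X^{(k)}⟩⟨Z^{(k+1)}⟩` for the chain).
[cite: TothGuhne2005Stabilizer, Theorem 1 (proof) and Theorem 7] -/
theorem vecState_graphStab_productVec (k : Fin N) (φ : Fin N → Bool → ℂ)
    (hφ : ∀ l, star (φ l) ⬝ᵥ φ l = 1) :
    vecState (productVec φ) (graphStab G k) =
      bloch Pauli.X (φ k) * ∏ l ∈ G.neighborFinset k, bloch Pauli.Z (φ l) := by
  rw [vecState_apply, graphStab, pauliWord_mulVec_productVec, star_productVec_dotProduct]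
  have h : ∀ l, star (φ l) ⬝ᵥ ((stabLetter G k l).mat *ᵥ φ l) =
      if l = k then (bloch Pauli.X (φ l) : ℂ) else
        if G.Adj k l then (bloch Pauli.Z (φ l) : ℂ) else 1 := by
    intro l
    rw [stabLetter]
    split_ifs with h1 h2
    · exact star_dotProduct_pauli_mulVec _ _
    · exact star_dotProduct_pauli_mulVec _ _
    · rw [pauliI_mat, one_mulVec, hφ l]
  simp_rw [h]
  rw [← Finset.mul_prod_erase Finset.univ _ (Finset.mem_univ k), if_pos rfl]
  have h2 : ∏ l ∈ Finset.univ.erase k, (if l = k then (bloch Pauli.X (φ l) : ℂ) else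
      if G.Adj k l then (bloch Pauli.Z (φ l) : ℂ) else 1) =
      ∏ l ∈ G.neighborFinset k, (bloch Pauli.Z (φ l) : ℂ) := by
    rw [Finset.prod_congr rfl (fun l hl => if_neg (Finset.ne_of_mem_erase hl)), Finset.prod_ite,
      Finset.prod_const_one, mul_one, filter_erase_adj]
  rw [h2, ← Complex.ofReal_prod, ← Complex.ofReal_mul, Complex.ofReal_re]

/-- `⟨σ_z φ, σ_x φ⟩ = i⟨φ|σ_y|φ⟩` (`σ_zσ_x = iσ_y`). [cite: TothGuhne2005Stabilizer, §III.A (the term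
`S_kS_{k+1}`)] -/
theorem star_Z_mulVec_dotProduct_X_mulVec (φ : Bool → ℂ) :
    star (Pauli.Z.mat *ᵥ φ) ⬝ᵥ (Pauli.X.mat *ᵥ φ) = I * (bloch Pauli.Y φ : ℂ) := by
  rw [star_dotProduct, star_X_mulVec_dotProduct_Z_mulVec, star_mul', star_neg, Complex.star_def,
    Complex.conj_I, Complex.conj_ofReal]
  ring

/-- The sites other than `k, l` on which exactly one of `S_k`, `S_l` carries a `Z`:
`(N(k) ∆ N(l)) ∖ {k, l}` (for the chain and `l = k+1`: `{k−1, k+2}`).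
[cite: TothGuhne2005Stabilizer, §III.A (“involves only the qubits of a quadruplet”)] -/
def crossNbr (k l : Fin N) : Finset (Fin N) :=
  ((Finset.univ.erase k).erase l).filter fun m => m ∈ symmDiff (G.neighborFinset k) (G.neighborFinset l)

/-- **`⟨S_kS_l⟩ = ⟨Y_k⟩⟨Y_l⟩ Π_{m ∈ (N(k)∆N(l))∖{k,l}} ⟨Z_m⟩` on a product state**, for neighbours
`k ∼ l` (site `k`: `⟨σ_xφ, σ_zφ⟩ = −i⟨Y⟩`; site `l`: `⟨σ_zφ, σ_xφ⟩ = i⟨Y⟩`; a common neighbour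
contributes `⟨σ_zφ, σ_zφ⟩ = 1`). [cite: TothGuhne2005Stabilizer, §II (three-term witness, “using the
fact that `⟨X⟩² + ⟨Y⟩² + ⟨Z⟩² ≤ 1`”) and §III.A (`S_kS_{k+1}`)] -/
theorem vecState_graphStab_mul_productVec {k l : Fin N} (hkl : G.Adj k l) (φ : Fin N → Bool → ℂ)
    (hφ : ∀ m, star (φ m) ⬝ᵥ φ m = 1) :
    vecState (productVec φ) (graphStab G k * graphStab G l) =
      bloch Pauli.Y (φ k) * bloch Pauli.Y (φ l) * ∏ m ∈ crossNbr G k l, bloch Pauli.Z (φ m) := by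
  have hne : k ≠ l := G.ne_of_adj hkl
  have hH : (graphStab G k)ᴴ = graphStab G k := (graphStab_isHermitian G k).eq
  rw [vecState_apply, ← mulVec_mulVec, ← hH, star_dotProduct_conjTranspose_mulVec, graphStab,
    graphStab, pauliWord_mulVec_productVec, pauliWord_mulVec_productVec, star_productVec_dotProduct]
  have h : ∀ m, star ((stabLetter G k m).mat *ᵥ φ m) ⬝ᵥ ((stabLetter G l m).mat *ᵥ φ m) =
      if m = k then -I * (bloch Pauli.Y (φ m) : ℂ) else if m = l then I * (bloch Pauli.Y (φ m) : ℂ)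
        else if m ∈ symmDiff (G.neighborFinset k) (G.neighborFinset l)
          then (bloch Pauli.Z (φ m) : ℂ) else 1 := by
    intro m
    by_cases hmk : m = k
    · subst hmk
      rw [if_pos rfl, stabLetter, stabLetter, if_pos rfl, if_neg hne, if_pos hkl.symm]
      exact star_X_mulVec_dotProduct_Z_mulVec _
    rw [if_neg hmk]
    by_cases hml : m = l
    · subst hml
      rw [if_pos rfl, stabLetter, stabLetter, if_neg hmk, if_pos hkl, if_pos rfl]
      exact star_Z_mulVec_dotProduct_X_mulVec _
    rw [if_neg hml, stabLetter, stabLetter, if_neg hmk, if_neg hml]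
    have hmem : m ∈ symmDiff (G.neighborFinset k) (G.neighborFinset l) ↔
        (G.Adj k m ∧ ¬ G.Adj l m) ∨ (G.Adj l m ∧ ¬ G.Adj k m) := by
      rw [Finset.mem_symmDiff, SimpleGraph.mem_neighborFinset, SimpleGraph.mem_neighborFinset]
    by_cases ha : G.Adj k m <;> by_cases hb : G.Adj l m
    · rw [if_pos ha, if_pos hb, if_neg (by rw [hmem]; tauto), star_pauli_mulVec_dotProduct_self, hφ m]
    · rw [if_pos ha, if_neg hb, if_pos (by rw [hmem]; tauto), pauliI_mat, one_mulVec,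
        star_pauli_mulVec_dotProduct]
    · rw [if_neg ha, if_pos hb, if_pos (by rw [hmem]; tauto), pauliI_mat, one_mulVec,
        star_dotProduct_pauli_mulVec]
    · rw [if_neg ha, if_neg hb, if_neg (by rw [hmem]; tauto), pauliI_mat, one_mulVec, hφ m]
  simp_rw [h]
  rw [← Finset.mul_prod_erase Finset.univ _ (Finset.mem_univ k), if_pos rfl,
    ← Finset.mul_prod_erase (Finset.univ.erase k) _ (Finset.mem_erase.mpr ⟨hne.symm, Finset.mem_univ l⟩),
    if_neg hne.symm, if_pos rfl]
  have h3 : ∏ m ∈ (Finset.univ.erase k).erase l,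
      (if m = k then -I * (bloch Pauli.Y (φ m) : ℂ) else if m = l then I * (bloch Pauli.Y (φ m) : ℂ)
        else if m ∈ symmDiff (G.neighborFinset k) (G.neighborFinset l)
          then (bloch Pauli.Z (φ m) : ℂ) else 1) =
      ∏ m ∈ crossNbr G k l, (bloch Pauli.Z (φ m) : ℂ) := by
    have hc : ∀ m ∈ (Finset.univ.erase k).erase l,
        (if m = k then -I * (bloch Pauli.Y (φ m) : ℂ) else if m = l then I * (bloch Pauli.Y (φ m) : ℂ)
          else if m ∈ symmDiff (G.neighborFinset k) (G.neighborFinset l)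
            then (bloch Pauli.Z (φ m) : ℂ) else 1) =
        if m ∈ symmDiff (G.neighborFinset k) (G.neighborFinset l)
          then (bloch Pauli.Z (φ m) : ℂ) else 1 := by
      intro m hm
      have hml : m ≠ l := Finset.ne_of_mem_erase hm
      have hmk : m ≠ k := Finset.ne_of_mem_erase (Finset.mem_of_mem_erase hm)
      rw [if_neg hmk, if_neg hml]
    rw [Finset.prod_congr rfl hc, Finset.prod_ite, Finset.prod_const_one, mul_one, crossNbr]
  rw [h3, ← Complex.ofReal_prod]
  have hI : (-I * (bloch Pauli.Y (φ k) : ℂ)) * (I * (bloch Pauli.Y (φ l) : ℂ)) =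
      ((bloch Pauli.Y (φ k) * bloch Pauli.Y (φ l) : ℝ) : ℂ) := by
    push_cast
    linear_combination (-(bloch Pauli.Y (φ k) : ℂ) * (bloch Pauli.Y (φ l) : ℂ)) * I_mul_I
  rw [← mul_assoc, hI, ← Complex.ofReal_mul, Complex.ofReal_re]

/-- The Bloch-sphere inequality behind the three-term witnesses: for unit Bloch vectors
`(x,y,z)`, `(x',y',z')` and `|a|, |b|, |c| ≤ 1`,
`x z' a + x' z b + y y' c = ⟨(x,y,z), (a z', c y', b x')⟩ ≤ 1` (Cauchy–Schwarz).
[cite: TothGuhne2005Stabilizer, §II (“using the fact that `⟨X⟩² + ⟨Y⟩² + ⟨Z⟩² ≤ 1`”)] -/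
private theorem triple_le {x y z x' y' z' a b c : ℝ} (h : x ^ 2 + y ^ 2 + z ^ 2 = 1)
    (h' : x' ^ 2 + y' ^ 2 + z' ^ 2 = 1) (ha : |a| ≤ 1) (hb : |b| ≤ 1) (hc : |c| ≤ 1) :
    x * (z' * a) + x' * (z * b) + y * y' * c ≤ 1 := by
  have ha2 : a * a ≤ 1 := abs_le_one_iff_mul_self_le_one.mp ha
  have hb2 : b * b ≤ 1 := abs_le_one_iff_mul_self_le_one.mp hb
  have hc2 : c * c ≤ 1 := abs_le_one_iff_mul_self_le_one.mp hc
  nlinarith [sq_nonneg (x - z' * a), sq_nonneg (z - x' * b), sq_nonneg (y - y' * c),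
    mul_nonneg (sub_nonneg.mpr ha2) (mul_self_nonneg z'),
    mul_nonneg (sub_nonneg.mpr hb2) (mul_self_nonneg x'),
    mul_nonneg (sub_nonneg.mpr hc2) (mul_self_nonneg y')]

/-- **Theorem 7 / Theorem 1's proof on pure product states**: for neighbours `k ∼ l`,
`⟨S_k⟩ + ⟨S_l⟩ ≤ |⟨X_k⟩|·|⟨Z_l⟩| + |⟨Z_k⟩|·|⟨X_l⟩| ≤ √(⟨X_k⟩²+⟨Z_k⟩²)√(⟨X_l⟩²+⟨Z_l⟩²) ≤ 1`.
[cite: TothGuhne2005Stabilizer, Theorem 1 (proof) and Theorem 7; GuhneToth2009, §6.6.5 eq. (151)] -/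
theorem graphStab_add_productVec_le {k l : Fin N} (hkl : G.Adj k l) (φ : Fin N → Bool → ℂ)
    (hφ : ∀ m, star (φ m) ⬝ᵥ φ m = 1) :
    vecState (productVec φ) (graphStab G k) + vecState (productVec φ) (graphStab G l) ≤ 1 := by
  rw [vecState_graphStab_productVec G k φ hφ, vecState_graphStab_productVec G l φ hφ,
    ← Finset.mul_prod_erase _ _ ((G.mem_neighborFinset k l).mpr hkl),
    ← Finset.mul_prod_erase _ _ ((G.mem_neighborFinset l k).mpr hkl.symm)]
  set a := ∏ m ∈ (G.neighborFinset k).erase l, bloch Pauli.Z (φ m)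
  set b := ∏ m ∈ (G.neighborFinset l).erase k, bloch Pauli.Z (φ m)
  have ha : |a| ≤ 1 := abs_prod_bloch_le Pauli.Z φ hφ _
  have hb : |b| ≤ 1 := abs_prod_bloch_le Pauli.Z φ hφ _
  set xk := bloch Pauli.X (φ k)
  set xl := bloch Pauli.X (φ l)
  set zk := bloch Pauli.Z (φ k)
  set zl := bloch Pauli.Z (φ l)
  have hk := bloch_sq_sum (φ k) (hφ k)
  have hl := bloch_sq_sum (φ l) (hφ l)
  have h1 : xk * (zl * a) ≤ |xk| * |zl| := by
    have h0 : xk * (zl * a) ≤ |xk * (zl * a)| := le_abs_self _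
    rw [abs_mul, abs_mul] at h0
    have h2 : |xk| * (|zl| * |a|) ≤ |xk| * (|zl| * 1) := by gcongr
    linarith
  have h2 : xl * (zk * b) ≤ |xl| * |zk| := by
    have h0 : xl * (zk * b) ≤ |xl * (zk * b)| := le_abs_self _
    rw [abs_mul, abs_mul] at h0
    have h3 : |xl| * (|zk| * |b|) ≤ |xl| * (|zk| * 1) := by gcongr
    linarith
  nlinarith [sq_nonneg (|xk| - |zl|), sq_nonneg (|zk| - |xl|), sq_abs xk, sq_abs xl, sq_abs zk,
    sq_abs zl, sq_nonneg (bloch Pauli.Y (φ k)), sq_nonneg (bloch Pauli.Y (φ l))]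

/-- **The three-term bound on pure product states**: for neighbours `k ∼ l`,
`⟨S_k⟩ + ⟨S_l⟩ + ⟨S_kS_l⟩ ≤ 1` (“This can be proved in a similar calculation as in Theorem 1, using
the fact that `⟨X⟩² + ⟨Y⟩² + ⟨Z⟩² ≤ 1`”). [cite: TothGuhne2005Stabilizer, §II (three-term witness)
and §III.A (`𝒲'_k^{(C_N)}`); GuhneToth2009, §6.6.5 eq. (152)] -/
theorem graphStab_add_add_mul_productVec_le {k l : Fin N} (hkl : G.Adj k l)
    (φ : Fin N → Bool → ℂ) (hφ : ∀ m, star (φ m) ⬝ᵥ φ m = 1) :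
    vecState (productVec φ) (graphStab G k) + vecState (productVec φ) (graphStab G l) +
      vecState (productVec φ) (graphStab G k * graphStab G l) ≤ 1 := by
  rw [vecState_graphStab_productVec G k φ hφ, vecState_graphStab_productVec G l φ hφ,
    vecState_graphStab_mul_productVec G hkl φ hφ,
    ← Finset.mul_prod_erase _ _ ((G.mem_neighborFinset k l).mpr hkl),
    ← Finset.mul_prod_erase _ _ ((G.mem_neighborFinset l k).mpr hkl.symm)]
  exact triple_le (bloch_sq_sum (φ k) (hφ k)) (bloch_sq_sum (φ l) (hφ l))
    (abs_prod_bloch_le Pauli.Z φ hφ _) (abs_prod_bloch_le Pauli.Z φ hφ _)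
    (abs_prod_bloch_le Pauli.Z φ hφ _)

/-! ## Theorem 7: the witnesses `𝟙 − S_k − S_l` and `𝟙 − S_k − S_l − S_kS_l` on fully separable states -/

/-- **Theorem 7's witness `𝒲_{kl}^{(G_N)} = 𝟙 − S_k^{(G_N)} − S_l^{(G_N)}`** (for neighbours `k ∼ l`).
[cite: TothGuhne2005Stabilizer, Theorem 7] -/
noncomputable def gsWitness (k l : Fin N) : Matrix (Fin N → Bool) (Fin N → Bool) ℂ :=
  1 - graphStab G k - graphStab G l

/-- **The three-term witness `𝟙 − S_k − S_l − S_kS_l`** (printed for the GHZ and cluster states;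
here for any pair of neighbouring vertices — flagged generalisation, same proof).
[cite: TothGuhne2005Stabilizer, §II (`𝟙 − S₁ − S_m − S₁S_m`) and §III.A (`𝒲'_k^{(C_N)}`)] -/
noncomputable def gsWitness' (k l : Fin N) : Matrix (Fin N → Bool) (Fin N → Bool) ℂ :=
  1 - graphStab G k - graphStab G l - graphStab G k * graphStab G l

/-- `Tr(|ψ⟩⟨ψ| M) = ⟨ψ|M|ψ⟩` (real parts). [folklore] -/
private theorem trState_vecMulVec (ψ : (Fin N → Bool) → ℂ)
    (M : Matrix (Fin N → Bool) (Fin N → Bool) ℂ) :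
    trState (vecMulVec ψ (star ψ)) M = vecState ψ M := by
  rw [trState_apply, vecState_apply, Matrix.trace_mul_comm, Matrix.mul_vecMulVec,
    Matrix.trace_vecMulVec, dotProduct_comm]

/-- `Tr((Σ p_i |ψ_i⟩⟨ψ_i|) M) = Σ p_i ⟨ψ_i|M|ψ_i⟩`. [folklore] -/
private theorem trState_mixture {ι : Type*} [Fintype ι] (p : ι → ℝ)
    (ψ : ι → (Fin N → Bool) → ℂ) (M : Matrix (Fin N → Bool) (Fin N → Bool) ℂ) :
    trState (∑ i, (p i : ℂ) • vecMulVec (ψ i) (star (ψ i))) M = ∑ i, p i * vecState (ψ i) M := by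
  rw [trState_apply, Finset.sum_mul, Matrix.trace_sum, Complex.re_sum]
  refine Finset.sum_congr rfl fun i _ => ?_
  rw [Matrix.smul_mul, Matrix.trace_smul, smul_eq_mul, Complex.re_ofReal_mul, ← trState_apply,
    trState_vecMulVec]

/-- `⟨ψ|ψ⟩ = 1` for a unit product vector. [folklore] -/
private theorem norm_productVec (φ : Fin N → Bool → ℂ) (hφ : ∀ k, star (φ k) ⬝ᵥ φ k = 1) :
    star (productVec φ) ⬝ᵥ productVec φ = 1 := by
  rw [star_productVec_dotProduct]; exact Finset.prod_eq_one fun k _ => hφ k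

/-- `Tr ϱ = 1` (as `Tr(ϱ𝟙)`) for a fully separable state. [folklore] -/
private theorem trState_one_of_isSeparable {ρ : Matrix (Fin N → Bool) (Fin N → Bool) ℂ}
    (hρ : IsSeparable ρ) : trState ρ 1 = 1 := by
  obtain ⟨ι, _, p, ψ, hp, h1, hψ, rfl⟩ := hρ
  rw [trState_mixture, ← h1]
  refine Finset.sum_congr rfl fun i _ => ?_
  obtain ⟨φ, hφ, hi⟩ := hψ i
  rw [vecState_one, hi, norm_productVec φ hφ, Complex.one_re, mul_one]

/-- **Theorem 7 in measured quantities: `⟨S_k⟩_ϱ + ⟨S_l⟩_ϱ ≤ 1` for every fully separable `ϱ` and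
neighbours `k ∼ l`** (pure product bound + convexity). [cite: TothGuhne2005Stabilizer, Theorem 7;
GuhneToth2009, §6.6.5 (“By convexity, the bound is also valid for mixed separable states”)] -/
theorem graphStab_add_le_one {ρ : Matrix (Fin N → Bool) (Fin N → Bool) ℂ} (hρ : IsSeparable ρ)
    {k l : Fin N} (hkl : G.Adj k l) :
    trState ρ (graphStab G k) + trState ρ (graphStab G l) ≤ 1 := by
  obtain ⟨ι, _, p, ψ, hp, h1, hψ, rfl⟩ := hρ
  rw [trState_mixture, trState_mixture, ← Finset.sum_add_distrib, ← h1]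
  refine Finset.sum_le_sum fun i _ => ?_
  obtain ⟨φ, hφ, hi⟩ := hψ i
  have h := graphStab_add_productVec_le G hkl φ hφ
  rw [← hi] at h
  nlinarith [hp i]

/-- **Theorem 7 (Tóth–Gühne 2005).** `𝒲_{kl}^{(G_N)} = 𝟙 − S_k − S_l` (`k`, `l` neighbours) is an
entanglement witness: `Tr(ϱ𝒲_{kl}) ≥ 0` on every fully separable `ϱ`.
[cite: TothGuhne2005Stabilizer, Theorem 7] -/
theorem tothGuhne_theorem7 {ρ : Matrix (Fin N → Bool) (Fin N → Bool) ℂ} (hρ : IsSeparable ρ)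
    {k l : Fin N} (hkl : G.Adj k l) : 0 ≤ trState ρ (gsWitness G k l) := by
  have h := graphStab_add_le_one G hρ hkl
  rw [gsWitness, map_sub, map_sub, trState_one_of_isSeparable hρ]
  linarith

/-- **Entanglement criterion**: `⟨S_k⟩_ϱ + ⟨S_l⟩_ϱ > 1` for some edge `k ∼ l ⟹ ϱ` is entangled
(not fully separable). [cite: TothGuhne2005Stabilizer, Theorem 7] -/
theorem not_isSeparable_of_one_lt {ρ : Matrix (Fin N → Bool) (Fin N → Bool) ℂ} {k l : Fin N}
    (hkl : G.Adj k l) (h : 1 < trState ρ (graphStab G k) + trState ρ (graphStab G l)) :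
    ¬ IsSeparable ρ :=
  fun hρ => absurd h (not_lt.2 (graphStab_add_le_one G hρ hkl))

/-- **`⟨S_k⟩_ϱ + ⟨S_l⟩_ϱ + ⟨S_kS_l⟩_ϱ ≤ 1` on fully separable `ϱ`** (neighbours `k ∼ l`).
[cite: TothGuhne2005Stabilizer, §II (three-term witness) and §III.A (`𝒲'_k^{(C_N)}`)] -/
theorem graphStab_add_add_mul_le_one {ρ : Matrix (Fin N → Bool) (Fin N → Bool) ℂ}
    (hρ : IsSeparable ρ) {k l : Fin N} (hkl : G.Adj k l) :
    trState ρ (graphStab G k) + trState ρ (graphStab G l) +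
      trState ρ (graphStab G k * graphStab G l) ≤ 1 := by
  obtain ⟨ι, _, p, ψ, hp, h1, hψ, rfl⟩ := hρ
  rw [trState_mixture, trState_mixture, trState_mixture, ← Finset.sum_add_distrib,
    ← Finset.sum_add_distrib, ← h1]
  refine Finset.sum_le_sum fun i _ => ?_
  obtain ⟨φ, hφ, hi⟩ := hψ i
  have h := graphStab_add_add_mul_productVec_le G hkl φ hφ
  rw [← hi] at h
  nlinarith [hp i]

/-- **`Tr(ϱ𝒲') ≥ 0` for the three-term witness on fully separable `ϱ`.**
[cite: TothGuhne2005Stabilizer, §II and §III.A] -/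
theorem trState_gsWitness'_nonneg {ρ : Matrix (Fin N → Bool) (Fin N → Bool) ℂ} (hρ : IsSeparable ρ)
    {k l : Fin N} (hkl : G.Adj k l) : 0 ≤ trState ρ (gsWitness' G k l) := by
  have h := graphStab_add_add_mul_le_one G hρ hkl
  rw [gsWitness', map_sub, map_sub, map_sub, trState_one_of_isSeparable hρ]
  linarith

/-! ## White noise (Definition 2) and the tolerances `1/2`, `2/3` -/

/-- **Definition 2**: the state mixed with white noise,
`ϱ(p_noise) = p_noise 𝟙/2^N + (1 − p_noise)|Ψ⟩⟨Ψ|`. [cite: TothGuhne2005Stabilizer, Definition 2] -/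
noncomputable def noisyState (ψ : (Fin N → Bool) → ℂ) (p : ℝ) :
    Matrix (Fin N → Bool) (Fin N → Bool) ℂ :=
  ((p / 2 ^ N : ℝ) : ℂ) • (1 : Matrix (Fin N → Bool) (Fin N → Bool) ℂ) +
    ((1 - p : ℝ) : ℂ) • vecMulVec ψ (star ψ)

/-- The tree's noisy GHZ state is `ϱ(p)` for `Ψ = GHZ_N`. [cite: TothGuhne2005Stabilizer,
Definition 2] -/
theorem noisyState_ghzN (p : ℝ) : noisyState (ghzN N) p = noisyGHZ N p := rfl

/-- **`Tr(𝒲ϱ(p)) = p · 2^{−N}Tr(𝒲) + (1 − p)⟨Ψ|𝒲|Ψ⟩`.** [cite: TothGuhne2005Stabilizer, Definition 2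
and the `p_limit` formula] -/
theorem trState_noisyState (ψ : (Fin N → Bool) → ℂ) (p : ℝ)
    (W : Matrix (Fin N → Bool) (Fin N → Bool) ℂ) :
    trState (noisyState ψ p) W = p * (W.trace.re / 2 ^ N) + (1 - p) * vecState ψ W := by
  rw [noisyState, trState_apply, Matrix.add_mul, Matrix.smul_mul, Matrix.smul_mul, Matrix.one_mul,
    Matrix.trace_add, Matrix.trace_smul, Matrix.trace_smul, smul_eq_mul, smul_eq_mul, Complex.add_re,
    Complex.re_ofReal_mul, Complex.re_ofReal_mul, ← trState_apply (vecMulVec ψ (star ψ)) W,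
    trState_vecMulVec]
  ring

/-- **The `p_limit` formula**: if `⟨Ψ|𝒲|Ψ⟩ < 0` and `⟨Ψ|𝒲|Ψ⟩ < 2^{−N}Tr(𝒲)`, then `𝒲` detects `ϱ(p)`
(`Tr(𝒲ϱ(p)) < 0`) iff `p < p_limit = −⟨Ψ|𝒲|Ψ⟩ / (2^{−N}Tr(𝒲) − ⟨Ψ|𝒲|Ψ⟩)`.
[cite: TothGuhne2005Stabilizer, §II.C (“witness `𝒲` detects `ϱ(p_noise)` as entangled if
`p_noise < p_limit`”)] -/
theorem noisyState_detected_iff (ψ : (Fin N → Bool) → ℂ) (p : ℝ)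
    (W : Matrix (Fin N → Bool) (Fin N → Bool) ℂ) (hlt : vecState ψ W < W.trace.re / 2 ^ N) :
    trState (noisyState ψ p) W < 0 ↔
      p < -vecState ψ W / (W.trace.re / 2 ^ N - vecState ψ W) := by
  rw [trState_noisyState]
  have hd : 0 < W.trace.re / 2 ^ N - vecState ψ W := by linarith
  rw [lt_div_iff₀ hd]
  constructor <;> intro h <;> linarith

/-- `Tr 𝒲_{kl} = 2^N`. [cite: TothGuhne2005Stabilizer, Definition 2 (`2^{−N}Tr(𝒲)`)] -/
theorem trace_gsWitness (k l : Fin N) : (gsWitness G k l).trace = 2 ^ N := by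
  rw [gsWitness, trace_sub, trace_sub, trace_one_register, trace_graphStab, trace_graphStab]; ring

/-- `Tr 𝒲'_{kl} = 2^N` for neighbours. [cite: TothGuhne2005Stabilizer, Definition 2] -/
theorem trace_gsWitness' {k l : Fin N} (hkl : G.Adj k l) : (gsWitness' G k l).trace = 2 ^ N := by
  rw [gsWitness', trace_sub, trace_sub, trace_sub, trace_one_register, trace_graphStab,
    trace_graphStab, trace_graphStab_mul G hkl]; ring

/-- `⟨G_N|𝒲_{kl}|G_N⟩ = −1`. [cite: TothGuhne2005Stabilizer, §III.A–B] -/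
theorem vecState_gsWitness_graphStateVec (k l : Fin N) :
    vecState (graphStateVec G) (gsWitness G k l) = -1 := by
  rw [gsWitness, map_sub, map_sub, vecState_one, graphStateVec_norm, Complex.one_re,
    vecState_graphStab_graphStateVec, vecState_graphStab_graphStateVec]; ring

/-- `⟨G_N|𝒲'_{kl}|G_N⟩ = −2`. [cite: TothGuhne2005Stabilizer, §III.A–B] -/
theorem vecState_gsWitness'_graphStateVec (k l : Fin N) :
    vecState (graphStateVec G) (gsWitness' G k l) = -2 := by
  rw [gsWitness', map_sub, map_sub, map_sub, vecState_one, graphStateVec_norm, Complex.one_re,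
    vecState_graphStab_graphStateVec, vecState_graphStab_graphStateVec,
    vecState_graphStab_mul_graphStateVec]; ring

/-- `Re(2^N) = 2^N` in `ℂ`. [folklore] -/
private theorem two_pow_re : ((2 : ℂ) ^ N).re = 2 ^ N := by
  rw [show ((2 : ℂ) ^ N) = ((2 ^ N : ℝ) : ℂ) by push_cast; ring, Complex.ofReal_re]

/-- **`Tr(𝒲_{kl} ϱ(p)) = 2p − 1`** on the noisy graph state. [cite: TothGuhne2005Stabilizer, §III.A
(“tolerates noise if `p_noise < 1/2`”)] -/
theorem trState_gsWitness_noisy (k l : Fin N) (p : ℝ) :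
    trState (noisyState (graphStateVec G) p) (gsWitness G k l) = 2 * p - 1 := by
  rw [trState_noisyState, trace_gsWitness, vecState_gsWitness_graphStateVec, two_pow_re]
  have hpos : (2 : ℝ) ^ N ≠ 0 := pow_ne_zero _ two_ne_zero
  field_simp
  ring

/-- **Noise tolerance of `𝒲_{kl}`: detected iff `p_noise < 1/2`.** [cite: TothGuhne2005Stabilizer,
§III.A; GuhneToth2009, §6.6.5] -/
theorem gsWitness_detects_iff (k l : Fin N) (p : ℝ) :
    trState (noisyState (graphStateVec G) p) (gsWitness G k l) < 0 ↔ p < 1 / 2 := by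
  rw [trState_gsWitness_noisy]; constructor <;> intro h <;> linarith

/-- **`Tr(𝒲'_{kl} ϱ(p)) = 3p − 2`** on the noisy graph state (neighbours).
[cite: TothGuhne2005Stabilizer, §III.A (“tolerates noise if `p_noise < 2/3`”)] -/
theorem trState_gsWitness'_noisy {k l : Fin N} (hkl : G.Adj k l) (p : ℝ) :
    trState (noisyState (graphStateVec G) p) (gsWitness' G k l) = 3 * p - 2 := by
  rw [trState_noisyState, trace_gsWitness' G hkl, vecState_gsWitness'_graphStateVec, two_pow_re]
  have hpos : (2 : ℝ) ^ N ≠ 0 := pow_ne_zero _ two_ne_zero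
  field_simp
  ring

/-- **Noise tolerance of `𝒲'_{kl}`: detected iff `p_noise < 2/3`.** [cite: TothGuhne2005Stabilizer,
§III.A; GuhneToth2009, §6.6.5] -/
theorem gsWitness'_detects_iff {k l : Fin N} (hkl : G.Adj k l) (p : ℝ) :
    trState (noisyState (graphStateVec G) p) (gsWitness' G k l) < 0 ↔ p < 2 / 3 := by
  rw [trState_gsWitness'_noisy G hkl]; constructor <;> intro h <;> linarith

/-- The noisy graph state is entangled (not fully separable) for `p_noise < 2/3`, for any graph with
an edge. [cite: TothGuhne2005Stabilizer, §III.A–B] -/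
theorem not_isSeparable_noisy_graphState {k l : Fin N} (hkl : G.Adj k l) {p : ℝ} (hp : p < 2 / 3) :
    ¬ IsSeparable (noisyState (graphStateVec G) p) := fun hρ =>
  absurd (trState_gsWitness'_nonneg G hρ hkl) (not_le.mpr ((gsWitness'_detects_iff G hkl p).mpr hp))

/-! ## The linear cluster state `|C_N⟩` (§III.A; Gühne–Tóth (142)) -/

/-- The chain (path) graph on `Fin N`: `u ∼ v ↔ |u − v| = 1`, with decidable adjacency.
[cite: TothGuhne2005Stabilizer, §III.A–B (“Chain (2-colorable)” graph of the cluster state, Fig. 2)] -/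
def chainGraph (N : ℕ) : SimpleGraph (Fin N) where
  Adj u v := u.val + 1 = v.val ∨ v.val + 1 = u.val
  symm := ⟨fun _ _ h => Or.symm h⟩
  loopless := ⟨fun u h => by rcases h with h | h <;> omega⟩

/-- Adjacency in the chain is decidable. [cite: TothGuhne2005Stabilizer, §III.A] -/
instance chainGraph.instDecidableRel (N : ℕ) : DecidableRel (chainGraph N).Adj := fun u v =>
  inferInstanceAs (Decidable (u.val + 1 = v.val ∨ v.val + 1 = u.val))

/-- Unfolding the chain adjacency. [cite: TothGuhne2005Stabilizer, §III.A] -/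
theorem chainGraph_adj {u v : Fin N} : (chainGraph N).Adj u v ↔ u.val + 1 = v.val ∨ v.val + 1 = u.val :=
  Iff.rfl

/-- The chain graph is Mathlib's path graph. [cite: TothGuhne2005Stabilizer, §III.A] -/
theorem chainGraph_eq_pathGraph (N : ℕ) : chainGraph N = SimpleGraph.pathGraph N := by
  ext u v; rw [SimpleGraph.pathGraph_adj]; rfl

/-- **The cluster stabilizers `S_k^{(C_N)}`** = the graph-state stabilizers of the chain.
[cite: TothGuhne2005Stabilizer, §III.A; GuhneToth2009, §6.6.2 eq. (142)] -/
noncomputable def clusterStab (N : ℕ) (k : Fin N) : Matrix (Fin N → Bool) (Fin N → Bool) ℂ :=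
  graphStab (chainGraph N) k

/-- **The printed letters: `S_k^{(C_N)} = Z^{(k−1)}X^{(k)}Z^{(k+1)}`** (`S₁ = X^{(1)}Z^{(2)}`,
`S_N = Z^{(N−1)}X^{(N)}` — the missing neighbours simply do not occur in `Fin N`).
[cite: TothGuhne2005Stabilizer, §III.A; GuhneToth2009, §6.6.2 eq. (142)] -/
theorem clusterStab_eq (k : Fin N) : clusterStab N k = pauliWord fun l =>
    if l = k then Pauli.X else if (k.val + 1 = l.val ∨ l.val + 1 = k.val) then Pauli.Z else Pauli.I :=
  rfl

/-- **The cluster state `|C_N⟩`**, the graph state of the chain: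
`⟨x|C_N⟩ = 2^{−N/2}(−1)^{#{k : x_k = x_{k+1} = 1}}`. [cite: TothGuhne2005Stabilizer, §III.A
(“defined to be the state fulfilling `|C_N⟩ = S_k^{(C_N)}|C_N⟩`”)] -/
noncomputable def clusterVec (N : ℕ) : (Fin N → Bool) → ℂ := graphStateVec (chainGraph N)

/-- **`S_k^{(C_N)}|C_N⟩ = |C_N⟩` for every `k`** — the printed defining equations.
[cite: TothGuhne2005Stabilizer, §III.A] -/
theorem clusterStab_mulVec_clusterVec (k : Fin N) : clusterStab N k *ᵥ clusterVec N = clusterVec N :=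
  graphStab_mulVec_graphStateVec (chainGraph N) k

/-- `⟨C_N|C_N⟩ = 1`. [cite: TothGuhne2005Stabilizer, §III.A] -/
theorem clusterVec_norm : star (clusterVec N) ⬝ᵥ clusterVec N = 1 := graphStateVec_norm (chainGraph N)

variable {n : ℕ}

/-- Consecutive sites `k = i.castSucc`, `k+1 = i.succ` are neighbours in the chain on `N = n+1` sites.
[cite: TothGuhne2005Stabilizer, §III.A (`k` and `k+1`)] -/
theorem chainGraph_adj_castSucc_succ (i : Fin n) : (chainGraph (n + 1)).Adj i.castSucc i.succ :=
  Or.inl (by simp [Fin.val_succ])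

/-- **The printed witness `𝒲_k^{(C_N)} = 𝟙 − S_k^{(C_N)} − S_{k+1}^{(C_N)}`**, `k = 1, …, N−1`
(`N = n+1`, `k ↔ i.castSucc`, `k+1 ↔ i.succ` for `i : Fin n`). [cite: TothGuhne2005Stabilizer, §III.A;
GuhneToth2009, §6.6.5 (`𝒲_k^{(C_N)}`)] -/
noncomputable def clusterWitness (i : Fin n) : Matrix (Fin (n + 1) → Bool) (Fin (n + 1) → Bool) ℂ :=
  gsWitness (chainGraph (n + 1)) i.castSucc i.succ

/-- **The printed witness `𝒲'_k^{(C_N)} = 𝟙 − S_k − S_{k+1} − S_kS_{k+1}`**, `k = 1, …, N−1`.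
[cite: TothGuhne2005Stabilizer, §III.A; GuhneToth2009, §6.6.5 (`𝒲̂_k^{(C_N)}`)] -/
noncomputable def clusterWitness' (i : Fin n) : Matrix (Fin (n + 1) → Bool) (Fin (n + 1) → Bool) ℂ :=
  gsWitness' (chainGraph (n + 1)) i.castSucc i.succ

/-- Unfolding `clusterWitness`. [cite: TothGuhne2005Stabilizer, §III.A] -/
theorem clusterWitness_eq (i : Fin n) :
    clusterWitness i = 1 - clusterStab (n + 1) i.castSucc - clusterStab (n + 1) i.succ := rfl

/-- Unfolding `clusterWitness'`. [cite: TothGuhne2005Stabilizer, §III.A] -/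
theorem clusterWitness'_eq (i : Fin n) :
    clusterWitness' i = 1 - clusterStab (n + 1) i.castSucc - clusterStab (n + 1) i.succ -
      clusterStab (n + 1) i.castSucc * clusterStab (n + 1) i.succ := rfl

/-- **`⟨S_k⟩_ϱ + ⟨S_{k+1}⟩_ϱ ≤ 1` on fully separable `ϱ`** (cluster stabilizers).
[cite: TothGuhne2005Stabilizer, §III.A (“The proof is essentially the same as the one for” Theorem 1)] -/
theorem clusterStab_add_le_one {ρ : Matrix (Fin (n + 1) → Bool) (Fin (n + 1) → Bool) ℂ}
    (hρ : IsSeparable ρ) (i : Fin n) :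
    trState ρ (clusterStab (n + 1) i.castSucc) + trState ρ (clusterStab (n + 1) i.succ) ≤ 1 :=
  graphStab_add_le_one (chainGraph (n + 1)) hρ (chainGraph_adj_castSucc_succ i)

/-- **`𝒲_k^{(C_N)}` is an entanglement witness: `Tr(ϱ𝒲_k^{(C_N)}) ≥ 0` on fully separable `ϱ`.**
[cite: TothGuhne2005Stabilizer, §III.A] -/
theorem trState_clusterWitness_nonneg {ρ : Matrix (Fin (n + 1) → Bool) (Fin (n + 1) → Bool) ℂ}
    (hρ : IsSeparable ρ) (i : Fin n) : 0 ≤ trState ρ (clusterWitness i) :=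
  tothGuhne_theorem7 (chainGraph (n + 1)) hρ (chainGraph_adj_castSucc_succ i)

/-- **`𝒲'_k^{(C_N)}` is an entanglement witness: `Tr(ϱ𝒲'_k^{(C_N)}) ≥ 0` on fully separable `ϱ`.**
[cite: TothGuhne2005Stabilizer, §III.A] -/
theorem trState_clusterWitness'_nonneg {ρ : Matrix (Fin (n + 1) → Bool) (Fin (n + 1) → Bool) ℂ}
    (hρ : IsSeparable ρ) (i : Fin n) : 0 ≤ trState ρ (clusterWitness' i) :=
  trState_gsWitness'_nonneg (chainGraph (n + 1)) hρ (chainGraph_adj_castSucc_succ i)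

/-- `⟨S_k⟩_ϱ + ⟨S_{k+1}⟩_ϱ > 1 ⟹ ϱ` entangled. [cite: TothGuhne2005Stabilizer, §III.A] -/
theorem not_isSeparable_of_one_lt_cluster {ρ : Matrix (Fin (n + 1) → Bool) (Fin (n + 1) → Bool) ℂ}
    (i : Fin n)
    (h : 1 < trState ρ (clusterStab (n + 1) i.castSucc) + trState ρ (clusterStab (n + 1) i.succ)) :
    ¬ IsSeparable ρ :=
  not_isSeparable_of_one_lt (chainGraph (n + 1)) (chainGraph_adj_castSucc_succ i) h

/-- **`Tr(𝒲_k^{(C_N)} ϱ(p)) = 2p − 1`** on the noisy cluster state. [cite: TothGuhne2005Stabilizer, §III.A] -/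
theorem trState_clusterWitness_noisy (i : Fin n) (p : ℝ) :
    trState (noisyState (clusterVec (n + 1)) p) (clusterWitness i) = 2 * p - 1 :=
  trState_gsWitness_noisy (chainGraph (n + 1)) _ _ p

/-- **“The witness `𝒲_k^{(C_N)}` tolerates noise if `p_noise < 1/2`”** (and only then).
[cite: TothGuhne2005Stabilizer, §III.A; GuhneToth2009, §6.6.5] -/
theorem clusterWitness_detects_iff (i : Fin n) (p : ℝ) :
    trState (noisyState (clusterVec (n + 1)) p) (clusterWitness i) < 0 ↔ p < 1 / 2 :=
  gsWitness_detects_iff (chainGraph (n + 1)) _ _ p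

/-- **`Tr(𝒲'_k^{(C_N)} ϱ(p)) = 3p − 2`** on the noisy cluster state. [cite: TothGuhne2005Stabilizer, §III.A] -/
theorem trState_clusterWitness'_noisy (i : Fin n) (p : ℝ) :
    trState (noisyState (clusterVec (n + 1)) p) (clusterWitness' i) = 3 * p - 2 :=
  trState_gsWitness'_noisy (chainGraph (n + 1)) (chainGraph_adj_castSucc_succ i) p

/-- **“This witness … tolerates noise if `p_noise < 2/3`”** (and only then).
[cite: TothGuhne2005Stabilizer, §III.A; GuhneToth2009, §6.6.5] -/
theorem clusterWitness'_detects_iff (i : Fin n) (p : ℝ) :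
    trState (noisyState (clusterVec (n + 1)) p) (clusterWitness' i) < 0 ↔ p < 2 / 3 :=
  gsWitness'_detects_iff (chainGraph (n + 1)) (chainGraph_adj_castSucc_succ i) p

/-- The noisy cluster state `p𝟙/2^N + (1−p)|C_N⟩⟨C_N|` (`N ≥ 2`) is entangled for every `p < 2/3`.
[cite: TothGuhne2005Stabilizer, §III.A] -/
theorem not_isSeparable_noisyCluster (i : Fin n) {p : ℝ} (hp : p < 2 / 3) :
    ¬ IsSeparable (noisyState (clusterVec (n + 1)) p) :=
  not_isSeparable_noisy_graphState (chainGraph (n + 1)) (chainGraph_adj_castSucc_succ i) hp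

/-! ## (v2) Genuine multipartite entanglement: the projector witness `𝟙/2 − |G_N⟩⟨G_N|`

Tóth–Gühne 2005 **Theorem 6** (“`𝒲̃_{C_N} := 𝟙/2 − |C_N⟩⟨C_N|` … detect[s] genuine `N`-party
entanglement close to a cluster state”) and the first step of the proof of **Theorem 7** (“First one
has to show that `𝟙/2 − |G_N⟩⟨G_N|` is a witness for true multipartite entanglement”); Gühne–Tóth
2009 §3.6.1–3.6.2 eqs. (70)–(73) (the projector witness `α𝟙 − |ψ⟩⟨ψ|`, `α` = the maximal squared
overlap with biseparable states).  OUR ROUTE (flagged): instead of the printed Schmidt-coefficient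
argument (“from a cluster state one can generate a singlet between arbitrary qubits by local
operations … the maximal Schmidt coefficient … does not exceed `1/√2`”) we bound the overlap through
two stabilizers across the cut: `|G_N⟩⟨G_N| ≤ (𝟙 + S_i)(𝟙 + S_j)/4` for any two vertices, and for an
edge `i ∼ j` crossing the cut `A | Ā` the restrictions of `S_i`, `S_j` to each side are locally
anticommuting dichotomic observables, whence `⟨S_i⟩ + ⟨S_j⟩ + ⟨S_iS_j⟩ ≤ 1` on `|a⟩_A ⊗ |b⟩_Ā` by
the Bloch-ball inequality for anticommuting triples and Cauchy–Schwarz. -/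

section PauliWordOn

variable {S : Type*} [Fintype S] [DecidableEq S]

/-- Entries of a product of two Pauli strings on an arbitrary finite register (`pauliWordOn` of
`UnentangledSpinsBound.lean` — the two sides `A`, `Ā` of a cut are such registers).
[cite: TothGuhne2005Stabilizer, Definition 1 (`K = K^{(1)} ⊗ ⋯ ⊗ K^{(N)}`)] -/
theorem pauliWordOn_mul_apply (u w : S → Pauli) (x z : S → Bool) :
    (pauliWordOn u * pauliWordOn w) x z = ∏ s, ((u s).mat * (w s).mat) (x s) (z s) := by
  rw [Matrix.mul_apply]
  simp only [pauliWordOn_apply]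
  have h : ∀ y : S → Bool, (∏ j, (u j).mat (x j) (y j)) * (∏ j, (w j).mat (y j) (z j)) =
      ∏ j, (u j).mat (x j) (y j) * (w j).mat (y j) (z j) :=
    fun y => (Finset.prod_mul_distrib).symm
  simp_rw [h]
  rw [← Fintype.piFinset_univ, ← Finset.prod_univ_sum (fun _ => (Finset.univ : Finset Bool))
    (fun j b => (u j).mat (x j) b * (w j).mat b (z j))]
  refine Finset.prod_congr rfl fun j _ => ?_
  rw [Matrix.mul_apply]

/-- `(⊗σ_w)² = 𝟙` (dichotomic observables) on any finite register. [cite: TothGuhne2005Stabilizer,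
Definition 1] -/
theorem pauliWordOn_mul_self (w : S → Pauli) : pauliWordOn w * pauliWordOn w = 1 := by
  ext x z
  rw [pauliWordOn_mul_apply, Matrix.one_apply]
  simp_rw [Pauli.mat_mul_self, Matrix.one_apply]
  by_cases hxz : x = z
  · subst hxz; simp
  · rw [if_neg hxz]
    have : ∃ j, x j ≠ z j := by
      by_contra hall; push Not at hall; exact hxz (funext hall)
    obtain ⟨j, hj⟩ := this
    exact Finset.prod_eq_zero (Finset.mem_univ j) (if_neg hj)

/-- **“Commute locally” ⟹ commute, with one exceptional site ⟹ anticommute**: if the letters of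
`⊗σ_u` and `⊗σ_w` anticommute at one site `s₀` and commute at every other site, then
`(⊗σ_u)(⊗σ_w) = −(⊗σ_w)(⊗σ_u)`. [cite: TothGuhne2005Stabilizer, Definition 1 and Observation 1
(“locally non-commuting”)] -/
theorem pauliWordOn_anticomm {u w : S → Pauli} (s₀ : S)
    (h0 : (u s₀).mat * (w s₀).mat = -((w s₀).mat * (u s₀).mat))
    (h1 : ∀ s, s ≠ s₀ → (u s).mat * (w s).mat = (w s).mat * (u s).mat) :
    pauliWordOn u * pauliWordOn w = -(pauliWordOn w * pauliWordOn u) := by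
  ext x z
  rw [Matrix.neg_apply, pauliWordOn_mul_apply, pauliWordOn_mul_apply,
    ← Finset.mul_prod_erase Finset.univ (fun s => ((u s).mat * (w s).mat) (x s) (z s))
      (Finset.mem_univ s₀),
    ← Finset.mul_prod_erase Finset.univ (fun s => ((w s).mat * (u s).mat) (x s) (z s))
      (Finset.mem_univ s₀),
    h0, Matrix.neg_apply,
    Finset.prod_congr rfl (fun s hs => by rw [h1 s (Finset.ne_of_mem_erase hs)])]
  ring

/-- If the letters commute at every site, the strings commute. [cite: TothGuhne2005Stabilizer,
Definition 1 (“commute locally”)] -/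
theorem pauliWordOn_comm_of_local {u w : S → Pauli}
    (h : ∀ s, (u s).mat * (w s).mat = (w s).mat * (u s).mat) :
    pauliWordOn u * pauliWordOn w = pauliWordOn w * pauliWordOn u := by
  ext x z
  rw [pauliWordOn_mul_apply, pauliWordOn_mul_apply]
  exact Finset.prod_congr rfl fun s _ => by rw [h s]

/-- Two exceptional (anticommuting) sites `s₀ ≠ s₁` ⟹ the strings commute.
[cite: TothGuhne2005Stabilizer, Definition 1] -/
theorem pauliWordOn_comm_of_two {u w : S → Pauli} {s₀ s₁ : S} (hne : s₀ ≠ s₁)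
    (h0 : (u s₀).mat * (w s₀).mat = -((w s₀).mat * (u s₀).mat))
    (h0' : (u s₁).mat * (w s₁).mat = -((w s₁).mat * (u s₁).mat))
    (h1 : ∀ s, s ≠ s₀ → s ≠ s₁ → (u s).mat * (w s).mat = (w s).mat * (u s).mat) :
    pauliWordOn u * pauliWordOn w = pauliWordOn w * pauliWordOn u := by
  ext x z
  rw [pauliWordOn_mul_apply, pauliWordOn_mul_apply]
  have hf : ∀ s, ((u s).mat * (w s).mat) (x s) (z s) =
      (if s = s₀ ∨ s = s₁ then (-1 : ℂ) else 1) * ((w s).mat * (u s).mat) (x s) (z s) := by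
    intro s
    by_cases hs0 : s = s₀
    · subst hs0; rw [if_pos (Or.inl rfl), h0, Matrix.neg_apply]; ring
    · by_cases hs1 : s = s₁
      · subst hs1; rw [if_pos (Or.inr rfl), h0', Matrix.neg_apply]; ring
      · rw [if_neg (not_or.mpr ⟨hs0, hs1⟩), h1 s hs0 hs1, one_mul]
  simp_rw [hf]
  rw [Finset.prod_mul_distrib, Finset.prod_ite, Finset.prod_const_one, mul_one, Finset.prod_const]
  have hset : (Finset.univ.filter fun s : S => s = s₀ ∨ s = s₁) = {s₀, s₁} := by
    ext s; simp
  rw [hset, Finset.card_pair hne]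
  norm_num

/-- `σ_x σ_z = −σ_z σ_x`. [folklore] -/
private theorem Pauli_X_mul_Z : Pauli.X.mat * Pauli.Z.mat = -(Pauli.Z.mat * Pauli.X.mat) := by
  ext a b
  rw [Matrix.neg_apply, Pauli.mul_apply_bool, Pauli.mul_apply_bool]
  cases a <;> cases b <;> simp

/-- `σ_z σ_x = −σ_x σ_z`. [folklore] -/
private theorem Pauli_Z_mul_X : Pauli.Z.mat * Pauli.X.mat = -(Pauli.X.mat * Pauli.Z.mat) := by
  rw [Pauli_X_mul_Z, neg_neg]

/-- Letters from `{σ_z, 𝟙}` commute. [folklore] -/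
private theorem Pauli_comm_of_ZI {P Q : Pauli} (hP : P = Pauli.Z ∨ P = Pauli.I) (hQ : Q = Pauli.Z ∨ Q = Pauli.I) :
    P.mat * Q.mat = Q.mat * P.mat := by
  rcases hP with rfl | rfl <;> rcases hQ with rfl | rfl <;> simp [pauliI_mat]

end PauliWordOn

/-! ### Generators commute; `|G_N⟩⟨G_N| ≤ (𝟙 + S_i)(𝟙 + S_j)/4` -/

/-- Away from its own vertex the letters of `S_k` are `σ_z` or `𝟙`. [cite: TothGuhne2005Stabilizer,
§III.B (`S_k^{(G_N)} = X^{(k)} Π_{l≠k} (Z^{(l)})^{Γ_{kl}}`)] -/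
theorem stabLetter_of_ne {k l : Fin N} (h : l ≠ k) :
    stabLetter G k l = Pauli.Z ∨ stabLetter G k l = Pauli.I := by
  rw [stabLetter, if_neg h]
  split_ifs <;> simp

/-- **The generators commute: `S_iS_j = S_jS_i`** (they anticommute at exactly the two sites `i`,
`j` when `i ∼ j`, nowhere otherwise). [cite: GuhneToth2009, §3.4.3 (“the commutative group of this
operators is called the stabilizer”); TothGuhne2005Stabilizer, §III.B] -/
theorem graphStab_comm (i j : Fin N) : graphStab G i * graphStab G j = graphStab G j * graphStab G i := by
  by_cases hij : i = j
  · subst hij; rfl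
  rw [graphStab, graphStab, pauliWord_eq_pauliWordOn, pauliWord_eq_pauliWordOn]
  by_cases hadj : G.Adj i j
  · refine pauliWordOn_comm_of_two hij ?_ ?_ ?_
    · rw [stabLetter, stabLetter, if_pos rfl, if_neg hij, if_pos hadj.symm]; exact Pauli_X_mul_Z
    · rw [stabLetter, stabLetter, if_neg (Ne.symm hij), if_pos hadj, if_pos rfl]; exact Pauli_Z_mul_X
    · intro s hs0 hs1
      exact Pauli_comm_of_ZI (stabLetter_of_ne G hs0) (stabLetter_of_ne G hs1)
  · refine pauliWordOn_comm_of_local fun s => ?_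
    by_cases hs0 : s = i
    · subst hs0
      rw [stabLetter, stabLetter, if_pos rfl, if_neg hij, if_neg (fun h => hadj h.symm), pauliI_mat,
        mul_one, one_mul]
    · by_cases hs1 : s = j
      · subst hs1
        rw [stabLetter, stabLetter, if_neg hs0, if_neg hadj, if_pos rfl, pauliI_mat, mul_one, one_mul]
      · exact Pauli_comm_of_ZI (stabLetter_of_ne G hs0) (stabLetter_of_ne G hs1)

/-- The two-generator operator `Q_{ij} = (𝟙 + S_i)(𝟙 + S_j)` (four times the projector onto the
joint `+1` eigenspace; cf. `|G⟩⟨G| = Π_k (𝟙 + g_k)/2`, eq. (58)). [cite: GuhneToth2009, §3.4.3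
eq. (58)] -/
noncomputable def stabPairOp (i j : Fin N) : Matrix (Fin N → Bool) (Fin N → Bool) ℂ :=
  (1 + graphStab G i) * (1 + graphStab G j)

/-- `Q_{ij}|G_N⟩ = 4|G_N⟩`. [cite: GuhneToth2009, §3.4.3 eqs. (57)–(58)] -/
theorem stabPairOp_mulVec_graphStateVec (i j : Fin N) :
    stabPairOp G i j *ᵥ graphStateVec G = (4 : ℂ) • graphStateVec G := by
  have h : ∀ k, (1 + graphStab G k) *ᵥ graphStateVec G = (2 : ℂ) • graphStateVec G := by
    intro k; rw [add_mulVec, one_mulVec, graphStab_mulVec_graphStateVec, two_smul]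
  rw [stabPairOp, ← mulVec_mulVec, h j, mulVec_smul, h i, smul_smul]
  norm_num

/-- `Q_{ij}` is Hermitian. [cite: GuhneToth2009, §3.4.3 eq. (58)] -/
theorem conjTranspose_stabPairOp (i j : Fin N) : (stabPairOp G i j)ᴴ = stabPairOp G i j := by
  rw [stabPairOp, conjTranspose_mul, conjTranspose_add, conjTranspose_add, conjTranspose_one,
    (graphStab_isHermitian G i).eq, (graphStab_isHermitian G j).eq]
  simp only [mul_add, add_mul, one_mul, mul_one, graphStab_comm G j i]
  abel

/-- `Q_{ij}² = 4Q_{ij}` (so `Q_{ij}/4` is a projector). [cite: GuhneToth2009, §3.4.3 eq. (58)] -/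
theorem stabPairOp_mul_self (i j : Fin N) :
    stabPairOp G i j * stabPairOp G i j = (4 : ℂ) • stabPairOp G i j := by
  have ha := graphStab_mul_self G i
  have hb := graphStab_mul_self G j
  have hc := graphStab_comm G i j
  have h1 : (1 + graphStab G i) * (1 + graphStab G i) = (2 : ℂ) • (1 + graphStab G i) := by
    simp only [mul_add, add_mul, one_mul, mul_one, ha, two_smul]; abel
  have h2 : (1 + graphStab G j) * (1 + graphStab G j) = (2 : ℂ) • (1 + graphStab G j) := by
    simp only [mul_add, add_mul, one_mul, mul_one, hb, two_smul]; abel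
  have h3 : (1 + graphStab G j) * (1 + graphStab G i) = (1 + graphStab G i) * (1 + graphStab G j) := by
    simp only [mul_add, add_mul, one_mul, mul_one, hc]; abel
  rw [stabPairOp]
  calc (1 + graphStab G i) * (1 + graphStab G j) * ((1 + graphStab G i) * (1 + graphStab G j))
      = (1 + graphStab G i) * ((1 + graphStab G j) * (1 + graphStab G i)) * (1 + graphStab G j) := by
        simp only [mul_assoc]
    _ = (1 + graphStab G i) * (1 + graphStab G i) * ((1 + graphStab G j) * (1 + graphStab G j)) := by
        rw [h3]; simp only [mul_assoc]
    _ = (4 : ℂ) • ((1 + graphStab G i) * (1 + graphStab G j)) := by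
        rw [h1, h2, Matrix.smul_mul, Matrix.mul_smul, smul_smul]; norm_num

/-! ### A finite-dimensional Cauchy–Schwarz inequality and real expectations -/

section CauchySchwarz

variable {ι : Type*} [Fintype ι]

/-- `Re⟨u|u⟩ = Σ ‖u_i‖²`. [folklore] -/
private theorem re_star_dotProduct_self (u : ι → ℂ) : (star u ⬝ᵥ u).re = ∑ i, ‖u i‖ ^ 2 := by
  rw [dotProduct, Complex.re_sum]
  refine Finset.sum_congr rfl fun i _ => ?_
  rw [Pi.star_apply, Complex.star_def, ← Complex.normSq_eq_conj_mul_self, Complex.ofReal_re,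
    Complex.normSq_eq_norm_sq]

/-- **Cauchy–Schwarz**: `|⟨u|v⟩|² ≤ ⟨u|u⟩⟨v|v⟩` for finite complex vectors.
[cite: TothGuhne2005Stabilizer, Theorem 1 (proof: “based on the Cauchy-Schwarz inequality”)] -/
theorem normSq_star_dotProduct_le (u v : ι → ℂ) :
    Complex.normSq (star u ⬝ᵥ v) ≤ (star u ⬝ᵥ u).re * (star v ⬝ᵥ v).re := by
  have h1 : ‖star u ⬝ᵥ v‖ ≤ ∑ i, ‖u i‖ * ‖v i‖ := by
    rw [dotProduct]
    refine (norm_sum_le _ _).trans (le_of_eq (Finset.sum_congr rfl fun i _ => ?_))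
    rw [Pi.star_apply, norm_mul, norm_star]
  have h2 := Finset.sum_mul_sq_le_sq_mul_sq Finset.univ (fun i => ‖u i‖) (fun i => ‖v i‖)
  have h0 : 0 ≤ ∑ i, ‖u i‖ * ‖v i‖ :=
    Finset.sum_nonneg fun i _ => mul_nonneg (norm_nonneg _) (norm_nonneg _)
  rw [Complex.normSq_eq_norm_sq, re_star_dotProduct_self, re_star_dotProduct_self]
  calc ‖star u ⬝ᵥ v‖ ^ 2 ≤ (∑ i, ‖u i‖ * ‖v i‖) ^ 2 := pow_le_pow_left₀ (norm_nonneg _) h1 2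
    _ ≤ _ := h2

/-- The expectation of a Hermitian matrix is real. [folklore] -/
private theorem star_dotProduct_mulVec_ofReal {M : Matrix ι ι ℂ} (hM : M.IsHermitian) (a : ι → ℂ) :
    (((star a ⬝ᵥ (M *ᵥ a)).re : ℝ) : ℂ) = star a ⬝ᵥ (M *ᵥ a) := by
  have h : star (star a ⬝ᵥ (M *ᵥ a)) = star a ⬝ᵥ (M *ᵥ a) := by
    rw [← star_dotProduct, ← star_dotProduct_conjTranspose_mulVec, hM.eq]
  have h' : (starRingEnd ℂ) (star a ⬝ᵥ (M *ᵥ a)) = star a ⬝ᵥ (M *ᵥ a) := by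
    simpa [Complex.star_def] using h
  exact (Complex.conj_eq_iff_re).1 h'

/-- `⟨Ma|Ma⟩ = ⟨a|MᴴM a⟩`. [folklore] -/
private theorem star_mulVec_dotProduct_mulVec (M : Matrix ι ι ℂ) (a : ι → ℂ) :
    star (M *ᵥ a) ⬝ᵥ (M *ᵥ a) = star a ⬝ᵥ ((Mᴴ * M) *ᵥ a) := by
  rw [← mulVec_mulVec, star_dotProduct_conjTranspose_mulVec]

end CauchySchwarz

/-- **`|⟨G_N|φ⟩|² ≤ ¼⟨φ|(𝟙 + S_i)(𝟙 + S_j)|φ⟩` for every vector `φ` and any two vertices** — the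
operator inequality `|G_N⟩⟨G_N| ≤ (𝟙+S_i)(𝟙+S_j)/4` behind “`𝒲 − 2𝒲̃ ≥ 0`”-type comparisons of
stabilizer and projector witnesses. [cite: GuhneToth2009, §3.4.3 eq. (58) and §6.6.1 (stabilizer
witnesses versus the projector witness); TothGuhne2005Stabilizer, Theorem 6 (proof)] -/
theorem normSq_overlap_le_stabPair (i j : Fin N) (φ : (Fin N → Bool) → ℂ) :
    Complex.normSq (star (graphStateVec G) ⬝ᵥ φ) ≤
      1 / 4 * (star φ ⬝ᵥ (stabPairOp G i j *ᵥ φ)).re := by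
  have hQ := conjTranspose_stabPairOp G i j
  -- `⟨G|Qφ⟩ = 4⟨G|φ⟩`
  have h4 : star (graphStateVec G) ⬝ᵥ (stabPairOp G i j *ᵥ φ) = 4 * (star (graphStateVec G) ⬝ᵥ φ) := by
    rw [← hQ, star_dotProduct_conjTranspose_mulVec, stabPairOp_mulVec_graphStateVec, star_smul,
      smul_dotProduct, smul_eq_mul]
    norm_num
  -- Cauchy–Schwarz with `‖G‖ = 1` and `‖Qφ‖² = 4⟨φ|Q|φ⟩`
  have hCS := normSq_star_dotProduct_le (graphStateVec G) (stabPairOp G i j *ᵥ φ)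
  rw [h4, graphStateVec_norm, Complex.one_re, one_mul, star_mulVec_dotProduct_mulVec, hQ,
    stabPairOp_mul_self, smul_mulVec, dotProduct_smul, smul_eq_mul, Complex.normSq_mul] at hCS
  have h16 : Complex.normSq (4 : ℂ) = 16 := by
    rw [show (4 : ℂ) = ((4 : ℝ) : ℂ) by norm_num, Complex.normSq_ofReal]; norm_num
  rw [h16, show ((4 : ℂ) * (star φ ⬝ᵥ (stabPairOp G i j *ᵥ φ))).re =
    4 * (star φ ⬝ᵥ (stabPairOp G i j *ᵥ φ)).re by
      rw [show (4 : ℂ) = ((4 : ℝ) : ℂ) by norm_num, Complex.re_ofReal_mul]] at hCS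
  linarith

/-- `⟨φ|(𝟙+S_i)(𝟙+S_j)|φ⟩ = ⟨φ|φ⟩ + ⟨φ|S_i|φ⟩ + ⟨φ|S_j|φ⟩ + ⟨φ|S_iS_j|φ⟩`. [cite: GuhneToth2009,
§3.4.3 eq. (58)] -/
theorem star_dotProduct_stabPairOp_mulVec (i j : Fin N) (φ : (Fin N → Bool) → ℂ) :
    star φ ⬝ᵥ (stabPairOp G i j *ᵥ φ) = star φ ⬝ᵥ φ + star φ ⬝ᵥ (graphStab G i *ᵥ φ) +
      star φ ⬝ᵥ (graphStab G j *ᵥ φ) + star φ ⬝ᵥ ((graphStab G i * graphStab G j) *ᵥ φ) := by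
  rw [stabPairOp]
  have : (1 + graphStab G i) * (1 + graphStab G j) =
      1 + graphStab G i + graphStab G j + graphStab G i * graphStab G j := by
    simp only [mul_add, add_mul, one_mul, mul_one]; abel
  rw [this, add_mulVec, add_mulVec, add_mulVec, one_mulVec, dotProduct_add, dotProduct_add,
    dotProduct_add]

/-! ### The Bloch ball of an anticommuting triple -/

section BlochBall

variable {ι : Type*} [Fintype ι] [DecidableEq ι]

/-- **Bloch-ball inequality for locally anticommuting dichotomic observables.** If `K`, `L` are
Hermitian, `K² = L² = 𝟙` and `KL = −LK`, then with the third (Hermitian, dichotomic) partner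
`J = −iKL`: `⟨K⟩² + ⟨L⟩² + ⟨J⟩² ≤ ⟨a|a⟩²` for every vector `a` (for a unit vector: the vector of
expectations lies in the unit ball — the single-qubit `⟨X⟩² + ⟨Y⟩² + ⟨Z⟩² ≤ 1` used in the printed
proofs, for any anticommuting triple).  Proof: `M = ⟨K⟩K + ⟨L⟩L + ⟨J⟩J` has `M² = r²𝟙` and
`⟨a|M|a⟩ = r²`, so Cauchy–Schwarz gives `r⁴ ≤ r²⟨a|a⟩²`. [cite: TothGuhne2005Stabilizer, §II
(“using the fact that `⟨X⟩² + ⟨Y⟩² + ⟨Z⟩² ≤ 1`”) and Observation 1] -/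
theorem sq_expect_triple_le {K L : Matrix ι ι ℂ} (hK : K.IsHermitian) (hL : L.IsHermitian)
    (hK2 : K * K = 1) (hL2 : L * L = 1) (hKL : K * L = -(L * K)) (a : ι → ℂ) :
    (star a ⬝ᵥ (K *ᵥ a)).re ^ 2 + (star a ⬝ᵥ (L *ᵥ a)).re ^ 2 +
        (star a ⬝ᵥ (((-I) • (K * L)) *ᵥ a)).re ^ 2 ≤ (star a ⬝ᵥ a).re ^ 2 := by
  have hLK : L * K = -(K * L) := by rw [hKL, neg_neg]
  set J : Matrix ι ι ℂ := (-I) • (K * L) with hJdef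
  -- `J` is Hermitian, dichotomic, and anticommutes with `K` and `L`
  have hJ : J.IsHermitian := by
    change Jᴴ = J
    rw [hJdef, conjTranspose_smul, conjTranspose_mul, hK.eq, hL.eq, hLK, star_neg, Complex.star_def,
      Complex.conj_I, neg_neg, smul_neg, neg_smul]
  have hKLKL : K * L * (K * L) = -1 := by
    calc K * L * (K * L) = K * (L * K) * L := by simp only [mul_assoc]
      _ = -(K * K * (L * L)) := by rw [hLK]; simp only [mul_neg, neg_mul, mul_assoc]
      _ = -1 := by rw [hK2, hL2, one_mul]
  have hJ2 : J * J = 1 := by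
    rw [hJdef, Matrix.smul_mul, Matrix.mul_smul, smul_smul, hKLKL, smul_neg, ← neg_smul]
    have : -(-I * -I) = (1 : ℂ) := by rw [neg_mul_neg, I_mul_I, neg_neg]
    rw [this, one_smul]
  have hKJ : K * J = -(J * K) := by
    rw [hJdef, Matrix.mul_smul, Matrix.smul_mul, ← smul_neg]
    congr 1
    rw [← mul_assoc, hK2, one_mul, mul_assoc, hLK, mul_neg, ← mul_assoc, hK2, one_mul, neg_neg]
  have hLJ : L * J = -(J * L) := by
    rw [hJdef, Matrix.mul_smul, Matrix.smul_mul, ← smul_neg]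
    congr 1
    rw [← mul_assoc, hLK, neg_mul]
  -- the real expectations
  set x : ℝ := (star a ⬝ᵥ (K *ᵥ a)).re with hxdef
  set z : ℝ := (star a ⬝ᵥ (L *ᵥ a)).re with hzdef
  set t : ℝ := (star a ⬝ᵥ (J *ᵥ a)).re with htdef
  have hx : ((x : ℝ) : ℂ) = star a ⬝ᵥ (K *ᵥ a) := star_dotProduct_mulVec_ofReal hK a
  have hz : ((z : ℝ) : ℂ) = star a ⬝ᵥ (L *ᵥ a) := star_dotProduct_mulVec_ofReal hL a
  have ht : ((t : ℝ) : ℂ) = star a ⬝ᵥ (J *ᵥ a) := star_dotProduct_mulVec_ofReal hJ a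
  -- the operator `M = xK + zL + tJ`
  set M : Matrix ι ι ℂ := (x : ℂ) • K + (z : ℂ) • L + (t : ℂ) • J with hMdef
  have hMh : Mᴴ = M := by
    rw [hMdef, conjTranspose_add, conjTranspose_add, conjTranspose_smul, conjTranspose_smul,
      conjTranspose_smul, hK.eq, hL.eq, hJ.eq]
    simp only [Complex.star_def, Complex.conj_ofReal]
  have hMM : M * M = (((x ^ 2 + z ^ 2 + t ^ 2 : ℝ)) : ℂ) • (1 : Matrix ι ι ℂ) := by
    have hJK : J * K = -(K * J) := by rw [hKJ, neg_neg]
    have hJL : J * L = -(L * J) := by rw [hLJ, neg_neg]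
    rw [hMdef]
    simp only [add_mul, mul_add, Matrix.smul_mul, Matrix.mul_smul, smul_smul, hK2, hL2, hJ2, hLK,
      hJK, hJL, smul_neg]
    push_cast
    module
  have hMa : star a ⬝ᵥ (M *ᵥ a) = (((x ^ 2 + z ^ 2 + t ^ 2 : ℝ)) : ℂ) := by
    rw [hMdef, add_mulVec, add_mulVec, smul_mulVec, smul_mulVec, smul_mulVec,
      dotProduct_add, dotProduct_add, dotProduct_smul, dotProduct_smul, dotProduct_smul, ← hx, ← hz,
      ← ht, smul_eq_mul, smul_eq_mul, smul_eq_mul]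
    push_cast; ring
  -- Cauchy–Schwarz: `|⟨a|Ma⟩|² ≤ ⟨a|a⟩⟨Ma|Ma⟩ = ⟨a|a⟩ · r² ⟨a|a⟩`
  have hCS := normSq_star_dotProduct_le a (M *ᵥ a)
  rw [star_mulVec_dotProduct_mulVec, hMh, hMM, smul_mulVec, one_mulVec, dotProduct_smul,
    smul_eq_mul, Complex.re_ofReal_mul, hMa, Complex.normSq_ofReal] at hCS
  -- conclude `r² ≤ ⟨a|a⟩²`
  set r2 : ℝ := x ^ 2 + z ^ 2 + t ^ 2 with hr2
  have hn : 0 ≤ (star a ⬝ᵥ a).re := by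
    rw [re_star_dotProduct_self]; exact Finset.sum_nonneg fun i _ => sq_nonneg _
  have hr : 0 ≤ r2 := by positivity
  by_cases h0 : r2 = 0
  · rw [h0]; positivity
  · have hpos : 0 < r2 := lt_of_le_of_ne hr (Ne.symm h0)
    nlinarith [hCS, hpos]

end BlochBall

/-! ### Pauli strings across a cut `A | Ā`: tensor rules -/

section CutTensor

variable (A : Finset (Fin N))

/-- `⟨a⊗b|⊗σ_w|a⊗b⟩ = ⟨a|⊗_Aσ_w|a⟩⟨b|⊗_Āσ_w|b⟩` — by the cut calculus of `UnentangledSpinsBound.lean`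
(`pauliWord_mulVec_tensorAcross`: `(⊗σ)(a⊗b) = (⊗_Aσ)a ⊗ (⊗_Āσ)b`, and
`star_tensorAcross_dotProduct`: `⟨a⊗b|a′⊗b′⟩ = ⟨a|a′⟩⟨b|b′⟩`). [cite: TothGuhne2005Stabilizer,
Theorem 1 (proof, first equality: expectations of product operators on product states factorise)] -/
theorem star_dotProduct_pauliWord_mulVec_tensorAcross (w : Fin N → Pauli)
    (a : ({i // i ∈ A} → Bool) → ℂ) (b : ({i // i ∉ A} → Bool) → ℂ) :
    star (tensorAcross A a b) ⬝ᵥ (pauliWord w *ᵥ tensorAcross A a b) =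
      (star a ⬝ᵥ (pauliWordOn (fun i : {i // i ∈ A} => w i) *ᵥ a)) *
        (star b ⬝ᵥ (pauliWordOn (fun i : {i // i ∉ A} => w i) *ᵥ b)) := by
  rw [pauliWord_mulVec_tensorAcross, star_tensorAcross_dotProduct]

/-- `⟨a⊗b|(⊗σ_u)(⊗σ_w)|a⊗b⟩` factorises likewise. [cite: TothGuhne2005Stabilizer, §II (the term
`S₁S_m`)] -/
theorem star_dotProduct_pauliWord_mul_mulVec_tensorAcross (u w : Fin N → Pauli)
    (a : ({i // i ∈ A} → Bool) → ℂ) (b : ({i // i ∉ A} → Bool) → ℂ) :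
    star (tensorAcross A a b) ⬝ᵥ ((pauliWord u * pauliWord w) *ᵥ tensorAcross A a b) =
      (star a ⬝ᵥ ((pauliWordOn (fun i : {i // i ∈ A} => u i) *
          pauliWordOn (fun i : {i // i ∈ A} => w i)) *ᵥ a)) *
        (star b ⬝ᵥ ((pauliWordOn (fun i : {i // i ∉ A} => u i) *
          pauliWordOn (fun i : {i // i ∉ A} => w i)) *ᵥ b)) := by
  rw [← mulVec_mulVec, pauliWord_mulVec_tensorAcross, pauliWord_mulVec_tensorAcross,
    star_tensorAcross_dotProduct, mulVec_mulVec, mulVec_mulVec]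

end CutTensor

/-! ### An edge across the cut: `⟨S_i⟩ + ⟨S_j⟩ + ⟨S_iS_j⟩ ≤ ⟨φ|φ⟩` on `|a⟩_A ⊗ |b⟩_Ā` -/

/-- The real Cauchy–Schwarz step: `x x′ + z z′ − t t′ ≤ √(x²+z²+t²)√(x′²+z′²+t′²) ≤ n n′` when
`x²+z²+t² ≤ n²`, `x′²+z′²+t′² ≤ n′²`, `n, n′ ≥ 0`. [cite: TothGuhne2005Stabilizer, Theorem 1 (proof)] -/
private theorem triple_cs {x z t x' z' t' n n' : ℝ} (h : x ^ 2 + z ^ 2 + t ^ 2 ≤ n ^ 2)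
    (h' : x' ^ 2 + z' ^ 2 + t' ^ 2 ≤ n' ^ 2) (hn : 0 ≤ n) (hn' : 0 ≤ n') :
    x * x' + z * z' - t * t' ≤ n * n' := by
  nlinarith [sq_nonneg (x * n' - x' * n), sq_nonneg (z * n' - z' * n), sq_nonneg (t * n' + t' * n),
    sq_nonneg (x * z' - z * x'), sq_nonneg (x * t' + t * x'), sq_nonneg (z * t' + t * z'),
    mul_nonneg hn hn', sq_nonneg (n * n' - (x * x' + z * z' - t * t'))]

/-- **The bipartite three-term bound**: for an edge `i ∼ j` with `i ∈ A`, `j ∉ A` and any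
`φ = |a⟩_A ⊗ |b⟩_Ā`: `⟨φ|S_i|φ⟩ + ⟨φ|S_j|φ⟩ + ⟨φ|S_iS_j|φ⟩ ≤ ⟨φ|φ⟩` (the restrictions of `S_i`,
`S_j` to each side anticommute at exactly one site). [cite: TothGuhne2005Stabilizer, §II (three-term
witness) and Observation 1; GuhneToth2009, §6.6.5 (“two locally non-commuting elements of the
stabilizer of any graph state”)] -/
theorem stab_three_le_of_cut {A : Finset (Fin N)} {i j : Fin N} (hi : i ∈ A) (hj : j ∉ A)
    (hadj : G.Adj i j) (a : ({i // i ∈ A} → Bool) → ℂ) (b : ({i // i ∉ A} → Bool) → ℂ) :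
    (star (tensorAcross A a b) ⬝ᵥ (graphStab G i *ᵥ tensorAcross A a b)).re +
      (star (tensorAcross A a b) ⬝ᵥ (graphStab G j *ᵥ tensorAcross A a b)).re +
      (star (tensorAcross A a b) ⬝ᵥ ((graphStab G i * graphStab G j) *ᵥ tensorAcross A a b)).re ≤
      (star (tensorAcross A a b) ⬝ᵥ tensorAcross A a b).re := by
  have hij : i ≠ j := G.ne_of_adj hadj
  -- the four restricted strings
  set KA := pauliWordOn (fun s : {s // s ∈ A} => stabLetter G i s) with hKA
  set LA := pauliWordOn (fun s : {s // s ∈ A} => stabLetter G j s) with hLA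
  set KB := pauliWordOn (fun s : {s // s ∉ A} => stabLetter G i s) with hKB
  set LB := pauliWordOn (fun s : {s // s ∉ A} => stabLetter G j s) with hLB
  -- anticommutation on each side (one exceptional site: `i` on `A`, `j` on `Ā`)
  have hA : KA * LA = -(LA * KA) := by
    refine pauliWordOn_anticomm ⟨i, hi⟩ ?_ ?_
    · show (stabLetter G i i).mat * (stabLetter G j i).mat = -((stabLetter G j i).mat * (stabLetter G i i).mat)
      rw [stabLetter, stabLetter, if_pos rfl, if_neg hij, if_pos hadj.symm]; exact Pauli_X_mul_Z
    · intro s hs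
      have hs' : (s : Fin N) ≠ i := fun h => hs (Subtype.ext h)
      have hsj : (s : Fin N) ≠ j := fun h => hj (h ▸ s.2)
      exact Pauli_comm_of_ZI (stabLetter_of_ne G hs') (stabLetter_of_ne G hsj)
  have hB : KB * LB = -(LB * KB) := by
    refine pauliWordOn_anticomm ⟨j, hj⟩ ?_ ?_
    · show (stabLetter G i j).mat * (stabLetter G j j).mat = -((stabLetter G j j).mat * (stabLetter G i j).mat)
      rw [stabLetter, stabLetter, if_neg (Ne.symm hij), if_pos hadj, if_pos rfl]; exact Pauli_Z_mul_X
    · intro s hs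
      have hs' : (s : Fin N) ≠ j := fun h => hs (Subtype.ext h)
      have hsi : (s : Fin N) ≠ i := fun h => s.2 (h ▸ hi)
      exact Pauli_comm_of_ZI (stabLetter_of_ne G hsi) (stabLetter_of_ne G hs')
  -- factorisations
  rw [graphStab, graphStab, star_dotProduct_pauliWord_mulVec_tensorAcross,
    star_dotProduct_pauliWord_mulVec_tensorAcross, star_dotProduct_pauliWord_mul_mulVec_tensorAcross,
    star_tensorAcross_dotProduct]
  rw [← hKA, ← hLA, ← hKB, ← hLB]
  -- real expectations `x, z` and `⟨KL⟩ = i t`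
  have hKAh : KA.IsHermitian := pauliWordOn_isHermitian _
  have hLAh : LA.IsHermitian := pauliWordOn_isHermitian _
  have hKBh : KB.IsHermitian := pauliWordOn_isHermitian _
  have hLBh : LB.IsHermitian := pauliWordOn_isHermitian _
  have exA := star_dotProduct_mulVec_ofReal hKAh a
  have ezA := star_dotProduct_mulVec_ofReal hLAh a
  have exB := star_dotProduct_mulVec_ofReal hKBh b
  have ezB := star_dotProduct_mulVec_ofReal hLBh b
  -- `J = −iKL` is Hermitian on each side, so `⟨KL⟩ = i⟨J⟩`
  have hJA : ((-I) • (KA * LA)).IsHermitian := by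
    change ((-I) • (KA * LA))ᴴ = (-I) • (KA * LA)
    rw [conjTranspose_smul, conjTranspose_mul, hKAh.eq, hLAh.eq, show LA * KA = -(KA * LA) by
      rw [hA, neg_neg], star_neg, Complex.star_def, Complex.conj_I, neg_neg, smul_neg, neg_smul]
  have hJB : ((-I) • (KB * LB)).IsHermitian := by
    change ((-I) • (KB * LB))ᴴ = (-I) • (KB * LB)
    rw [conjTranspose_smul, conjTranspose_mul, hKBh.eq, hLBh.eq, show LB * KB = -(KB * LB) by
      rw [hB, neg_neg], star_neg, Complex.star_def, Complex.conj_I, neg_neg, smul_neg, neg_smul]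
  have eKLA : star a ⬝ᵥ ((KA * LA) *ᵥ a) =
      I * (((star a ⬝ᵥ (((-I) • (KA * LA)) *ᵥ a)).re : ℝ) : ℂ) := by
    have h := star_dotProduct_mulVec_ofReal hJA a
    conv_rhs at h => rw [smul_mulVec, dotProduct_smul, smul_eq_mul]
    rw [h, ← mul_assoc, show I * -I = 1 by rw [mul_neg, I_mul_I, neg_neg], one_mul]
  have eKLB : star b ⬝ᵥ ((KB * LB) *ᵥ b) =
      I * (((star b ⬝ᵥ (((-I) • (KB * LB)) *ᵥ b)).re : ℝ) : ℂ) := by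
    have h := star_dotProduct_mulVec_ofReal hJB b
    conv_rhs at h => rw [smul_mulVec, dotProduct_smul, smul_eq_mul]
    rw [h, ← mul_assoc, show I * -I = 1 by rw [mul_neg, I_mul_I, neg_neg], one_mul]
  -- norms
  have hna : star a ⬝ᵥ a = (((star a ⬝ᵥ a).re : ℝ) : ℂ) := by
    have := star_dotProduct_mulVec_ofReal (Matrix.isHermitian_one : (1 : Matrix _ _ ℂ).IsHermitian) a
    rw [one_mulVec] at this; exact this.symm
  have hnb : star b ⬝ᵥ b = (((star b ⬝ᵥ b).re : ℝ) : ℂ) := by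
    have := star_dotProduct_mulVec_ofReal (Matrix.isHermitian_one : (1 : Matrix _ _ ℂ).IsHermitian) b
    rw [one_mulVec] at this; exact this.symm
  rw [← exA, ← ezA, ← exB, ← ezB, eKLA, eKLB, hna, hnb]
  have hre : ∀ u v : ℝ, (((u : ℝ) : ℂ) * ((v : ℝ) : ℂ)).re = u * v := by
    intro u v; rw [← Complex.ofReal_mul, Complex.ofReal_re]
  have hI : ∀ u v : ℝ, (I * (u : ℂ) * (I * (v : ℂ))).re = -(u * v) := by
    intro u v
    have : I * (u : ℂ) * (I * (v : ℂ)) = (((-(u * v) : ℝ)) : ℂ) := by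
      push_cast; linear_combination ((u : ℂ) * (v : ℂ)) * I_mul_I
    rw [this, Complex.ofReal_re]
  rw [hre, hre, hI, hre]
  -- Bloch balls on both sides and Cauchy–Schwarz
  have hballA := sq_expect_triple_le hKAh hLAh (pauliWordOn_mul_self _) (pauliWordOn_mul_self _) hA a
  have hballB := sq_expect_triple_le hKBh hLBh (pauliWordOn_mul_self _) (pauliWordOn_mul_self _) hB b
  have hna0 : 0 ≤ (star a ⬝ᵥ a).re := by
    rw [re_star_dotProduct_self]; exact Finset.sum_nonneg fun _ _ => sq_nonneg _
  have hnb0 : 0 ≤ (star b ⬝ᵥ b).re := by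
    rw [re_star_dotProduct_self]; exact Finset.sum_nonneg fun _ _ => sq_nonneg _
  have := triple_cs hballA hballB hna0 hnb0
  linarith

/-! ### The projector witness on connected graphs -/

/-- **Overlap bound across a crossed cut**: if an edge `i ∼ j` crosses the cut `A | Ā`, then
`|⟨G_N|a⊗b⟩|² ≤ ½‖a⊗b‖²` for every `|a⟩_A ⊗ |b⟩_Ā` — the squared maximal Schmidt coefficient of
`|G_N⟩` across the cut is at most `1/2` (it “does not exceed the maximal Schmidt coefficient of the
singlet, which equals `1/√2`”). [cite: TothGuhne2005Stabilizer, Theorem 6 (proof); GuhneToth2009,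
§3.6.1 eq. (70)] -/
theorem normSq_graphState_overlap_le {A : Finset (Fin N)} {i j : Fin N} (hi : i ∈ A) (hj : j ∉ A)
    (hadj : G.Adj i j) (a : ({i // i ∈ A} → Bool) → ℂ) (b : ({i // i ∉ A} → Bool) → ℂ) :
    Complex.normSq (star (graphStateVec G) ⬝ᵥ tensorAcross A a b) ≤
      1 / 2 * (star (tensorAcross A a b) ⬝ᵥ tensorAcross A a b).re := by
  have h1 := normSq_overlap_le_stabPair G i j (tensorAcross A a b)
  have h2 := stab_three_le_of_cut G hi hj hadj a b
  rw [star_dotProduct_stabPairOp_mulVec, Complex.add_re, Complex.add_re, Complex.add_re] at h1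
  linarith

omit [DecidableRel G.Adj] in
/-- **In a connected graph every proper cut `A | Ā` is crossed by an edge** (a walk from inside to
outside crosses the boundary — Mathlib's `SimpleGraph.Walk.exists_boundary_dart`); this is the
graph-theoretic content of “from a cluster state one can generate a singlet between arbitrary qubits”.
[cite: TothGuhne2005Stabilizer, Theorem 6 (proof)] -/
theorem exists_adj_across_of_connected (h : G.Connected) (A : Finset (Fin N)) (hA : A.Nonempty)
    (hAc : Aᶜ.Nonempty) : ∃ i ∈ A, ∃ j ∉ A, G.Adj i j := by
  obtain ⟨u, hu⟩ := hA
  obtain ⟨v, hv⟩ := hAc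
  rw [Finset.mem_compl] at hv
  obtain ⟨p⟩ := h.preconnected u v
  obtain ⟨d, -, hd1, hd2⟩ := p.exists_boundary_dart (A : Set (Fin N)) (by simpa using hu)
    (by simpa using hv)
  exact ⟨d.toProd.1, by simpa using hd1, d.toProd.2, by simpa using hd2, d.adj⟩

/-- **`|⟨G_N|ψ⟩|² ≤ ½⟨ψ|ψ⟩` for every biseparable pure `ψ`** and every connected graph: the constant
`α = 1/2` of the projector witness (70)–(71) for graph states.
[cite: GuhneToth2009, §3.6.1 eqs. (70)–(71); TothGuhne2005Stabilizer, Theorems 6–7 (proofs)] -/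
theorem normSq_graphState_overlap_le_of_isBiseparablePure (hG : G.Connected)
    {ψ : (Fin N → Bool) → ℂ} (hψ : IsBiseparablePure ψ) :
    Complex.normSq (star (graphStateVec G) ⬝ᵥ ψ) ≤ 1 / 2 * (star ψ ⬝ᵥ ψ).re := by
  obtain ⟨A, hA, hAc, a, b, rfl⟩ := hψ
  obtain ⟨i, hi, j, hj, hadj⟩ := exists_adj_across_of_connected G hG A hA hAc
  exact normSq_graphState_overlap_le G hi hj hadj a b

/-- The fidelity with the graph state, `F_G(ϱ) = ⟨G_N|ϱ|G_N⟩`. [cite: TothGuhne2005Stabilizer,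
§III.C (“`F := Tr(|GHZ_N⟩⟨GHZ_N|ρ)`”, here for `|G_N⟩`)] -/
noncomputable def graphFidelity (ρ : Matrix (Fin N → Bool) (Fin N → Bool) ℂ) : ℝ :=
  vecState (graphStateVec G) ρ

/-- **The projector witness `𝒲̃_{G_N} = 𝟙/2 − |G_N⟩⟨G_N|`.** [cite: TothGuhne2005Stabilizer,
Theorem 6 (`𝒲̃_{C_N} := 𝟙/2 − |C_N⟩⟨C_N|`) and Theorem 7 (proof); GuhneToth2009, §3.6.2 eq. (73)
(GHZ analogue)] -/
noncomputable def graphProjWitness : Matrix (Fin N → Bool) (Fin N → Bool) ℂ :=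
  ((1 / 2 : ℝ) : ℂ) • (1 : Matrix (Fin N → Bool) (Fin N → Bool) ℂ) -
    vecMulVec (graphStateVec G) (star (graphStateVec G))

/-- **Cone form**: `⟨G_N|ϱ|G_N⟩ ≤ ½ Tr ϱ` on the cone of biseparable pure states (connected graph).
[cite: GuhneToth2009, §3.6.1 eqs. (70)–(71)] -/
theorem graphFidelity_le_half_trace (hG : G.Connected) {ι : Type*} [Fintype ι] {p : ι → ℝ}
    (hp : ∀ k, 0 ≤ p k) {ψ : ι → (Fin N → Bool) → ℂ} (hψ : ∀ k, IsBiseparablePure (ψ k)) :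
    graphFidelity G (∑ k, (p k : ℂ) • vecMulVec (ψ k) (star (ψ k))) ≤
      1 / 2 * (∑ k, (p k : ℂ) • vecMulVec (ψ k) (star (ψ k))).trace.re := by
  rw [graphFidelity, vecState_sum_smul_vecMulVec, trace_sum_smul_vecMulVec, Complex.re_sum,
    Finset.mul_sum]
  refine Finset.sum_le_sum fun k _ => ?_
  rw [Complex.re_ofReal_mul, ← mul_assoc, mul_comm (1 / 2 : ℝ) (p k), mul_assoc]
  exact mul_le_mul_of_nonneg_left (normSq_graphState_overlap_le_of_isBiseparablePure G hG (hψ k))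
    (hp k)

/-- **`F_G(ϱ) ≤ 1/2` for every biseparable `ϱ`**, for every connected graph `G`.
[cite: TothGuhne2005Stabilizer, Theorems 6–7 (the projector witness); GuhneToth2009, §3.6.1 eq. (71)] -/
theorem graphFidelity_le_half (hG : G.Connected) {ρ : Matrix (Fin N → Bool) (Fin N → Bool) ℂ}
    (hρ : IsBiseparable ρ) : graphFidelity G ρ ≤ 1 / 2 := by
  obtain ⟨ι, _, p, ψ, hp, h1, hunit, hψ, rfl⟩ := hρ
  have h := graphFidelity_le_half_trace G hG hp hψ
  rw [trace_sum_smul_vecMulVec] at h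
  simp only [hunit, mul_one] at h
  rw [← Complex.ofReal_sum, h1, Complex.ofReal_one, Complex.one_re, mul_one] at h
  exact h

/-- **GME criterion**: `F_G(ϱ) > 1/2 ⟹ ϱ` is genuinely `N`-partite entangled (not biseparable).
[cite: TothGuhne2005Stabilizer, Theorems 6–7; GuhneToth2009, §3.6.2 eq. (73)] -/
theorem not_isBiseparable_of_half_lt_graphFidelity (hG : G.Connected)
    {ρ : Matrix (Fin N → Bool) (Fin N → Bool) ℂ} (h : 1 / 2 < graphFidelity G ρ) :
    ¬ IsBiseparable ρ :=
  fun hρ => absurd h (not_lt.2 (graphFidelity_le_half G hG hρ))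

/-- `Tr(ϱ 𝒲̃_{G_N}) = ½ Tr ϱ − F_G(ϱ)` (real parts). [cite: TothGuhne2005Stabilizer, Theorem 6] -/
theorem trState_graphProjWitness (ρ : Matrix (Fin N → Bool) (Fin N → Bool) ℂ) :
    trState ρ (graphProjWitness G) = 1 / 2 * ρ.trace.re - graphFidelity G ρ := by
  rw [graphProjWitness, map_sub, trState_apply, trState_apply, Matrix.mul_smul, Matrix.mul_one,
    trace_smul, smul_eq_mul, Complex.re_ofReal_mul, Matrix.mul_vecMulVec, Matrix.trace_vecMulVec,
    dotProduct_comm, graphFidelity, vecState_apply]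

/-- **Theorem 6 / Theorem 7 (projector part): `𝒲̃_{G_N}` is an entanglement witness for genuine
`N`-party entanglement** — `Tr(ϱ𝒲̃_{G_N}) ≥ 0` on biseparable `ϱ` (connected `G`).
[cite: TothGuhne2005Stabilizer, Theorem 6 and Theorem 7 (proof)] -/
theorem trState_graphProjWitness_nonneg (hG : G.Connected)
    {ρ : Matrix (Fin N → Bool) (Fin N → Bool) ℂ} (hρ : IsBiseparable ρ) :
    0 ≤ trState ρ (graphProjWitness G) := by
  rw [trState_graphProjWitness, trace_eq_one_of_isBiseparable hρ, Complex.one_re, mul_one]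
  linarith [graphFidelity_le_half G hG hρ]

/-- The witness is not vacuous: `F_G(|G_N⟩⟨G_N|) = 1`. [cite: TothGuhne2005Stabilizer, Theorem 6] -/
theorem graphFidelity_graphState :
    graphFidelity G (vecMulVec (graphStateVec G) (star (graphStateVec G))) = 1 := by
  rw [graphFidelity, vecState_vecMulVec, graphStateVec_norm, map_one]

/-- `|G_N⟩` is genuinely `N`-partite entangled for every connected graph `G`.
[cite: TothGuhne2005Stabilizer, Theorems 6–7; GuhneToth2009, §3.4.3 (graph states as “maximally
entangled” multi-qubit states)] -/
theorem not_isBiseparable_graphState (hG : G.Connected) :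
    ¬ IsBiseparable (vecMulVec (graphStateVec G) (star (graphStateVec G))) :=
  not_isBiseparable_of_half_lt_graphFidelity G hG (by rw [graphFidelity_graphState]; norm_num)

/-! ### The cluster state: Theorem 6's `𝒲̃_{C_N} = 𝟙/2 − |C_N⟩⟨C_N|` -/

/-- The chain on `N ≥ 1` sites (the cluster state's graph, “Chain (2-colorable)”) is connected
(Mathlib `pathGraph_connected`). [cite: TothGuhne2005Stabilizer, §III.B (Fig. 2(a) “Chain”)] -/
theorem chainGraph_connected (n : ℕ) : (chainGraph (n + 1)).Connected := by
  rw [chainGraph_eq_pathGraph]; exact SimpleGraph.pathGraph_connected n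

/-- The cluster-state fidelity `F_{C_N}(ϱ) = ⟨C_N|ϱ|C_N⟩`. [cite: TothGuhne2005Stabilizer, §III.C
(fidelity “with respect to the cluster state”)] -/
noncomputable def clusterFidelity (N : ℕ) (ρ : Matrix (Fin N → Bool) (Fin N → Bool) ℂ) : ℝ :=
  graphFidelity (chainGraph N) ρ

/-- **Theorem 6 (projector witness): `⟨C_N|ϱ|C_N⟩ ≤ 1/2` for every biseparable `ϱ`** (`N ≥ 1`;
for `N = 1` nothing is biseparable). [cite: TothGuhne2005Stabilizer, Theorem 6
(“`𝒲̃_{C_N} := 𝟙/2 − |C_N⟩⟨C_N|` … detect[s] genuine `N`-party entanglement”)] -/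
theorem clusterFidelity_le_half {ρ : Matrix (Fin (n + 1) → Bool) (Fin (n + 1) → Bool) ℂ}
    (hρ : IsBiseparable ρ) : clusterFidelity (n + 1) ρ ≤ 1 / 2 :=
  graphFidelity_le_half _ (chainGraph_connected n) hρ

/-- **`F_{C_N} > 1/2 ⟹` genuine `N`-partite entanglement.** [cite: TothGuhne2005Stabilizer, Theorem 6] -/
theorem not_isBiseparable_of_half_lt_clusterFidelity
    {ρ : Matrix (Fin (n + 1) → Bool) (Fin (n + 1) → Bool) ℂ} (h : 1 / 2 < clusterFidelity (n + 1) ρ) :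
    ¬ IsBiseparable ρ :=
  not_isBiseparable_of_half_lt_graphFidelity _ (chainGraph_connected n) h

/-- `|C_N⟩` is genuinely `N`-partite entangled (`N ≥ 1`). [cite: TothGuhne2005Stabilizer, §III.A] -/
theorem not_isBiseparable_clusterVec :
    ¬ IsBiseparable (vecMulVec (clusterVec (n + 1)) (star (clusterVec (n + 1)))) :=
  not_isBiseparable_graphState _ (chainGraph_connected n)

/-! ## (v2, part 2) The stabilizer projector `|G_N⟩⟨G_N| = Π_k (𝟙 + S_k)/2`, Theorem 6's two-setting
witness and Theorem 7's witness `(N − 1)𝟙 − Σ_k S_k`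

Tóth–Gühne 2005 **Theorem 6**, second witness: “`𝒲_{C_N} := 3𝟙 − 2[Π_{odd k} (S_k^{(C_N)}+𝟙)/2 +
Π_{even k} (S_k^{(C_N)}+𝟙)/2]` … detect[s] genuine `N`-party entanglement close to a cluster state”
(proof: “This can be proved similarly as it has been done for Theorem 3 using that
`𝒲_{C_N} − 2𝒲̃_{C_N} ≥ 0`”; after the proof: “Witness `𝒲^{(C_N)}` tolerates mixing with noise if
`p_noise < (4 − 4/2^{N/2})^{−1}` for even `N`, `[4 − 2(1/2^{(N+1)/2} + 1/2^{(N−1)/2})]^{−1}` for odd `N`.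
Thus, for any number of qubits at least 25 % noise is tolerated”).  **Theorem 7**, second witness:
“a witness detecting genuine `N`-party entanglement can be defined as
`𝒲^{(G_N)} := (N−1)𝟙 − Σ_k S_k^{(G_N)}`” (proof: “The proofs are essentially the same as before. First
one has to show that `𝟙/2 − |G_N⟩⟨G_N|` is a witness for true multipartite entanglement. Then one can
prove that [the] witnesses … detect also only genuine multipartite entanglement”); for the GHZ graph
this is **Theorem 2** (“the constant term, `c_0 = N−1`, was chosen such that the observable
`X_α := 𝒲 − α𝒲̃_{GHZ_N} ≥ 0` for some `α > 0` is positive semidefinite … One can check that with this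
choice `𝒲 − 2𝒲̃_{GHZ_N} ≥ 0`”; “detects states mixed with noise … if `p_noise < 1/N`”).  Gühne–Tóth
2009 §6.6: eq. (135) (`𝒲_stab − α𝒲 ≥ 0`), eq. (137) (“the projector to `|Ψ⟩` can be written as
`|Ψ⟩⟨Ψ| = 2^{−N} Σ_k S_k = Π_{k=1}^N (𝟙+g_k)/2`”), eqs. (143)–(144) (the cluster witness and its
tolerance, “For large `N` the limit is `p_noise = 1/4`”) and eq. (145) (“for a `k`-colorable graph
state `|G_N⟩` the following witness detects genuine multi-partite entanglement.
`𝒲̃_{G_N} := 3𝟙 − 2[Σ_{j=1}^k (Π_{i∈M_j} (g_i+𝟙)/2)]` … requires the measurement of `k` settings”)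
— formalised here for `k = 2` colour classes `T`, `Tᶜ`.

OUR ROUTE (flagged): (i) the partial products `Π_G(T) := Π_{k∈T}(𝟙+S_k)/2` are DEFINED by the closed
form `⟨x|Π_G(T)|y⟩ = 2^{−|T|} χ_G(x)χ_G(y)·[x_l = y_l for all l ∉ T]` (`χ_G(x) = (−1)^{q_G(x)}`,
`stabProj`), from which the product rule `(𝟙+S_k)/2 · Π_G(T) = Π_G(T ∪ {k})`, `Π_G({k}) = (𝟙+S_k)/2`,
`Π_G(T)Π_G(U) = Π_G(T ∪ U)` and (137) `Π_G(V) = |G_N⟩⟨G_N|` are proved; (ii) both comparisons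
`𝒲 − 2𝒲̃ ≥ 0` are reduced to `A + B ≤ 𝟙 + AB` for commuting projectors (`(𝟙−A)(𝟙−B)` is a
projector), stated as quadratic-form inequalities; the two-setting witness is proved to detect only
genuine `N`-party entanglement for an ARBITRARY vertex bipartition `T | Tᶜ` of any connected graph
(colour classes are only needed to measure each product with one local setting — measurability is not
formalised; `k ≥ 3` colour classes are not covered). -/

section StabProj

/-- **The partial stabilizer projectors `Π_G(T) = Π_{k∈T} (𝟙 + S_k)/2` in closed form**:
`⟨x|Π_G(T)|y⟩ = 2^{−|T|} χ_G(x) χ_G(y) [x_l = y_l for all l ∉ T]`, `χ_G(x) = (−1)^{q_G(x)}`.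
[cite: GuhneToth2009, §6.6 eq. (137)] -/
noncomputable def stabProj (T : Finset (Fin N)) : Matrix (Fin N → Bool) (Fin N → Bool) ℂ :=
  Matrix.of fun x y => if (∀ l, l ∉ T → x l = y l) then
    (1 / 2 : ℂ) ^ T.card * (chi (edgeParity G x) * chi (edgeParity G y)) else 0

/-- Unfolding `stabProj`. [cite: GuhneToth2009, §6.6 eq. (137)] -/
theorem stabProj_apply (T : Finset (Fin N)) (x y : Fin N → Bool) :
    stabProj G T x y = if (∀ l, l ∉ T → x l = y l) then
      (1 / 2 : ℂ) ^ T.card * (chi (edgeParity G x) * chi (edgeParity G y)) else 0 := rfl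

/-- `Π_G(∅) = 𝟙`. [cite: GuhneToth2009, §6.6 eq. (137)] -/
theorem stabProj_empty : stabProj G ∅ = 1 := by
  ext x y
  rw [stabProj_apply, Finset.card_empty, pow_zero, one_mul, Matrix.one_apply]
  by_cases hxy : x = y
  · subst hxy
    rw [if_pos (fun l _ => rfl), if_pos rfl, chi_mul_self]
  · rw [if_neg, if_neg hxy]
    intro h
    exact hxy (funext fun l => h l (Finset.notMem_empty l))

/-- **`Π_G(V) = |G_N⟩⟨G_N|`** — “the projector to `|Ψ⟩` can be written as
`|Ψ⟩⟨Ψ| = 2^{−N} Σ_k S_k = Π_{k=1}^N (𝟙 + g_k)/2`”. [cite: GuhneToth2009, §6.6 eq. (137)] -/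
theorem stabProj_univ :
    stabProj G Finset.univ = vecMulVec (graphStateVec G) (star (graphStateVec G)) := by
  ext x y
  rw [stabProj_apply, if_pos (fun l hl => absurd (Finset.mem_univ l) hl), Finset.card_univ,
    Fintype.card_fin, vecMulVec_apply, Pi.star_apply, graphStateVec, graphStateVec, star_mul',
    star_chi, star_pow, Complex.star_def, Complex.conj_ofReal]
  have h2 : ((1 / 2 : ℂ)) ^ N = (CHSHOpt.invSqrtTwo : ℂ) ^ N * (CHSHOpt.invSqrtTwo : ℂ) ^ N := by
    rw [← mul_pow, invSqrtTwo_mul_self_C]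
  rw [h2]; ring

/-- `Π_G(T)` is Hermitian (its entries are real and symmetric). [cite: GuhneToth2009, §6.6 eq. (137)] -/
theorem conjTranspose_stabProj (T : Finset (Fin N)) : (stabProj G T)ᴴ = stabProj G T := by
  ext x y
  rw [conjTranspose_apply, stabProj_apply, stabProj_apply]
  by_cases h : ∀ l, l ∉ T → x l = y l
  · rw [if_pos h, if_pos (fun l hl => (h l hl).symm), star_mul', star_mul', star_chi, star_chi,
      star_pow, mul_comm (chi (edgeParity G y))]
    congr 2
    rw [Complex.star_def, map_div₀, map_one, map_ofNat]
  · rw [if_neg h, if_neg (fun h' => h (fun l hl => (h' l hl).symm)), star_zero]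

/-- `Tr Π_G(T) = 2^{N − |T|}` (as `2^N (1/2)^{|T|}`). [cite: GuhneToth2009, §6.6 eq. (137);
TothGuhne2005Stabilizer, Definition 2 (`2^{−N}Tr(𝒲)`)] -/
theorem trace_stabProj (T : Finset (Fin N)) :
    (stabProj G T).trace = (2 : ℂ) ^ N * (1 / 2 : ℂ) ^ T.card := by
  rw [Matrix.trace, Finset.sum_congr rfl fun x _ =>
    show Matrix.diag (stabProj G T) x = (1 / 2 : ℂ) ^ T.card from by
      rw [Matrix.diag_apply, stabProj_apply, if_pos (fun l _ => rfl), chi_mul_self, mul_one]]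
  rw [Finset.sum_const, Finset.card_univ, Fintype.card_fun, Fintype.card_bool, Fintype.card_fin,
    nsmul_eq_mul]
  push_cast; ring


/-- Entries of `S_k M`: `(S_k M)_{xy} = [Π_{l∈N(k)} (−1)^{x_l}] M_{x⊕e_k, y}` (`graphStab_mulVec_apply`
column by column). [cite: TothGuhne2005Stabilizer, §III.B; GuhneToth2009, §3.4.3 eq. (56)] -/
theorem graphStab_mul_apply (k : Fin N) (M : Matrix (Fin N → Bool) (Fin N → Bool) ℂ)
    (x y : Fin N → Bool) :
    (graphStab G k * M) x y =
      (∏ l ∈ G.neighborFinset k, (if x l then (-1 : ℂ) else 1)) * M (flipAt k x) y :=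
  graphStab_mulVec_apply G k (fun z => M z y) x

/-- Sign bookkeeping: `[Π_{l∈N(k)} (−1)^{x_l}] χ_G(x ⊕ e_k) = χ_G(x)` (`edgeParity_flipAt`).
[cite: HeinEisertBriegel2004, §2; GuhneToth2009, §3.4.3 eqs. (56)–(57)] -/
theorem sign_mul_chi_flipAt (k : Fin N) (x : Fin N → Bool) :
    (∏ l ∈ G.neighborFinset k, (if x l then (-1 : ℂ) else 1)) * chi (edgeParity G (flipAt k x)) =
      chi (edgeParity G x) := by
  rw [edgeParity_flipAt, chi_add, chi_sum]
  simp_rw [chi_bitZ]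
  have hP : (∏ l ∈ G.neighborFinset k, (if x l then (-1 : ℂ) else 1)) *
      (∏ l ∈ G.neighborFinset k, (if x l then (-1 : ℂ) else 1)) = 1 := by
    rw [← Finset.prod_mul_distrib]
    exact Finset.prod_eq_one fun l _ => by split_ifs <;> norm_num
  linear_combination (chi (K := ℂ) (edgeParity G x)) * hP

/-- **The product rule `(𝟙 + S_k)/2 · Π_G(T) = Π_G(T ∪ {k})` for `k ∉ T`** (entrywise: exactly one of
`x`, `x ⊕ e_k` agrees with `y` outside `T` when they agree outside `T ∪ {k}`).
[cite: GuhneToth2009, §6.6 eq. (137)] -/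
theorem half_one_add_graphStab_mul_stabProj {k : Fin N} {T : Finset (Fin N)} (hk : k ∉ T) :
    ((1 / 2 : ℝ) • (1 + graphStab G k)) * stabProj G T = stabProj G (insert k T) := by
  ext x y
  rw [Matrix.smul_mul, Matrix.smul_apply, Matrix.add_mul, Matrix.one_mul, Matrix.add_apply,
    graphStab_mul_apply, stabProj_apply, stabProj_apply, stabProj_apply,
    Finset.card_insert_of_notMem hk, pow_succ, Complex.real_smul]
  have hc : ((1 / 2 : ℝ) : ℂ) = 1 / 2 := by push_cast; ring
  rw [hc]
  by_cases h' : ∀ l, l ∉ insert k T → x l = y l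
  · rw [if_pos h']
    have hoff : ∀ l, l ≠ k → l ∉ T → x l = y l := fun l hlk hl =>
      h' l (by rw [Finset.mem_insert, not_or]; exact ⟨hlk, hl⟩)
    by_cases hxk : x k = y k
    · have hA : ∀ l, l ∉ T → x l = y l := by
        intro l hl
        by_cases hlk : l = k
        · rw [hlk]; exact hxk
        · exact hoff l hlk hl
      have hB : ¬ ∀ l, l ∉ T → flipAt k x l = y l := by
        intro hall
        have h1 := hall k hk
        rw [flipAt_apply_self, ← hxk] at h1
        revert h1
        cases x k <;> decide
      rw [if_pos hA, if_neg hB, mul_zero, add_zero]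
      ring
    · have hA : ¬ ∀ l, l ∉ T → x l = y l := fun hall => hxk (hall k hk)
      have hB : ∀ l, l ∉ T → flipAt k x l = y l := by
        intro l hl
        by_cases hlk : l = k
        · rw [hlk, flipAt_apply_self]
          revert hxk
          cases x k <;> cases y k <;> decide
        · rw [flipAt_apply_of_ne hlk]; exact hoff l hlk hl
      rw [if_neg hA, if_pos hB, zero_add]
      have hs := sign_mul_chi_flipAt G k x
      linear_combination ((1 / 2 : ℂ) * (1 / 2 : ℂ) ^ T.card * chi (K := ℂ) (edgeParity G y)) * hs
  · rw [if_neg h']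
    have hA : ¬ ∀ l, l ∉ T → x l = y l := fun hall =>
      h' (fun l hl => hall l (fun hT => hl (Finset.mem_insert_of_mem hT)))
    have hB : ¬ ∀ l, l ∉ T → flipAt k x l = y l := by
      intro hall
      apply h'
      intro l hl
      rw [Finset.mem_insert, not_or] at hl
      have h1 := hall l hl.2
      rwa [flipAt_apply_of_ne hl.1] at h1
    rw [if_neg hA, if_neg hB, mul_zero, add_zero, mul_zero]

/-- **`Π_G({k}) = (𝟙 + S_k)/2`**, the projector onto the `+1` eigenspace of the generator `S_k`.
[cite: GuhneToth2009, §6.6 eq. (137); TothGuhne2005Stabilizer, Theorem 6 (the factors `(S_k+𝟙)/2`)] -/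
theorem stabProj_singleton (k : Fin N) : stabProj G {k} = (1 / 2 : ℝ) • (1 + graphStab G k) := by
  have h := half_one_add_graphStab_mul_stabProj G (Finset.notMem_empty k)
  rw [stabProj_empty, Matrix.mul_one, Finset.insert_empty] at h
  exact h.symm

/-- `S_k = 2Π_G({k}) − 𝟙`, written additively. [cite: GuhneToth2009, §6.6 eq. (137)] -/
theorem graphStab_eq_stabProj (k : Fin N) :
    graphStab G k = stabProj G {k} + stabProj G {k} - 1 := by
  rw [stabProj_singleton, ← add_smul, show (1 / 2 : ℝ) + 1 / 2 = 1 by norm_num, one_smul]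
  abel

/-- `Π_G({k})² = Π_G({k})` (from `S_k² = 𝟙`). [cite: GuhneToth2009, §6.6 eq. (137)] -/
theorem stabProj_singleton_mul_self (k : Fin N) :
    stabProj G {k} * stabProj G {k} = stabProj G {k} := by
  rw [stabProj_singleton, Matrix.smul_mul, Matrix.mul_smul, smul_smul, mul_add, add_mul, add_mul,
    one_mul, mul_one, one_mul, graphStab_mul_self]
  rw [show (1 : Matrix (Fin N → Bool) (Fin N → Bool) ℂ) + graphStab G k + (graphStab G k + 1) =
    (2 : ℝ) • (1 + graphStab G k) by rw [two_smul]; abel, smul_smul]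
  norm_num

/-- **The product rule `Π_G({k}) Π_G(T) = Π_G(T ∪ {k})`** for every `k` (absorption when `k ∈ T`).
[cite: GuhneToth2009, §6.6 eq. (137) (“If operators `S_k` and `S_l` stabilize `|Ψ⟩`, then so does
their product”)] -/
theorem stabProj_singleton_mul (k : Fin N) (T : Finset (Fin N)) :
    stabProj G {k} * stabProj G T = stabProj G (insert k T) := by
  by_cases hk : k ∈ T
  · have h := half_one_add_graphStab_mul_stabProj G (Finset.notMem_erase k T)
    rw [Finset.insert_erase hk, ← stabProj_singleton] at h
    rw [Finset.insert_eq_of_mem hk, ← h, ← Matrix.mul_assoc, stabProj_singleton_mul_self]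
  · rw [stabProj_singleton]; exact half_one_add_graphStab_mul_stabProj G hk

/-- **`Π_G(T) Π_G(U) = Π_G(T ∪ U)`** (the stabilizer is a commutative group of projector products).
[cite: GuhneToth2009, §6.6 eq. (137)] -/
theorem stabProj_mul_stabProj (T U : Finset (Fin N)) :
    stabProj G T * stabProj G U = stabProj G (T ∪ U) := by
  induction T using Finset.induction_on with
  | empty => rw [stabProj_empty, Matrix.one_mul, Finset.empty_union]
  | insert k T hk ih =>
    rw [← stabProj_singleton_mul G k T, Matrix.mul_assoc, ih, stabProj_singleton_mul,
      Finset.insert_union]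

/-- `Π_G(T)² = Π_G(T)`. [cite: GuhneToth2009, §6.6 eq. (137)] -/
theorem stabProj_mul_self (T : Finset (Fin N)) : stabProj G T * stabProj G T = stabProj G T := by
  rw [stabProj_mul_stabProj, Finset.union_idempotent]

/-- `Π_G(T) Π_G(U) = Π_G(U) Π_G(T)`. [cite: GuhneToth2009, §6.6 eq. (137) (“these stabilizing
operators form a commutative group”)] -/
theorem stabProj_comm (T U : Finset (Fin N)) :
    stabProj G T * stabProj G U = stabProj G U * stabProj G T := by
  rw [stabProj_mul_stabProj, stabProj_mul_stabProj, Finset.union_comm]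

/-- `Π_G(T)|G_N⟩ = |G_N⟩`. [cite: GuhneToth2009, §6.6 eqs. (136)–(137)] -/
theorem stabProj_mulVec_graphStateVec (T : Finset (Fin N)) :
    stabProj G T *ᵥ graphStateVec G = graphStateVec G := by
  have h : stabProj G T * stabProj G Finset.univ = stabProj G Finset.univ := by
    rw [stabProj_mul_stabProj, Finset.union_eq_right.2 (Finset.subset_univ _)]
  have h2 : stabProj G Finset.univ *ᵥ graphStateVec G = graphStateVec G := by
    rw [stabProj_univ]
    ext x
    simp only [mulVec, dotProduct, vecMulVec_apply, Pi.star_apply]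
    simp_rw [mul_assoc, ← Finset.mul_sum]
    have hn := graphStateVec_norm G
    rw [dotProduct] at hn
    simp only [Pi.star_apply] at hn
    rw [hn, mul_one]
  conv_lhs => rw [← h2]
  rw [mulVec_mulVec, h, h2]

end StabProj

/-! ### `A + B ≤ 𝟙 + AB` for commuting projectors; the comparisons `𝒲 − 2𝒲̃ ≥ 0` -/

section Comparison

variable {ι : Type*} [Fintype ι] [DecidableEq ι]

/-- **Two commuting projectors: `⟨A⟩ + ⟨B⟩ ≤ ⟨𝟙⟩ + ⟨AB⟩`** on every vector — `(𝟙 − A)(𝟙 − B)` is again a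
projector, hence positive (the mechanism of “`X_α := 𝒲 − α𝒲̃ ≥ 0` … is positive semidefinite”).
[cite: TothGuhne2005Stabilizer, Theorem 2 (proof) and Theorem 6 (proof, “`𝒲_{C_N} − 2𝒲̃_{C_N} ≥ 0`”);
GuhneToth2009, §6.6 eq. (135)] -/
theorem vecState_add_le_of_commuting_proj {A B : Matrix ι ι ℂ} (hA : Aᴴ = A) (hB : Bᴴ = B)
    (hA2 : A * A = A) (hB2 : B * B = B) (hAB : A * B = B * A) (φ : ι → ℂ) :
    vecState φ A + vecState φ B ≤ (star φ ⬝ᵥ φ).re + vecState φ (A * B) := by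
  have hcomm : (1 - B) * (1 - A) = (1 - A) * (1 - B) := by
    simp only [mul_sub, sub_mul, one_mul, mul_one, hAB]; abel
  have hRh : ((1 - A) * (1 - B))ᴴ = (1 - A) * (1 - B) := by
    rw [conjTranspose_mul, conjTranspose_sub, conjTranspose_sub, conjTranspose_one, hA, hB, hcomm]
  have hA' : (1 - A) * (1 - A) = 1 - A := by
    simp only [mul_sub, sub_mul, one_mul, mul_one, hA2]; abel
  have hB' : (1 - B) * (1 - B) = 1 - B := by
    simp only [mul_sub, sub_mul, one_mul, mul_one, hB2]; abel
  have hR2 : ((1 - A) * (1 - B))ᴴ * ((1 - A) * (1 - B)) = (1 - A) * (1 - B) := by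
    rw [hRh]
    calc (1 - A) * (1 - B) * ((1 - A) * (1 - B))
        = (1 - A) * ((1 - B) * (1 - A)) * (1 - B) := by simp only [mul_assoc]
      _ = (1 - A) * (1 - A) * ((1 - B) * (1 - B)) := by rw [hcomm]; simp only [mul_assoc]
      _ = (1 - A) * (1 - B) := by rw [hA', hB']
  have hpos : 0 ≤ vecState φ ((1 - A) * (1 - B)) := by
    have h := (isPosFunctional_vecState φ).nonneg ((1 - A) * (1 - B))
    rwa [Matrix.star_eq_conjTranspose, hR2] at h
  have hexp : (1 - A) * (1 - B) = 1 - A - B + A * B := by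
    simp only [mul_sub, sub_mul, one_mul, mul_one]; abel
  rw [hexp, map_add, map_sub, map_sub, vecState_one] at hpos
  linarith

end Comparison

/-- **`Σ_{k∈T} ⟨Π_G({k})⟩ ≤ (|T| − 1)⟨𝟙⟩ + ⟨Π_G(T)⟩`** on every vector (induction on `T` with the
two-projector inequality). [cite: TothGuhne2005Stabilizer, Theorem 2 (proof: “Simple calculation leads
to `c_0 = N − 1`. One can check that with this choice `𝒲 − 2𝒲̃ ≥ 0`”) and Theorem 7 (proof)] -/
theorem sum_vecState_stabProj_singleton_le (T : Finset (Fin N)) (φ : (Fin N → Bool) → ℂ) :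
    ∑ k ∈ T, vecState φ (stabProj G {k}) + (star φ ⬝ᵥ φ).re ≤
      T.card * (star φ ⬝ᵥ φ).re + vecState φ (stabProj G T) := by
  induction T using Finset.induction_on with
  | empty =>
    rw [Finset.sum_empty, Finset.card_empty, stabProj_empty, vecState_one]
    push_cast
    linarith
  | insert k T hk ih =>
    rw [Finset.sum_insert hk, Finset.card_insert_of_notMem hk]
    have h2 := vecState_add_le_of_commuting_proj (conjTranspose_stabProj G {k})
      (conjTranspose_stabProj G T) (stabProj_mul_self G {k}) (stabProj_mul_self G T)
      (stabProj_comm G {k} T) φ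
    rw [stabProj_singleton_mul] at h2
    push_cast
    linarith

/-- `|⟨u|v⟩|² = |⟨v|u⟩|²`. [folklore] -/
private theorem normSq_star_dotProduct_comm {ι : Type*} [Fintype ι] (u v : ι → ℂ) :
    Complex.normSq (star u ⬝ᵥ v) = Complex.normSq (star v ⬝ᵥ u) := by
  rw [star_dotProduct, Complex.star_def, Complex.normSq_conj]

/-- `⟨φ|Π_G(V)|φ⟩ = |⟨G_N|φ⟩|²`. [cite: GuhneToth2009, §6.6 eq. (137)] -/
theorem vecState_stabProj_univ (φ : (Fin N → Bool) → ℂ) :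
    vecState φ (stabProj G Finset.univ) = Complex.normSq (star (graphStateVec G) ⬝ᵥ φ) := by
  rw [stabProj_univ, vecState_vecMulVec, normSq_star_dotProduct_comm]

/-- `⟨S_k⟩ = 2⟨Π_G({k})⟩ − ⟨φ|φ⟩`. [cite: GuhneToth2009, §6.6 eq. (137)] -/
theorem vecState_graphStab_eq (k : Fin N) (φ : (Fin N → Bool) → ℂ) :
    vecState φ (graphStab G k) = 2 * vecState φ (stabProj G {k}) - (star φ ⬝ᵥ φ).re := by
  rw [graphStab_eq_stabProj, map_sub, map_add, vecState_one]; ring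

/-- **`Σ_k ⟨S_k⟩ ≤ (N − 2)⟨φ|φ⟩ + 2|⟨G_N|φ⟩|²` on every vector** — the operator inequality
`Σ_k S_k^{(G_N)} ≤ (N−2)𝟙 + 2|G_N⟩⟨G_N|`, i.e. `𝒲^{(G_N)} − 2𝒲̃_{G_N} ≥ 0`.
[cite: TothGuhne2005Stabilizer, Theorem 7 (proof) and Theorem 2 (proof, “`𝒲 − 2𝒲̃ ≥ 0`”)] -/
theorem sum_vecState_graphStab_le (φ : (Fin N → Bool) → ℂ) :
    ∑ k, vecState φ (graphStab G k) ≤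
      (N - 2) * (star φ ⬝ᵥ φ).re + 2 * Complex.normSq (star (graphStateVec G) ⬝ᵥ φ) := by
  have h := sum_vecState_stabProj_singleton_le G Finset.univ φ
  rw [Finset.card_univ, Fintype.card_fin, vecState_stabProj_univ] at h
  simp_rw [vecState_graphStab_eq]
  rw [Finset.sum_sub_distrib, Finset.sum_const, Finset.card_univ, Fintype.card_fin, nsmul_eq_mul,
    ← Finset.mul_sum]
  linarith

/-! ### Theorem 7: the witness `𝒲^{(G_N)} = (N − 1)𝟙 − Σ_k S_k^{(G_N)}` -/

/-- **Theorem 7's witness for genuine `N`-party entanglement, `𝒲^{(G_N)} := (N−1)𝟙 − Σ_k S_k^{(G_N)}`.**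
[cite: TothGuhne2005Stabilizer, Theorem 7 (“a witness detecting genuine `N`-party entanglement can be
defined as `𝒲^{(G_N)} := (N−1)𝟙 − Σ_k S_k^{(G_N)}`”) and, for the GHZ graph, Theorem 2] -/
noncomputable def gsSumWitness : Matrix (Fin N → Bool) (Fin N → Bool) ℂ :=
  ((N : ℝ) - 1) • (1 : Matrix (Fin N → Bool) (Fin N → Bool) ℂ) - ∑ k, graphStab G k

/-- `⟨φ|𝒲^{(G_N)}|φ⟩ = (N−1)⟨φ|φ⟩ − Σ_k ⟨φ|S_k|φ⟩`. [cite: TothGuhne2005Stabilizer, Theorem 7] -/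
theorem vecState_gsSumWitness (φ : (Fin N → Bool) → ℂ) :
    vecState φ (gsSumWitness G) = ((N : ℝ) - 1) * (star φ ⬝ᵥ φ).re - ∑ k, vecState φ (graphStab G k) := by
  rw [gsSumWitness, map_sub, map_smul, map_sum, vecState_one, smul_eq_mul]

/-- `Tr(ϱ𝒲^{(G_N)}) = (N−1)Tr ϱ − Σ_k Tr(ϱS_k)` (real parts). [cite: TothGuhne2005Stabilizer, Theorem 7] -/
theorem trState_gsSumWitness (ρ : Matrix (Fin N → Bool) (Fin N → Bool) ℂ) :
    trState ρ (gsSumWitness G) = ((N : ℝ) - 1) * ρ.trace.re - ∑ k, trState ρ (graphStab G k) := by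
  rw [gsSumWitness, map_sub, map_smul, map_sum, trState_one, smul_eq_mul]

/-- `⟨φ|𝒲̃_{G_N}|φ⟩ = ½⟨φ|φ⟩ − |⟨G_N|φ⟩|²`. [cite: TothGuhne2005Stabilizer, Theorem 6] -/
theorem vecState_graphProjWitness (φ : (Fin N → Bool) → ℂ) :
    vecState φ (graphProjWitness G) =
      1 / 2 * (star φ ⬝ᵥ φ).re - Complex.normSq (star (graphStateVec G) ⬝ᵥ φ) := by
  rw [graphProjWitness, map_sub, vecState_vecMulVec, vecState_apply, smul_mulVec, one_mulVec,
    dotProduct_smul, smul_eq_mul, Complex.re_ofReal_mul, normSq_star_dotProduct_comm]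

/-- **`𝒲^{(G_N)} − 2𝒲̃_{G_N} ≥ 0`** on vectors. [cite: TothGuhne2005Stabilizer, Theorem 7 (proof:
“Then one can prove that [the] witnesses … detect also only genuine multipartite entanglement”) and
Theorem 2 (proof); GuhneToth2009, §6.6 eq. (135) with `α = 2`] -/
theorem two_mul_vecState_graphProjWitness_le_gsSumWitness (φ : (Fin N → Bool) → ℂ) :
    2 * vecState φ (graphProjWitness G) ≤ vecState φ (gsSumWitness G) := by
  rw [vecState_graphProjWitness, vecState_gsSumWitness]
  have h := sum_vecState_graphStab_le G φ
  linarith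

/-- **Theorem 7 (Tóth–Gühne 2005), genuine multipartite part.** For a connected graph `G`,
`Tr(ϱ𝒲^{(G_N)}) ≥ 0` for every biseparable `ϱ`: `𝒲^{(G_N)} = (N−1)𝟙 − Σ_k S_k^{(G_N)}` detects only
genuine `N`-party entanglement. [cite: TothGuhne2005Stabilizer, Theorem 7] -/
theorem tothGuhne_theorem7_gme (hG : G.Connected) {ρ : Matrix (Fin N → Bool) (Fin N → Bool) ℂ}
    (hρ : IsBiseparable ρ) : 0 ≤ trState ρ (gsSumWitness G) := by
  obtain ⟨ι, _, p, ψ, hp, h1, hunit, hψ, rfl⟩ := hρ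
  rw [trState_mixture]
  refine Finset.sum_nonneg fun i _ => mul_nonneg (hp i) ?_
  have h2 := two_mul_vecState_graphProjWitness_le_gsSumWitness G (ψ i)
  have h3 := normSq_graphState_overlap_le_of_isBiseparablePure G hG (hψ i)
  rw [vecState_graphProjWitness] at h2
  linarith

/-- **GME criterion in measured quantities: `Σ_k ⟨S_k^{(G_N)}⟩_ϱ > N − 1 ⟹ ϱ` is genuinely
`N`-partite entangled** (connected `G`). [cite: TothGuhne2005Stabilizer, Theorem 7] -/
theorem not_isBiseparable_of_sum_graphStab_gt (hG : G.Connected)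
    {ρ : Matrix (Fin N → Bool) (Fin N → Bool) ℂ}
    (h : (N : ℝ) - 1 < ∑ k, trState ρ (graphStab G k)) : ¬ IsBiseparable ρ := by
  intro hρ
  have h0 := tothGuhne_theorem7_gme G hG hρ
  rw [trState_gsSumWitness, trace_eq_one_of_isBiseparable hρ, Complex.one_re, mul_one] at h0
  linarith

/-- `⟨G_N|𝒲^{(G_N)}|G_N⟩ = −1`. [cite: TothGuhne2005Stabilizer, Theorem 7; Theorem 2 (noise)] -/
theorem vecState_gsSumWitness_graphStateVec : vecState (graphStateVec G) (gsSumWitness G) = -1 := by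
  rw [vecState_gsSumWitness, graphStateVec_norm, Complex.one_re, mul_one]
  simp_rw [vecState_graphStab_graphStateVec]
  rw [Finset.sum_const, Finset.card_univ, Fintype.card_fin, nsmul_eq_mul, mul_one]; ring

/-- `Tr 𝒲^{(G_N)} = (N−1)2^N`. [cite: TothGuhne2005Stabilizer, Definition 2 (`2^{−N}Tr(𝒲)`)] -/
theorem trace_gsSumWitness : (gsSumWitness G).trace = ((N : ℂ) - 1) * 2 ^ N := by
  rw [gsSumWitness, trace_sub, trace_smul, trace_sum, trace_one_register]
  simp_rw [trace_graphStab]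
  rw [Finset.sum_const_zero, sub_zero, Complex.real_smul]
  push_cast; ring

/-- **`Tr(𝒲^{(G_N)} ϱ(p)) = Np − 1`** on the noisy graph state. [cite: TothGuhne2005Stabilizer,
Theorem 2 (“detects states mixed with noise … if `p_noise < 1/N`”) and Theorem 7] -/
theorem trState_gsSumWitness_noisy (p : ℝ) :
    trState (noisyState (graphStateVec G) p) (gsSumWitness G) = N * p - 1 := by
  rw [trState_noisyState, trace_gsSumWitness, vecState_gsSumWitness_graphStateVec]
  have hre : (((N : ℂ) - 1) * 2 ^ N).re = ((N : ℝ) - 1) * 2 ^ N := by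
    rw [show ((N : ℂ) - 1) * 2 ^ N = ((((N : ℝ) - 1) * 2 ^ N : ℝ) : ℂ) by push_cast; ring,
      Complex.ofReal_re]
  rw [hre]
  have hpos : (2 : ℝ) ^ N ≠ 0 := pow_ne_zero _ two_ne_zero
  field_simp
  ring

/-- **Noise tolerance of `𝒲^{(G_N)}`: the noisy graph state is detected iff `p_noise < 1/N`** (`N ≥ 1`).
[cite: TothGuhne2005Stabilizer, Theorem 2 (“`p_noise < 1/N`. Thus the noise tolerance decreases as
the number of qubits increases”) and Theorem 7] -/
theorem gsSumWitness_detects_iff [NeZero N] (p : ℝ) :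
    trState (noisyState (graphStateVec G) p) (gsSumWitness G) < 0 ↔ p < 1 / N := by
  rw [trState_gsSumWitness_noisy]
  have hN : (0 : ℝ) < N := Nat.cast_pos.mpr (Nat.pos_of_ne_zero (NeZero.ne N))
  rw [lt_div_iff₀ hN]
  constructor <;> intro h <;> linarith [mul_comm p (N : ℝ)]

/-! ### Theorem 6 / Gühne–Tóth (145) with two colours: `3·𝟙 − 2[Π_G(T) + Π_G(Tᶜ)]` -/

/-- **The two-setting witness `𝒲₂(T) := 3·𝟙 − 2[Π_{k∈T}(S_k+𝟙)/2 + Π_{k∉T}(S_k+𝟙)/2]`** for a vertex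
bipartition `T | Tᶜ` (Theorem 6's `𝒲_{C_N}` is `T` = the odd sites of the chain; Gühne–Tóth (145)
with the two colour classes `M₁ = T`, `M₂ = Tᶜ` of a two-colourable graph; when `T`, `Tᶜ` are
independent sets each product is measured with the single local setting `{X_i}_{i∈M_j} ∪ {Z_i}_{i∉M_j}`
— the measurability is not formalised, the witness property below holds for every `T`).
[cite: TothGuhne2005Stabilizer, Theorem 6; GuhneToth2009, §6.6 eqs. (143), (145)] -/
noncomputable def twoSettingWitness (T : Finset (Fin N)) : Matrix (Fin N → Bool) (Fin N → Bool) ℂ :=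
  (3 : ℝ) • (1 : Matrix (Fin N → Bool) (Fin N → Bool) ℂ) - (2 : ℝ) • (stabProj G T + stabProj G Tᶜ)

/-- `⟨φ|𝒲₂(T)|φ⟩ = 3⟨φ|φ⟩ − 2(⟨Π_G(T)⟩ + ⟨Π_G(Tᶜ)⟩)`. [cite: TothGuhne2005Stabilizer, Theorem 6] -/
theorem vecState_twoSettingWitness (T : Finset (Fin N)) (φ : (Fin N → Bool) → ℂ) :
    vecState φ (twoSettingWitness G T) =
      3 * (star φ ⬝ᵥ φ).re - 2 * (vecState φ (stabProj G T) + vecState φ (stabProj G Tᶜ)) := by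
  rw [twoSettingWitness, map_sub, map_smul, map_smul, map_add, vecState_one, smul_eq_mul, smul_eq_mul]

/-- `Tr(ϱ𝒲₂(T)) = 3Tr ϱ − 2(Tr(ϱΠ_G(T)) + Tr(ϱΠ_G(Tᶜ)))` (real parts).
[cite: TothGuhne2005Stabilizer, Theorem 6] -/
theorem trState_twoSettingWitness (T : Finset (Fin N)) (ρ : Matrix (Fin N → Bool) (Fin N → Bool) ℂ) :
    trState ρ (twoSettingWitness G T) =
      3 * ρ.trace.re - 2 * (trState ρ (stabProj G T) + trState ρ (stabProj G Tᶜ)) := by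
  rw [twoSettingWitness, map_sub, map_smul, map_smul, map_add, trState_one, smul_eq_mul, smul_eq_mul]

/-- **`𝒲₂(T) − 2𝒲̃_{G_N} ≥ 0`** on vectors: `⟨Π_G(T)⟩ + ⟨Π_G(Tᶜ)⟩ ≤ ⟨𝟙⟩ + |⟨G_N|φ⟩|²` since
`Π_G(T)Π_G(Tᶜ) = Π_G(V) = |G_N⟩⟨G_N|`. [cite: TothGuhne2005Stabilizer, Theorem 6 (proof:
“using that `𝒲_{C_N} − 2𝒲̃_{C_N} ≥ 0`”); GuhneToth2009, §6.6 eq. (135)] -/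
theorem two_mul_vecState_graphProjWitness_le_twoSettingWitness (T : Finset (Fin N))
    (φ : (Fin N → Bool) → ℂ) :
    2 * vecState φ (graphProjWitness G) ≤ vecState φ (twoSettingWitness G T) := by
  have h := vecState_add_le_of_commuting_proj (conjTranspose_stabProj G T)
    (conjTranspose_stabProj G Tᶜ) (stabProj_mul_self G T) (stabProj_mul_self G Tᶜ)
    (stabProj_comm G T Tᶜ) φ
  rw [stabProj_mul_stabProj, Finset.union_compl, vecState_stabProj_univ] at h
  rw [vecState_graphProjWitness, vecState_twoSettingWitness]
  linarith

/-- **Theorem 6 (Tóth–Gühne 2005) / Gühne–Tóth (145), two colours.** For a connected graph `G` and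
any vertex bipartition `T | Tᶜ`: `Tr(ϱ𝒲₂(T)) ≥ 0` for every biseparable `ϱ` — `𝒲₂(T)` detects only
genuine `N`-party entanglement. [cite: TothGuhne2005Stabilizer, Theorem 6; GuhneToth2009, §6.6
eq. (145)] -/
theorem twoSettingWitness_nonneg_of_isBiseparable (hG : G.Connected) (T : Finset (Fin N))
    {ρ : Matrix (Fin N → Bool) (Fin N → Bool) ℂ} (hρ : IsBiseparable ρ) :
    0 ≤ trState ρ (twoSettingWitness G T) := by
  obtain ⟨ι, _, p, ψ, hp, h1, hunit, hψ, rfl⟩ := hρ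
  rw [trState_mixture]
  refine Finset.sum_nonneg fun i _ => mul_nonneg (hp i) ?_
  have h2 := two_mul_vecState_graphProjWitness_le_twoSettingWitness G T (ψ i)
  have h3 := normSq_graphState_overlap_le_of_isBiseparablePure G hG (hψ i)
  rw [vecState_graphProjWitness] at h2
  linarith

/-- **GME criterion in measured quantities: `⟨Π_{k∈T}(S_k+𝟙)/2⟩_ϱ + ⟨Π_{k∉T}(S_k+𝟙)/2⟩_ϱ > 3/2 ⟹ ϱ`
is genuinely `N`-partite entangled** (connected `G`). [cite: TothGuhne2005Stabilizer, Theorem 6;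
GuhneToth2009, §6.6 eq. (145)] -/
theorem not_isBiseparable_of_stabProj_add_gt (hG : G.Connected) (T : Finset (Fin N))
    {ρ : Matrix (Fin N → Bool) (Fin N → Bool) ℂ}
    (h : 3 / 2 < trState ρ (stabProj G T) + trState ρ (stabProj G Tᶜ)) : ¬ IsBiseparable ρ := by
  intro hρ
  have h0 := twoSettingWitness_nonneg_of_isBiseparable G hG T hρ
  rw [trState_twoSettingWitness, trace_eq_one_of_isBiseparable hρ, Complex.one_re, mul_one] at h0
  linarith

/-- `⟨G_N|Π_G(T)|G_N⟩ = 1`. [cite: GuhneToth2009, §6.6 eqs. (136)–(137)] -/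
theorem vecState_stabProj_graphStateVec (T : Finset (Fin N)) :
    vecState (graphStateVec G) (stabProj G T) = 1 := by
  rw [vecState_apply, stabProj_mulVec_graphStateVec, graphStateVec_norm, Complex.one_re]

/-- `⟨G_N|𝒲₂(T)|G_N⟩ = −1`. [cite: TothGuhne2005Stabilizer, Theorem 6] -/
theorem vecState_twoSettingWitness_graphStateVec (T : Finset (Fin N)) :
    vecState (graphStateVec G) (twoSettingWitness G T) = -1 := by
  rw [vecState_twoSettingWitness, graphStateVec_norm, Complex.one_re, vecState_stabProj_graphStateVec,
    vecState_stabProj_graphStateVec]; ring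

/-- `Tr 𝒲₂(T) = 3·2^N − 2(2^{N−|T|} + 2^{N−|Tᶜ|})`. [cite: TothGuhne2005Stabilizer, Theorem 6
(noise tolerance); GuhneToth2009, §6.6 eq. (144)] -/
theorem trace_twoSettingWitness (T : Finset (Fin N)) :
    (twoSettingWitness G T).trace =
      2 ^ N * (3 - 2 * ((1 / 2 : ℂ) ^ T.card + (1 / 2 : ℂ) ^ Tᶜ.card)) := by
  rw [twoSettingWitness, trace_sub, trace_smul, trace_smul, trace_add, trace_one_register,
    trace_stabProj, trace_stabProj, Complex.real_smul, Complex.real_smul]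
  push_cast; ring

/-- **`Tr(𝒲₂(T) ϱ(p)) = p[4 − 2(2^{−|T|} + 2^{−|Tᶜ|})] − 1`** on the noisy graph state.
[cite: TothGuhne2005Stabilizer, Theorem 6; GuhneToth2009, §6.6 eq. (144)] -/
theorem trState_twoSettingWitness_noisy (T : Finset (Fin N)) (p : ℝ) :
    trState (noisyState (graphStateVec G) p) (twoSettingWitness G T) =
      p * (4 - 2 * ((1 / 2 : ℝ) ^ T.card + (1 / 2 : ℝ) ^ Tᶜ.card)) - 1 := by
  rw [trState_noisyState, trace_twoSettingWitness, vecState_twoSettingWitness_graphStateVec]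
  have hre : ((2 : ℂ) ^ N * (3 - 2 * ((1 / 2 : ℂ) ^ T.card + (1 / 2 : ℂ) ^ Tᶜ.card))).re =
      (2 : ℝ) ^ N * (3 - 2 * ((1 / 2 : ℝ) ^ T.card + (1 / 2 : ℝ) ^ Tᶜ.card)) := by
    rw [show (2 : ℂ) ^ N * (3 - 2 * ((1 / 2 : ℂ) ^ T.card + (1 / 2 : ℂ) ^ Tᶜ.card)) =
      (((2 : ℝ) ^ N * (3 - 2 * ((1 / 2 : ℝ) ^ T.card + (1 / 2 : ℝ) ^ Tᶜ.card)) : ℝ) : ℂ) by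
        push_cast; ring, Complex.ofReal_re]
  rw [hre]
  have hpos : (2 : ℝ) ^ N ≠ 0 := pow_ne_zero _ two_ne_zero
  field_simp
  ring

/-- **Noise tolerance of the two-setting witness** (printed for the cluster state as
`p_noise < (4 − 4/2^{N/2})^{−1}` for even `N`, `[4 − 2(2^{−(N+1)/2} + 2^{−(N−1)/2})]^{−1}` for odd `N`):
`𝒲₂(T)` detects the noisy graph state iff `p_noise < [4 − 2(2^{−|T|} + 2^{−|Tᶜ|})]^{−1}`, for every
bipartition with `T`, `Tᶜ` non-empty. [cite: TothGuhne2005Stabilizer, Theorem 6 (eq. after the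
proof); GuhneToth2009, §6.6 eq. (144)] -/
theorem twoSettingWitness_detects_iff {T : Finset (Fin N)} (hT : T.Nonempty) (hTc : Tᶜ.Nonempty)
    (p : ℝ) :
    trState (noisyState (graphStateVec G) p) (twoSettingWitness G T) < 0 ↔
      p < 1 / (4 - 2 * ((1 / 2 : ℝ) ^ T.card + (1 / 2 : ℝ) ^ Tᶜ.card)) := by
  rw [trState_twoSettingWitness_noisy]
  have ha : (1 / 2 : ℝ) ^ T.card ≤ 1 / 2 := by
    calc (1 / 2 : ℝ) ^ T.card ≤ (1 / 2 : ℝ) ^ 1 :=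
          pow_le_pow_of_le_one (by norm_num) (by norm_num) (Finset.card_pos.mpr hT)
      _ = 1 / 2 := pow_one _
  have hb : (1 / 2 : ℝ) ^ Tᶜ.card ≤ 1 / 2 := by
    calc (1 / 2 : ℝ) ^ Tᶜ.card ≤ (1 / 2 : ℝ) ^ 1 :=
          pow_le_pow_of_le_one (by norm_num) (by norm_num) (Finset.card_pos.mpr hTc)
      _ = 1 / 2 := pow_one _
  have hd : 0 < 4 - 2 * ((1 / 2 : ℝ) ^ T.card + (1 / 2 : ℝ) ^ Tᶜ.card) := by linarith
  rw [lt_div_iff₀ hd]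
  constructor <;> intro h <;> linarith

/-- **“For any number of qubits at least 25 % noise is tolerated”**: for `p_noise < 1/4` the noisy graph
state of a connected graph is detected by `𝒲₂(T)` (any `T`), hence is genuinely `N`-partite entangled. [cite: TothGuhne2005Stabilizer, Theorem 6 (“Thus, for any number of
qubits at least 25 % noise is tolerated”); GuhneToth2009, §6.6 (“For large `N` the limit is
`p_noise = 1/4`”)] -/
theorem not_isBiseparable_noisy_graphState_of_lt_quarter (hG : G.Connected) (T : Finset (Fin N))
    {p : ℝ} (hp : p < 1 / 4) : ¬ IsBiseparable (noisyState (graphStateVec G) p) := by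
  intro hρ
  have h0 := twoSettingWitness_nonneg_of_isBiseparable G hG T hρ
  rw [trState_twoSettingWitness_noisy] at h0
  have ha : (0 : ℝ) < (1 / 2 : ℝ) ^ T.card := pow_pos (by norm_num) _
  have hb : (0 : ℝ) < (1 / 2 : ℝ) ^ Tᶜ.card := pow_pos (by norm_num) _
  have ha1 : (1 / 2 : ℝ) ^ T.card ≤ 1 := pow_le_one₀ (by norm_num) (by norm_num)
  have hb1 : (1 / 2 : ℝ) ^ Tᶜ.card ≤ 1 := pow_le_one₀ (by norm_num) (by norm_num)
  have hc : 0 ≤ 4 - 2 * ((1 / 2 : ℝ) ^ T.card + (1 / 2 : ℝ) ^ Tᶜ.card) := by linarith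
  have h1 : p * (4 - 2 * ((1 / 2 : ℝ) ^ T.card + (1 / 2 : ℝ) ^ Tᶜ.card)) ≤
      1 / 4 * (4 - 2 * ((1 / 2 : ℝ) ^ T.card + (1 / 2 : ℝ) ^ Tᶜ.card)) :=
    mul_le_mul_of_nonneg_right hp.le hc
  linarith

/-! ### The linear cluster state: Theorem 6's `𝒲_{C_N}` and the printed tolerance -/

/-- The sites `k = 1, 3, 5, …` of the chain in the paper's numbering (`k.val` even in the tree's
`0`-based labels): one colour class of the two-colourable chain, carrying the factor
`Π_{odd k}(S_k^{(C_N)}+𝟙)/2` of `𝒲_{C_N}`. [cite: TothGuhne2005Stabilizer, Theorem 6 (“the two settings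
`{X^{(1)},Z^{(2)},X^{(3)},Z^{(4)},…}` and `{Z^{(1)},X^{(2)},Z^{(3)},X^{(4)},…}`”)] -/
def oddSites (N : ℕ) : Finset (Fin N) := Finset.univ.filter fun k => k.val % 2 = 0

/-- **Theorem 6's two-setting witness for the cluster state,
`𝒲_{C_N} := 3·𝟙 − 2[Π_{odd k}(S_k^{(C_N)}+𝟙)/2 + Π_{even k}(S_k^{(C_N)}+𝟙)/2]`** (= Gühne–Tóth (143)).
[cite: TothGuhne2005Stabilizer, Theorem 6; GuhneToth2009, §6.6 eq. (143)] -/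
noncomputable def clusterTwoSettingWitness (N : ℕ) : Matrix (Fin N → Bool) (Fin N → Bool) ℂ :=
  twoSettingWitness (chainGraph N) (oddSites N)

/-- The chain on `N ≥ 1` sites is connected (any `N`, from `chainGraph_connected`).
[cite: TothGuhne2005Stabilizer, §III.B (Fig. 2(a) “Chain”)] -/
theorem chainGraph_connected_of_pos (hN : 1 ≤ N) : (chainGraph N).Connected := by
  obtain ⟨n, rfl⟩ := Nat.exists_eq_add_of_le' hN
  exact chainGraph_connected n

/-- **Theorem 6 (Tóth–Gühne 2005): `Tr(ϱ𝒲_{C_N}) ≥ 0` for every biseparable `ϱ`** — `𝒲_{C_N}` detects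
only genuine `N`-party entanglement (`N ≥ 1`). [cite: TothGuhne2005Stabilizer, Theorem 6
(“detect[s] genuine `N`-party entanglement close to a cluster state”)] -/
theorem tothGuhne_theorem6 (hN : 1 ≤ N) {ρ : Matrix (Fin N → Bool) (Fin N → Bool) ℂ}
    (hρ : IsBiseparable ρ) : 0 ≤ trState ρ (clusterTwoSettingWitness N) :=
  twoSettingWitness_nonneg_of_isBiseparable _ (chainGraph_connected_of_pos hN) _ hρ

/-- **GME criterion for the cluster state in measured quantities**:
`⟨Π_{odd k}(S_k+𝟙)/2⟩_ϱ + ⟨Π_{even k}(S_k+𝟙)/2⟩_ϱ > 3/2 ⟹ ϱ` is genuinely `N`-partite entangled.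
[cite: TothGuhne2005Stabilizer, Theorem 6; GuhneToth2009, §6.6 eq. (143)] -/
theorem not_isBiseparable_of_cluster_stabProj_add_gt (hN : 1 ≤ N)
    {ρ : Matrix (Fin N → Bool) (Fin N → Bool) ℂ}
    (h : 3 / 2 < trState ρ (stabProj (chainGraph N) (oddSites N)) +
      trState ρ (stabProj (chainGraph N) (oddSites N)ᶜ)) : ¬ IsBiseparable ρ :=
  not_isBiseparable_of_stabProj_add_gt _ (chainGraph_connected_of_pos hN) _ h

/-- `#{m < N : m even} = ⌈N/2⌉`. [folklore] -/
private theorem card_filter_range_even (N : ℕ) :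
    ((Finset.range N).filter fun m => m % 2 = 0).card = (N + 1) / 2 := by
  induction N with
  | zero => simp
  | succ N ih =>
    rw [Finset.range_add_one, Finset.filter_insert]
    split_ifs with h
    · rw [Finset.card_insert_of_notMem (by simp), ih]; omega
    · rw [ih]; omega

/-- `|{odd sites}| = ⌈N/2⌉` (`= N/2` for even `N`, `(N+1)/2` for odd `N`). [cite: GuhneToth2009,
§6.6 eq. (144) (the exponents `N/2`, `(N±1)/2`)] -/
theorem card_oddSites (N : ℕ) : (oddSites N).card = (N + 1) / 2 := by
  rw [oddSites, Finset.card_filter,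
    Fin.sum_univ_eq_sum_range (fun m => if m % 2 = 0 then 1 else 0) N, ← Finset.card_filter,
    card_filter_range_even]

/-- `|{even sites}| = ⌊N/2⌋`. [cite: GuhneToth2009, §6.6 eq. (144)] -/
theorem card_oddSites_compl (N : ℕ) : (oddSites N)ᶜ.card = N / 2 := by
  rw [Finset.card_compl, card_oddSites, Fintype.card_fin]; omega

/-- **`Tr(𝒲_{C_N} ϱ(p)) = p[4 − 2(2^{−⌈N/2⌉} + 2^{−⌊N/2⌋})] − 1`** on the noisy cluster state.
[cite: TothGuhne2005Stabilizer, Theorem 6; GuhneToth2009, §6.6 eq. (144)] -/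
theorem trState_clusterTwoSettingWitness_noisy (p : ℝ) :
    trState (noisyState (clusterVec N) p) (clusterTwoSettingWitness N) =
      p * (4 - 2 * ((1 / 2 : ℝ) ^ ((N + 1) / 2) + (1 / 2 : ℝ) ^ (N / 2))) - 1 := by
  rw [clusterTwoSettingWitness, clusterVec, trState_twoSettingWitness_noisy, card_oddSites,
    card_oddSites_compl]

/-- **The printed noise tolerance of `𝒲_{C_N}` (Gühne–Tóth (144))**: the noisy cluster state is detected
iff `p_noise < [4 − 2(2^{−⌈N/2⌉} + 2^{−⌊N/2⌋})]^{−1}` (`N ≥ 2`). [cite: TothGuhne2005Stabilizer,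
Theorem 6 (eq. after the proof); GuhneToth2009, §6.6 eq. (144)] -/
theorem clusterTwoSettingWitness_detects_iff (hN : 2 ≤ N) (p : ℝ) :
    trState (noisyState (clusterVec N) p) (clusterTwoSettingWitness N) < 0 ↔
      p < 1 / (4 - 2 * ((1 / 2 : ℝ) ^ ((N + 1) / 2) + (1 / 2 : ℝ) ^ (N / 2))) := by
  have hT : (oddSites N).Nonempty :=
    ⟨⟨0, by omega⟩, by simp [oddSites]⟩
  have hTc : (oddSites N)ᶜ.Nonempty :=
    ⟨⟨1, by omega⟩, by simp [oddSites]⟩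
  have h := twoSettingWitness_detects_iff (chainGraph N) hT hTc p
  rw [card_oddSites, card_oddSites_compl] at h
  exact h

/-- **Even `N`: `p_noise < (4 − 4/2^{N/2})^{−1}`.** [cite: TothGuhne2005Stabilizer, Theorem 6
(“`(4 − 4/2^{N/2})^{−1}` for even `N`”); GuhneToth2009, §6.6 eq. (144)] -/
theorem clusterTwoSettingWitness_detects_iff_even {m : ℕ} (hm : 1 ≤ m) (p : ℝ) :
    trState (noisyState (clusterVec (2 * m)) p) (clusterTwoSettingWitness (2 * m)) < 0 ↔
      p < 1 / (4 - 4 * (1 / 2 : ℝ) ^ m) := by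
  rw [clusterTwoSettingWitness_detects_iff (by omega), show (2 * m + 1) / 2 = m by omega,
    show 2 * m / 2 = m by omega]
  rw [show (4 : ℝ) - 4 * (1 / 2 : ℝ) ^ m = 4 - 2 * ((1 / 2 : ℝ) ^ m + (1 / 2 : ℝ) ^ m) by ring]

/-- **Odd `N`: `p_noise < [4 − 2(1/2^{(N+1)/2} + 1/2^{(N−1)/2})]^{−1}`.** [cite: TothGuhne2005Stabilizer,
Theorem 6 (“for odd `N`”); GuhneToth2009, §6.6 eq. (144)] -/
theorem clusterTwoSettingWitness_detects_iff_odd {m : ℕ} (hm : 1 ≤ m) (p : ℝ) :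
    trState (noisyState (clusterVec (2 * m + 1)) p) (clusterTwoSettingWitness (2 * m + 1)) < 0 ↔
      p < 1 / (4 - 2 * ((1 / 2 : ℝ) ^ (m + 1) + (1 / 2 : ℝ) ^ m)) := by
  rw [clusterTwoSettingWitness_detects_iff (by omega), show (2 * m + 1 + 1) / 2 = m + 1 by omega,
    show (2 * m + 1) / 2 = m by omega]

/-- **“For any number of qubits at least 25 % noise is tolerated”**: the noisy cluster state with
`p_noise < 1/4` is genuinely `N`-partite entangled (`N ≥ 1`). [cite: TothGuhne2005Stabilizer,
Theorem 6] -/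
theorem not_isBiseparable_noisyCluster_of_lt_quarter (hN : 1 ≤ N) {p : ℝ} (hp : p < 1 / 4) :
    ¬ IsBiseparable (noisyState (clusterVec N) p) :=
  not_isBiseparable_noisy_graphState_of_lt_quarter _ (chainGraph_connected_of_pos hN) (oddSites N) hp

/-- **Theorem 7's `𝒲^{(C_N)} = (N−1)𝟙 − Σ_k S_k^{(C_N)}` for the cluster state**: biseparable states give
`Tr ≥ 0`, and the noisy cluster state is detected iff `p_noise < 1/N` (`N ≥ 1`).
[cite: TothGuhne2005Stabilizer, Theorem 7 and Theorem 2] -/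
theorem cluster_gsSumWitness_nonneg_of_isBiseparable (hN : 1 ≤ N)
    {ρ : Matrix (Fin N → Bool) (Fin N → Bool) ℂ} (hρ : IsBiseparable ρ) :
    0 ≤ trState ρ (gsSumWitness (chainGraph N)) :=
  tothGuhne_theorem7_gme _ (chainGraph_connected_of_pos hN) hρ

/-- The noisy cluster state is detected by `(N−1)𝟙 − Σ_k S_k^{(C_N)}` iff `p_noise < 1/N` (`N ≥ 1`).
[cite: TothGuhne2005Stabilizer, Theorem 2 (“`p_noise < 1/N`”) and Theorem 7] -/
theorem cluster_gsSumWitness_detects_iff [NeZero N] (p : ℝ) :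
    trState (noisyState (clusterVec N) p) (gsSumWitness (chainGraph N)) < 0 ↔ p < 1 / N :=
  gsSumWitness_detects_iff (chainGraph N) p

/-! ## (v2, part 3) Fidelity estimation from the stabilizer data: `|G_N⟩⟨G_N| ≥ ½𝟙 − ½𝒲`

Tóth–Gühne 2005 §III.C, last sentence: “Bounds can be obtained similarly for the fidelity with respect
to the cluster state based on `|C_N⟩⟨C_N| ≥ ½ − ½𝒲_{C_N}`”; Gühne–Tóth 2009 §6.6.4: “This relation
implies that measurement of the right hand side of Eq. (148) can be used to give a lower bound on the
fidelity … Equivalently, the stabilizer witness allows to give a lower bound on the fidelity via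
`F_{GHZ_N} ≥ (1 − ⟨𝒲̃_{GHZ_N}⟩)/2`.”  Here for the graph state of ANY graph (connectedness is not
needed for the fidelity bound) with the two witnesses of part 2: from `𝒲₂(T) − 2𝒲̃_{G_N} ≥ 0`,
`F_G(ϱ) ≥ Tr(ϱΠ_G(T)) + Tr(ϱΠ_G(Tᶜ)) − Tr ϱ = (Tr ϱ − Tr(ϱ𝒲₂(T)))/2` (the two-setting estimate, GHZ
case = `GHZStabilizerWitness.trState_fidBound_le_ghzFidelity`), and from `𝒲^{(G_N)} − 2𝒲̃_{G_N} ≥ 0`,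
`F_G(ϱ) ≥ (Σ_k Tr(ϱS_k) − (N−2)Tr ϱ)/2`; stated for every mixture `ϱ = Σ_i p_i|ψ_i⟩⟨ψ_i|`, `p_i ≥ 0`. -/

/-- **`⟨Π_G(T)⟩ + ⟨Π_G(Tᶜ)⟩ − ⟨φ|φ⟩ ≤ |⟨G_N|φ⟩|²` on vectors** (`|G_N⟩⟨G_N| ≥ Π_G(T) + Π_G(Tᶜ) − 𝟙
= ½𝟙 − ½𝒲₂(T)`). [cite: TothGuhne2005Stabilizer, §III.C (“`|C_N⟩⟨C_N| ≥ ½ − ½𝒲_{C_N}`”);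
GuhneToth2009, §6.6.4 eq. (148)] -/
theorem stabProj_add_sub_norm_le_overlap (T : Finset (Fin N)) (φ : (Fin N → Bool) → ℂ) :
    vecState φ (stabProj G T) + vecState φ (stabProj G Tᶜ) - (star φ ⬝ᵥ φ).re ≤
      Complex.normSq (star (graphStateVec G) ⬝ᵥ φ) := by
  have h := vecState_add_le_of_commuting_proj (conjTranspose_stabProj G T)
    (conjTranspose_stabProj G Tᶜ) (stabProj_mul_self G T) (stabProj_mul_self G Tᶜ)
    (stabProj_comm G T Tᶜ) φ
  rw [stabProj_mul_stabProj, Finset.union_compl, vecState_stabProj_univ] at h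
  linarith

/-- **The two-setting fidelity estimate `F_G(ϱ) ≥ Tr(ϱΠ_G(T)) + Tr(ϱΠ_G(Tᶜ)) − Tr ϱ`** for every
mixture of pure states `ϱ = Σ_i p_i|ψ_i⟩⟨ψ_i|`, `p_i ≥ 0`, every graph and every bipartition `T | Tᶜ`.
[cite: TothGuhne2005Stabilizer, §III.C (“Bounds can be obtained similarly for the fidelity with respect
to the cluster state based on `|C_N⟩⟨C_N| ≥ ½ − ½𝒲_{C_N}`”); GuhneToth2009, §6.6.4 (“can be used to
give a lower bound on the fidelity”)] -/
theorem graphFidelity_ge_stabProj_add {ι : Type*} [Fintype ι] {p : ι → ℝ} (hp : ∀ i, 0 ≤ p i)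
    (ψ : ι → (Fin N → Bool) → ℂ) (T : Finset (Fin N)) :
    trState (∑ i, (p i : ℂ) • vecMulVec (ψ i) (star (ψ i))) (stabProj G T) +
        trState (∑ i, (p i : ℂ) • vecMulVec (ψ i) (star (ψ i))) (stabProj G Tᶜ) -
        (∑ i, (p i : ℂ) • vecMulVec (ψ i) (star (ψ i))).trace.re ≤
      graphFidelity G (∑ i, (p i : ℂ) • vecMulVec (ψ i) (star (ψ i))) := by
  rw [trState_mixture, trState_mixture, graphFidelity, vecState_sum_smul_vecMulVec,
    trace_sum_smul_vecMulVec, Complex.re_sum, ← Finset.sum_add_distrib, ← Finset.sum_sub_distrib]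
  refine Finset.sum_le_sum fun i _ => ?_
  rw [Complex.re_ofReal_mul]
  have h := stabProj_add_sub_norm_le_overlap G T (ψ i)
  nlinarith [hp i]

/-- The same estimate through the witness: **`F_G(ϱ) ≥ (Tr ϱ − Tr(ϱ𝒲₂(T)))/2`** (for `Tr ϱ = 1`:
`F ≥ (1 − ⟨𝒲₂(T)⟩)/2`). [cite: GuhneToth2009, §6.6.4 (“`F_{GHZ_N} ≥ (1 − ⟨𝒲̃_{GHZ_N}⟩)/2`”, here for
graph states); TothGuhne2005Stabilizer, §III.C] -/
theorem graphFidelity_ge_half_sub_twoSettingWitness {ι : Type*} [Fintype ι] {p : ι → ℝ}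
    (hp : ∀ i, 0 ≤ p i) (ψ : ι → (Fin N → Bool) → ℂ) (T : Finset (Fin N)) :
    ((∑ i, (p i : ℂ) • vecMulVec (ψ i) (star (ψ i))).trace.re -
        trState (∑ i, (p i : ℂ) • vecMulVec (ψ i) (star (ψ i))) (twoSettingWitness G T)) / 2 ≤
      graphFidelity G (∑ i, (p i : ℂ) • vecMulVec (ψ i) (star (ψ i))) := by
  have h := graphFidelity_ge_stabProj_add G hp ψ T
  rw [trState_twoSettingWitness]
  linarith

/-- **The full-generator fidelity estimate `F_G(ϱ) ≥ (Σ_k Tr(ϱS_k) − (N−2)Tr ϱ)/2`** (from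
`𝒲^{(G_N)} − 2𝒲̃ ≥ 0`; for `Tr ϱ = 1`: `F ≥ (1 − ⟨𝒲^{(G_N)}⟩)/2`), every mixture of pure states,
every graph. [cite: GuhneToth2009, §6.6.4 (“the stabilizer witness allows to give a lower bound on the
fidelity”); TothGuhne2005Stabilizer, Theorem 7 and §III.C] -/
theorem graphFidelity_ge_sum_graphStab {ι : Type*} [Fintype ι] {p : ι → ℝ} (hp : ∀ i, 0 ≤ p i)
    (ψ : ι → (Fin N → Bool) → ℂ) :
    (∑ k, trState (∑ i, (p i : ℂ) • vecMulVec (ψ i) (star (ψ i))) (graphStab G k) -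
        ((N : ℝ) - 2) * (∑ i, (p i : ℂ) • vecMulVec (ψ i) (star (ψ i))).trace.re) / 2 ≤
      graphFidelity G (∑ i, (p i : ℂ) • vecMulVec (ψ i) (star (ψ i))) := by
  simp_rw [trState_mixture]
  rw [Finset.sum_comm, graphFidelity, vecState_sum_smul_vecMulVec, trace_sum_smul_vecMulVec,
    Complex.re_sum, Finset.mul_sum, ← Finset.sum_sub_distrib]
  have h : ∀ i, ∑ k, p i * vecState (ψ i) (graphStab G k) - ((N : ℝ) - 2) * ((p i : ℂ) *
      (star (ψ i) ⬝ᵥ ψ i)).re ≤ 2 * (p i * Complex.normSq (star (graphStateVec G) ⬝ᵥ ψ i)) := by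
    intro i
    rw [← Finset.mul_sum, Complex.re_ofReal_mul]
    have h1 := sum_vecState_graphStab_le G (ψ i)
    nlinarith [hp i]
  have hs := Finset.sum_le_sum fun i (_ : i ∈ Finset.univ) => h i
  rw [← Finset.mul_sum] at hs
  linarith

/-- The same through the witness: **`F_G(ϱ) ≥ (Tr ϱ − Tr(ϱ𝒲^{(G_N)}))/2`.** [cite: GuhneToth2009,
§6.6.4; TothGuhne2005Stabilizer, Theorem 7] -/
theorem graphFidelity_ge_half_sub_gsSumWitness {ι : Type*} [Fintype ι] {p : ι → ℝ}
    (hp : ∀ i, 0 ≤ p i) (ψ : ι → (Fin N → Bool) → ℂ) :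
    ((∑ i, (p i : ℂ) • vecMulVec (ψ i) (star (ψ i))).trace.re -
        trState (∑ i, (p i : ℂ) • vecMulVec (ψ i) (star (ψ i))) (gsSumWitness G)) / 2 ≤
      graphFidelity G (∑ i, (p i : ℂ) • vecMulVec (ψ i) (star (ψ i))) := by
  have h := graphFidelity_ge_sum_graphStab G hp ψ
  rw [trState_gsSumWitness]
  linarith

/-- **The cluster state: `F_{C_N}(ϱ) ≥ Tr(ϱ Π_{odd k}(S_k+𝟙)/2) + Tr(ϱ Π_{even k}(S_k+𝟙)/2) − Tr ϱ`**
(“`|C_N⟩⟨C_N| ≥ ½ − ½𝒲_{C_N}`”), every mixture of pure states.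
[cite: TothGuhne2005Stabilizer, §III.C (last sentence)] -/
theorem clusterFidelity_ge_stabProj_add {ι : Type*} [Fintype ι] {p : ι → ℝ} (hp : ∀ i, 0 ≤ p i)
    (ψ : ι → (Fin N → Bool) → ℂ) :
    trState (∑ i, (p i : ℂ) • vecMulVec (ψ i) (star (ψ i))) (stabProj (chainGraph N) (oddSites N)) +
        trState (∑ i, (p i : ℂ) • vecMulVec (ψ i) (star (ψ i)))
          (stabProj (chainGraph N) (oddSites N)ᶜ) -
        (∑ i, (p i : ℂ) • vecMulVec (ψ i) (star (ψ i))).trace.re ≤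
      clusterFidelity N (∑ i, (p i : ℂ) • vecMulVec (ψ i) (star (ψ i))) :=
  graphFidelity_ge_stabProj_add _ hp ψ _

/-! ## (v2, part 3) The graph state here IS the graph state of `GraphStateCutRank.lean`

`⟨x|G_N⟩ = 2^{−N/2}(−1)^{q_G(x)}` (`graphStateVec`, labels `Fin N → Bool`) equals
`2^{−N/2}·graphSign G x'` with `x'_i = x_i ∈ 𝔽₂` (`GraphStateCutRank.graphSign = (−1)^{#E(G[supp x])}`),
so Hein–Eisert–Briegel's Schmidt-rank statement `rank_graphState_cut` and the witnesses of this file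
speak about the same vector. [cite: HeinEisertBriegel2004, §2 (“`|G⟩ = Π_{(a,b)∈E} U^{(a,b)}|+⟩^{⊗V}`”,
`U^{(a,b)} = diag(1,1,1,−1)`)] -/

section Bridge

/-- `bitZ b = 1 ↔ b = true`. [cite: HeinEisertBriegel2004, §2 (binary labels)] -/
theorem bitZ_eq_one_iff (b : Bool) : bitZ b = 1 ↔ b = true := by
  cases b <;> decide

/-- **Ordered versus unordered edge count**: `#{(i,j) : i < j, i ∼ j} = #E(H)` for a graph on `Fin N`.
[folklore] -/
private theorem card_filter_lt_adj_eq_card_edgeFinset (H : SimpleGraph (Fin N)) [DecidableRel H.Adj] :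
    ((Finset.univ : Finset (Fin N × Fin N)).filter (fun p => p.1 < p.2 ∧ H.Adj p.1 p.2)).card =
      H.edgeFinset.card := by
  refine Finset.card_bij (fun p _ => s(p.1, p.2)) ?_ ?_ ?_
  · intro p hp
    rw [Finset.mem_filter] at hp
    rw [SimpleGraph.mem_edgeFinset, SimpleGraph.mem_edgeSet]
    exact hp.2.2
  · intro p hp q hq h
    rw [Finset.mem_filter] at hp hq
    rcases Sym2.eq_iff.mp h with ⟨h1, h2⟩ | ⟨h1, h2⟩
    · exact Prod.ext h1 h2
    · exfalso
      have hlt : p.2 < p.1 := by rw [h1, h2]; exact hq.2.1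
      exact lt_asymm hp.2.1 hlt
  · intro e he
    induction e using Sym2.ind with
    | h a b =>
      rw [SimpleGraph.mem_edgeFinset, SimpleGraph.mem_edgeSet] at he
      rcases lt_or_gt_of_ne (H.ne_of_adj he) with hab | hab
      · exact ⟨(a, b), by rw [Finset.mem_filter]; exact ⟨Finset.mem_univ _, hab, he⟩, rfl⟩
      · exact ⟨(b, a), by rw [Finset.mem_filter]; exact ⟨Finset.mem_univ _, hab, he.symm⟩,
          Sym2.eq_swap⟩

/-- **The edge parity is the lit-edge count mod 2**: `q_G(x) = #E(G[supp x]) (mod 2)`.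
[cite: HeinEisertBriegel2004, §2 (`⟨x|G⟩ ∝ Π_{{a,b}∈E}(−1)^{x_a x_b}`)] -/
theorem edgeParity_eq_litEdgeCount (x : Fin N → Bool) :
    edgeParity G x = (litEdgeCount G (fun i => bitZ (x i)) : ZMod 2) := by
  rw [litEdgeCount, ← card_filter_lt_adj_eq_card_edgeFinset, ← Finset.sum_boole,
    Fintype.sum_prod_type, edgeParity]
  refine Finset.sum_congr rfl fun i _ => Finset.sum_congr rfl fun j _ => ?_
  change _ = if (i < j ∧ (G.Adj i j ∧ bitZ (x i) = 1 ∧ bitZ (x j) = 1)) then (1 : ZMod 2) else 0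
  simp only [bitZ_eq_one_iff]
  cases x i <;> cases x j <;> by_cases h : i < j ∧ G.Adj i j <;> simp [bitZ, h]

/-- **`⟨x|G_N⟩ = 2^{−N/2}·graphSign G x`** (same graph state as `GraphStateCutRank.lean`).
[cite: HeinEisertBriegel2004, §2 (“`|G⟩ = Π_{(a,b)∈E} U^{(a,b)}|+⟩^{⊗V}`”)] -/
theorem graphStateVec_eq_graphSign (x : Fin N → Bool) :
    graphStateVec G x = (CHSHOpt.invSqrtTwo : ℂ) ^ N * graphSign G (fun i => bitZ (x i)) := by
  rw [graphStateVec, graphSign, edgeParity_eq_litEdgeCount, chi, ZMod.val_natCast,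
    ← neg_one_pow_eq_pow_mod_two]

end Bridge

/-! ## (v2, part 3) Uniqueness: the eigenvalue equations determine `|G_N⟩`

“Then, the graph state `|G_N⟩` is defined as the `N`-qubit state fulfilling `|G_N⟩ = S_k^{(G_N)}|G_N⟩`”
(TG05 §III.B); “the graph state `|G⟩` is uniquely determined by these eigenvalue equations” (GT09
§3.4.3 after eq. (57)).  With part 2: `S_kψ = ψ` for all `k` forces `Π_G(T)ψ = ψ` for every `T`, and
`Π_G(V) = |G_N⟩⟨G_N|` gives `ψ = ⟨G_N|ψ⟩|G_N⟩`. -/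

/-- A common `+1` eigenvector of all generators is fixed by every partial product `Π_G(T)`.
[cite: GuhneToth2009, §3.4.3 (after eq. (57)) and §6.6 eq. (137)] -/
theorem stabProj_mulVec_of_forall_stab {ψ : (Fin N → Bool) → ℂ} (h : ∀ k, graphStab G k *ᵥ ψ = ψ)
    (T : Finset (Fin N)) : stabProj G T *ᵥ ψ = ψ := by
  induction T using Finset.induction_on with
  | empty => rw [stabProj_empty, one_mulVec]
  | insert k T hk ih =>
    rw [← stabProj_singleton_mul, ← mulVec_mulVec, ih, stabProj_singleton, Matrix.smul_mulVec,
      add_mulVec, one_mulVec, h k, ← two_smul ℝ ψ, smul_smul]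
    norm_num

/-- **The graph state is uniquely determined by `S_k|G_N⟩ = |G_N⟩`**: every common `+1` eigenvector
of the generators is a multiple of `|G_N⟩`, `ψ = ⟨G_N|ψ⟩|G_N⟩`. [cite: GuhneToth2009, §3.4.3 (“the
graph state `|G⟩` is uniquely determined by these eigenvalue equations”); TothGuhne2005Stabilizer,
§III.B (“the graph state `|G_N⟩` is defined as the `N`-qubit state fulfilling `|G_N⟩ = S_k^{(G_N)}|G_N⟩`”)] -/
theorem graphState_unique {ψ : (Fin N → Bool) → ℂ} (h : ∀ k, graphStab G k *ᵥ ψ = ψ) :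
    ψ = (star (graphStateVec G) ⬝ᵥ ψ) • graphStateVec G := by
  have h1 := stabProj_mulVec_of_forall_stab G h Finset.univ
  rw [stabProj_univ] at h1
  have h2 : vecMulVec (graphStateVec G) (star (graphStateVec G)) *ᵥ ψ =
      (star (graphStateVec G) ⬝ᵥ ψ) • graphStateVec G := by
    ext i
    simp [mulVec, dotProduct, vecMulVec_apply, Finset.mul_sum, mul_comm, mul_left_comm]
  rw [h2] at h1
  exact h1.symm

/-- In particular the joint `+1` eigenspace is one-dimensional: a unit common eigenvector has
`|⟨G_N|ψ⟩|² = 1`. [cite: GuhneToth2009, §3.4.3 (after eq. (57))] -/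
theorem normSq_overlap_eq_one_of_forall_stab {ψ : (Fin N → Bool) → ℂ} (h : ∀ k, graphStab G k *ᵥ ψ = ψ)
    (hψ : star ψ ⬝ᵥ ψ = 1) : Complex.normSq (star (graphStateVec G) ⬝ᵥ ψ) = 1 := by
  have h1 := graphState_unique G h
  have h2 : star ψ ⬝ᵥ ψ = Complex.normSq (star (graphStateVec G) ⬝ᵥ ψ) := by
    conv_lhs => rw [h1]
    rw [star_smul, smul_dotProduct, dotProduct_smul, graphStateVec_norm, smul_eq_mul, smul_eq_mul,
      mul_one, Complex.star_def, Complex.normSq_eq_conj_mul_self]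
  rw [← Complex.ofReal_inj, ← h2, hψ, Complex.ofReal_one]

end GraphStateWitness

end Literature.InformationTheory.Entanglement
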